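import Mathlib
import Literature.NumberTheory.EllipticCurves.IwasawaAlgebra
import Literature.NumberTheory.EllipticCurves.Rubin1991.TwoVariableMainConjecture
import Literature.NumberTheory.EllipticCurves.Kobayashi2003.SignedPAdicLFunctionConstantTermProofs
import Literature.NumberTheory.EllipticCurves.Kobayashi2003.SignedColemanKatoZetaJoint
import Literature.NumberTheory.EllipticCurves.KatoFineSelmerDualTorsion
import Literature.NumberTheory.EllipticCurves.Kato2004.IwasawaH1LambdaTorsionFreeProofs
import Literature.NumberTheory.IwasawaTheory.IwasawaAlgebraTwoVarRegularProofs
import Literature.NumberTheory.EllipticCurves.IwasawaAlgebraUnitTwistPair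
import Summits.BirchSwinnertonDyer.BirchSwinnertonDyer.Theorems.SignedBaseChangeAnticyclotomicEisensteinDivisibilitySpecializationHerbrand
import Summits.BirchSwinnertonDyer.BirchSwinnertonDyer.Theorems.ErratumRoadFiveCharIdealTransferTorsion
import Literature.NumberTheory.EllipticCurves.IwasawaAlgebraEisensteinCoefficientRingProofs
import Literature.NumberTheory.EllipticCurves.TwoVariableSelmerDual

/-!
# QtameDoor3 v1.2 (g18) — the THIRD DOOR of the qtame patching engine: `engine_door3` (+ §E12 (F-h) `engine_door3_of_associated`; + §E13 DOOR 4 `engine_door4[_XGr₂]`: the Kato line from the bottom layer)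
(crux `TwoVariableEulerSystemDivisibility`, stmt-BirchSwinnertonDyer-20728, route SignedBaseChange; ideator
bsd-idea-14 g17; companion of `QtameEngine.lean` v1.4 and `IdeaSketchQtame.lean` v4.7 — an idea workfile, NOT a
registered skeleton; the line of record stays `Lines/ratlift.lean` v4; narrative in the card `Ideas/qtame.md` § V#23i⁗).

THE THEOREM (`engine_door3`, §E11.7, axioms `propext · Classical.choice · Quot.sound`): for a finitely generated
`Λ₂`-module `X` (`Λ₂ = ℤ_p⟦T₂⟧⟦T₁⟧`) and `G ∈ Λ₂`,
  `PatchingTarget p X G` (pure UFD algebra, PROVED in the sketch §7 `patchingTarget_holds`)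
  `→ GoodPointExists p` ((GP): good points exist, PROVED in the sketch §9.7 `PB.goodPointExists_holds`)
  `→` Kato-line torsion of `X/(T₂)X` `→ DepthFibreBoundsDVR p X G` (ONE depth function + ONE `z ≠ 0`: fibre bounds
  at every point `u ∈ 𝔪_S` of every complete DVR `S` finite over `ℤ_p` off the zeros of `z`)
  `→ ∃ a, (p^a · G) ⊆ ch_{Λ₂}(X)`.
Compared with door 2 (`engine_doorS'`, QtameEngine v1.4): NO `PatchingBeta`, NO separate non-vertical binder `hnv`,
no root data, no twists / (UNIF) / `VFamily` / (FT) / (LB) hypotheses — the DVR-class fibre bounds serve BOTH the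
vertical primes (§E9–E10, as in door 2) AND the non-vertical ones (§E11, new).

§E11 (new, ≈ 750 lines): for a non-vertical height-one `𝔓 = (F)` of `Λ₂` and `G = F^g G₁`: (GP) gives a good prime
`P` and a height-one `𝔔` of `Λ₂/(P)` through `F̄` avoiding `p̄ Ḡ₁`; the root datum `(S, u₀)` of `P` (§E10) gives the
prime `π = T₂ - u₀` of `Λ_{2,S} = S⟦T₂⟧⟦T₁⟧` over `C P`; LYING OVER along the finite free extension `Λ₂ ⊆ Λ_{2,S}`
gives a prime `Q ⊇ (π)` over `𝔔₂ = 𝔔 + (P)` and `𝔮 = Q/(π)`, of height one in `Λ_{2,S}/(π) ≅ S⟦T₁⟧` (dimension 2,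
`p̄ ∉ 𝔮`); then  `ℓ_𝔓(X) · Σe ≤ Σ_{𝔭 ∋ F, ht 1} ℓ_𝔭(Λ_{2,S} ⊗ X) · ℓ_𝔮(A/𝔭̄)` (flat base change, §E11.4)
`≤ ℓ_𝔮((Λ_{2,S} ⊗ X)/π)` (the dévissage lower bound for FINITELY MANY height-one primes at once, §E11.1)
`≤ g · ℓ_𝔮(A/(F̄))` (fibre transport of the fibre bound at `u₀`, `p̄, Ḡ₁ ∉ 𝔮`) `≤ g · Σe` (cyclic UFD upper bound,
§E11.2), with `Σe = Σ_𝔭 ℓ_𝔭(Λ_{2,S}/(F)) ℓ_𝔮(A/𝔭̄) ∈ [1, ∞)`, whence `ℓ_𝔓(X) ≤ g`, i.e. `𝔓^{ℓ_𝔓(X)} ∣ (G)`.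

SELF-CONTAINED BY NECESSITY: `Cruxes/**` workfiles are not importable on the farm (`remote:stale:unbuilt`) and one
workfile is capped at 200 000 B, so this file carries the dependency cone of `engine_door3` inside QtameEngine v1.4 —
152 of its 228 declarations (+ the 11 of §E11 = 163), each block byte-identical, § headers kept for cross-reference, declarations outside the
cone (doors 1/2: `engine`, `engine_std'`, `engine_doorS'`, twists, currencies, `PatchingBeta`, …) omitted — under the
namespace `…QtameDoor3` (so nothing clashes with `…QtameEngine` should both ever be imported), followed by §E11.

v1.1 (§E12, critic V#23n): a supplier that carries an ERL constant `h` proves the binder for `h * G`; door 3 then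
gives `(p^a · W · G) ⊆ ch(X)` for `h ~ p^m · W` (`engine_door3_of_associated`), i.e. the crux shape iff `W` is a
unit (`engine_door3_of_associated_pow`) — the typed field (F-h) a (KS-Ind-S) supplier must decide.

v1.2 (§E13, g18): DOOR 4 — the Kato-line hypothesis `hKato` of door 3 follows from the BOTTOM LAYER: (BOT)
`p^k · X ⊆ (T₁,T₂) · X` ⟹ `X/(T₂)X` torsion over `Λ₂/(T₂)` (Cayley–Hamilton + `ev_{(0,0)}`, PROVED:
`isTorsion_katoFibre_of_bottomPTorsion`, `engine_door4`, `engine_door4_of_associated[_pow]`); for `X = X_Gr₂`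
(BOT) ⟸ «`p^k · Sel_{∅,0}(K̃_∞,E[p^∞])^{Γ_K} = 0`» (Pontryagin, PROVED: `XGr₂_bottomPTorsion_of_invariants`,
`engine_door4_XGr₂`; one new import `TwoVariableSelmerDual`). The arithmetic behind that statement (bottom-layer
control + finiteness of `Sel_{𝔭-rel,𝔭̄-str}(E/K)[p^∞]` in analytic rank one over `K`) is the dossier `KatoLine.md`.

What the line still owes is ARITHMETIC, unchanged: an inhabitant of `DepthFibreBoundsDVR` (the Kolyvagin-system
bound with uniform error over the DVR class) and Kato-line torsion (or, §E13, (BOT)); (GP) and `PatchingTarget` are proved in the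
sketch, not here (hypotheses of this file). NO `sorry`. BSD is not proved by this file; no summit statement is
proved by this seat.
-/

set_option autoImplicit false
set_option linter.dupNamespace false

open scoped Pointwise TensorProduct

namespace Summit.BirchSwinnertonDyer.BirchSwinnertonDyer.Cruxes.TwoVariableEulerSystemDivisibility.QtameDoor3

open Literature.NumberTheory.EllipticCurves

/-! ## E0. Verbatim restatements from `IdeaSketchQtame.lean` v4.7 (§1 First lemma with proof; §2–§4 and §9.1–§9.3
definitions and Props; small helper lemmas with proofs). Texts byte-identical up to the namespace. -/

/-- Nakayama at a prime: if `s ∉ 𝔭` and `s • M ⊆ π • M` with `π ∈ 𝔭`, then `M_𝔭 = 0`. -/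
theorem subsingleton_localizedModule_of_smul_le
    {R : Type*} [CommRing R] {M : Type*} [AddCommGroup M] [Module R M] [Module.Finite R M]
    (𝔭 : Ideal R) [𝔭.IsPrime] {π s : R} (hπ : π ∈ 𝔭) (hs : s ∉ 𝔭)
    (hsM : ∀ x : M, s • x ∈ π • (⊤ : Submodule R M)) :
    Subsingleton (LocalizedModule 𝔭.primeCompl M) := by
  classical
  set Rp := Localization.AtPrime 𝔭
  set Mp := LocalizedModule 𝔭.primeCompl M
  -- every element of `Mp` lies in `𝔪 • ⊤`
  have hle : (⊤ : Submodule Rp Mp) ≤ IsLocalRing.maximalIdeal Rp • (⊤ : Submodule Rp Mp) := by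
    rintro y -
    induction y using LocalizedModule.induction_on with
    | h m t =>
      obtain ⟨m', -, hm'⟩ := (Submodule.mem_smul_pointwise_iff_exists _ _ _).mp (hsM m)
      have hunit : IsUnit (algebraMap R Rp s) :=
        IsLocalization.map_units Rp (⟨s, hs⟩ : 𝔭.primeCompl)
      obtain ⟨u, hu⟩ := hunit
      have hπmem : algebraMap R Rp π ∈ IsLocalRing.maximalIdeal Rp :=
        (IsLocalization.AtPrime.to_map_mem_maximal_iff Rp 𝔭 π).mpr hπ
      have key : (LocalizedModule.mk m t : Mp) =
          ((↑u⁻¹ : Rp) * algebraMap R Rp π) • (LocalizedModule.mk m' t : Mp) := by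
        have h1 : algebraMap R Rp s • (LocalizedModule.mk m t : Mp) =
            algebraMap R Rp π • (LocalizedModule.mk m' t : Mp) := by
          rw [algebraMap_smul, algebraMap_smul, LocalizedModule.smul'_mk, LocalizedModule.smul'_mk, hm']
        calc (LocalizedModule.mk m t : Mp)
            = (↑u⁻¹ : Rp) • ((↑u : Rp) • (LocalizedModule.mk m t : Mp)) := by
                rw [smul_smul, Units.inv_mul, one_smul]
          _ = (↑u⁻¹ : Rp) • (algebraMap R Rp π • (LocalizedModule.mk m' t : Mp)) := by rw [hu, h1]
          _ = ((↑u⁻¹ : Rp) * algebraMap R Rp π) • (LocalizedModule.mk m' t : Mp) := by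
                rw [mul_smul]
      rw [key]
      exact Submodule.smul_mem_smul (Ideal.mul_mem_left _ _ hπmem) Submodule.mem_top
  have htop : (⊤ : Submodule Rp Mp) = ⊥ :=
    Submodule.eq_bot_of_le_smul_of_le_jacobson_bot _ _ Module.Finite.fg_top hle
      (IsLocalRing.maximalIdeal_le_jacobson _)
  refine subsingleton_of_forall_eq 0 fun y => ?_
  have hy : y ∈ (⊤ : Submodule Rp Mp) := Submodule.mem_top
  rw [htop] at hy
  exact (Submodule.mem_bot Rp).mp hy

/-- **First lemma (vertical exclusion by fibre torsion = Nakayama at a height-one prime). PROVED (v4.3).**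
If the fibre `M/πM` of a finitely generated module over a Noetherian domain at a prime element `π` is
killed by some `s ∉ (π)`, then `M_{(π)} = 0`, i.e. the local length of `M` at `(π)` is `0`. At
`R = ℤ_p⟦T₂⟧⟦T₁⟧`, `π = T₂ - u` this is "fibre Euler-system class at `u` non-zero ⇒ fibre Selmer torsion ⇒
no vertical component at `u`". -/
theorem lengthAt_eq_zero_of_fibre_torsion
    {R : Type*} [CommRing R] [IsDomain R] [IsNoetherianRing R]
    {M : Type*} [AddCommGroup M] [Module R M] [Module.Finite R M]
    {π : R} (hπ : Prime π) {s : R} (hs : s ∉ Ideal.span {π})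
    (hsM : ∀ x : M, s • x ∈ π • (⊤ : Submodule R M)) :
    Literature.NumberTheory.EllipticCurves.Module.lengthAt R M
      ⟨Ideal.span {π}, (Ideal.span_singleton_prime hπ.ne_zero).mpr hπ⟩ = 0 := by
  haveI : (Ideal.span {π}).IsPrime := (Ideal.span_singleton_prime hπ.ne_zero).mpr hπ
  haveI := subsingleton_localizedModule_of_smul_le (M := M) (Ideal.span {π})
    (Ideal.mem_span_singleton_self π) hs hsM
  exact Module.length_eq_zero

/-! ## 2. Fibres of the inner (anticyclotomic) variable over a coefficient ring `O` -/

section Fibres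

variable (O : Type*) [CommRing O]

/-- The vertical prime of `O⟦T₂⟧⟦T₁⟧` through the point `u` of the inner disc: `T₂ - u`, via the constants
embedding `C : O⟦T₂⟧ → O⟦T₂⟧⟦T₁⟧`. (`u = 0`: the KATO LINE.) -/
noncomputable def verticalPrimeO (u : O) : PowerSeries (PowerSeries O) :=
  PowerSeries.C (R := PowerSeries O) (PowerSeries.X - PowerSeries.C (R := O) u)

/-- The SECTION `O⟦T⟧ → O⟦T₂⟧⟦T₁⟧`, `T ↦ T₁` (outer variable), constants to constants. Composed with the
quotient by `(T₂ - u)` it is the isomorphism `O⟦T₂⟧⟦T₁⟧/(T₂ - u) ≅ O⟦T₁⟧`; it is the `Λ_cyc`-structure of a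
qtame fibre. (NOT the constants map `PowerSeries.C`, which is the `Λ_ac`-structure used on the anticyclotomic
line by the tree's Herbrand lemmas — SMUL-TRAP of `IwasawaAlgebraSpecialization`.) -/
noncomputable def fibreSection : PowerSeries O →+* PowerSeries (PowerSeries O) :=
  PowerSeries.map (PowerSeries.C (R := O))

/-- **Fibre bound at `u` with slack `p^t`**: `p^t · G(T₁,u) ∈ ch_{O⟦T₁⟧}(Y/(T₂-u)Y)`, written inside
`O⟦T₂⟧⟦T₁⟧` without an evaluation map: `p^t G ∈ ch(fibre)·(section) + (T₂ - u)`. This is what ONE rational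
Euler-system argument over `ℚ_∞` for the fibre representation `V_f ⊗ Ind ψ_u⁻¹` plus EXACT fibre control
delivers. v2: the engine is the `Λ_cyc`-adic form of Rubin's FUNCTIONAL-AT-`p` theorem (Euler Systems,
Thm 2.2.10; printed Greenberg-condition variant at finite level = LLZ14, arXiv:1311.0175, App. Thm 9.2.3);
Rubin's standard-structure Thm 2.3.3 is VACUOUS here because `d⁻(T_u) = 2 = rank_Λ H¹_Iw(ℚ, T_u)`. -/
def FibreBoundAt (p : ℕ) (Y : Type*) [AddCommGroup Y] [Module (PowerSeries (PowerSeries O)) Y]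
    (G : PowerSeries (PowerSeries O)) (u : O) (t : ℕ) : Prop :=
  letI : Module (PowerSeries O) (QuotSMulTop (verticalPrimeO O u) Y) :=
    Module.compHom _ (fibreSection O)
  (p : PowerSeries (PowerSeries O)) ^ t * G ∈
    (Literature.NumberTheory.EllipticCurves.Module.charIdeal (PowerSeries O)
        (QuotSMulTop (verticalPrimeO O u) Y)).map (fibreSection O) ⊔
      Ideal.span {verticalPrimeO O u}

end Fibres

/-- **Final patching (pure algebra over the UFD `Λ₂`, P4-fixed)**: if every height-one `𝔓 ∌ p` carries
exponent in `ch(X)` at most its exponent in `G`, then `(p^a · G) ⊆ ch(X)` for some `a` (`= μ(X)`).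
(`ch(X) = ∏ 𝔓^{lengthAt}`.) PROVED below (v4.2, `patchingTarget_holds`) from the tree's `Module.charIdeal`
and the tree's PROVED factoriality of `Λ₂` (Auslander–Buchsbaum). -/
def PatchingTarget (p : ℕ) [Fact p.Prime] (X : Type*) [AddCommGroup X]
    [Module (IwasawaAlgebra₂ p) X] [Module.Finite (IwasawaAlgebra₂ p) X] (G : IwasawaAlgebra₂ p) : Prop :=
  Module.IsTorsion (IwasawaAlgebra₂ p) X →
  (∀ 𝔓 : PrimeSpectrum (IwasawaAlgebra₂ p), 𝔓.asIdeal.height = 1 →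
      (p : IwasawaAlgebra₂ p) ∉ 𝔓.asIdeal →
      𝔓.asIdeal ^ (Literature.NumberTheory.EllipticCurves.Module.lengthAt
        (IwasawaAlgebra₂ p) X 𝔓).toNat ∣ Ideal.span {G}) →
    ∃ a : ℕ, Ideal.span {(p : IwasawaAlgebra₂ p) ^ a * G} ≤
      Literature.NumberTheory.EllipticCurves.Module.charIdeal (IwasawaAlgebra₂ p) X

/-! ## 5. NEW: vertical primes by p-adic approximation from neighbouring fibres (model case `u ∈ ℤ_p`) -/

/-! ### E0.1 Good primes of `Λ₁` (sketch §9.1) and the Props (FT), (LB) (sketch §9.3) -/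

section GoodPrimes

variable {p : ℕ} [Fact p.Prime]

theorem C_dvd_of_forall_dvd_coeff {R : Type*} [CommRing R] {a : R} {w : PowerSeries R}
    (h : ∀ n, a ∣ PowerSeries.coeff n w) : PowerSeries.C a ∣ w := by
  choose q hq using h
  refine ⟨PowerSeries.mk q, PowerSeries.ext fun n => ?_⟩
  rw [PowerSeries.coeff_C_mul, PowerSeries.coeff_mk, hq n]

/-- `C a ∣ w` in `R⟦X⟧` forces `a ∣ coeff n w` for every `n`. -/
theorem dvd_coeff_of_C_dvd {R : Type*} [CommRing R] {a : R} {w : PowerSeries R}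
    (h : PowerSeries.C a ∣ w) (n : ℕ) : a ∣ PowerSeries.coeff n w := by
  obtain ⟨q, rfl⟩ := h
  exact ⟨PowerSeries.coeff n q, by rw [PowerSeries.coeff_C_mul]⟩

/-! ### 9.1 Points: prime elements `P ∤ p` of `Λ₁ = ℤ_p⟦T₂⟧` and the finite `ℤ_p`-orders `O_P = Λ₁/(P)` -/

/-- A **good prime** of `Λ₁ = ℤ_p⟦T₂⟧`: a prime element not dividing `p` (equivalently: associated to a
distinguished irreducible polynomial). Its residue ring `O_P = Λ₁/(P)` is a finite `ℤ_p`-order and a domain of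
characteristic zero, and `u_P := T₂ mod P` is a non-unit of `O_P`: these are the algebraic points fed to
`PatchingBeta`. -/
structure GoodPrime (p : ℕ) [Fact p.Prime] where
  /-- the prime element -/
  P : IwasawaAlgebra p
  prime : Prime P
  not_dvd : ¬ P ∣ (p : IwasawaAlgebra p)

namespace GoodPrime

variable (P : GoodPrime p)

/-- `O_P = Λ₁/(P)`. -/
abbrev O : Type := IwasawaAlgebra p ⧸ Ideal.span {P.P}

theorem span_isPrime : (Ideal.span {P.P}).IsPrime :=
  (Ideal.span_singleton_prime P.prime.ne_zero).mpr P.prime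

instance : (Ideal.span {P.P}).IsPrime := P.span_isPrime

instance : IsDomain P.O := Ideal.Quotient.isDomain _

theorem not_isUnit : ¬ IsUnit P.P := P.prime.not_unit

/-- `P` divides no non-zero constant. -/
theorem not_dvd_C {c : ℤ_[p]} (hc : c ≠ 0) : ¬ P.P ∣ PowerSeries.C c := by
  intro h
  have hc' : c = (PadicInt.unitCoeff hc : ℤ_[p]) * (p : ℤ_[p]) ^ c.valuation :=
    PadicInt.unitCoeff_spec hc
  rw [hc', map_mul, map_pow, map_natCast] at h
  have h1 : P.P ∣ (p : IwasawaAlgebra p) ^ c.valuation :=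
    ((P.prime.dvd_or_dvd h).resolve_left fun h' => P.not_isUnit
      (isUnit_of_dvd_unit h' ((PadicInt.unitCoeff hc).isUnit.map _)))
  exact P.not_dvd (P.prime.dvd_of_dvd_pow h1)

theorem algebraMap_injective : Function.Injective (algebraMap ℤ_[p] P.O) := by
  rw [injective_iff_map_eq_zero]
  intro c hc
  by_contra h0
  rw [← Ideal.Quotient.mk_algebraMap, Ideal.Quotient.eq_zero_iff_mem, Ideal.mem_span_singleton,
    ← PowerSeries.C_eq_algebraMap] at hc
  exact P.not_dvd_C h0 hc

instance : CharZero P.O := charZero_of_injective_algebraMap P.algebraMap_injective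

theorem not_isUnit_p : ¬ IsUnit (p : IwasawaAlgebra p) := by
  rw [show (p : IwasawaAlgebra p) = PowerSeries.C (p : ℤ_[p]) by rw [map_natCast],
    PowerSeries.isUnit_iff_constantCoeff, PowerSeries.constantCoeff_C]
  exact PadicInt.irreducible_p.not_isUnit

/-- `P mod p ≠ 0` (as `P ∤ p` and `P` is prime). -/
theorem map_residue_ne_zero : (P.P).map (IsLocalRing.residue ℤ_[p]) ≠ 0 := by
  intro h
  have hcoeff : ∀ n, (p : ℤ_[p]) ∣ PowerSeries.coeff n P.P := by
    intro n
    have := congrArg (PowerSeries.coeff n) h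
    rw [PowerSeries.coeff_map, map_zero, IsLocalRing.residue_eq_zero_iff,
      PadicInt.maximalIdeal_eq_span_p, Ideal.mem_span_singleton] at this
    exact this
  have hdvd : (p : IwasawaAlgebra p) ∣ P.P := by
    have := C_dvd_of_forall_dvd_coeff hcoeff
    rwa [map_natCast] at this
  obtain ⟨Q, hQ⟩ := hdvd
  rcases P.prime.dvd_or_dvd (dvd_of_eq hQ) with h1 | h1
  · exact P.not_dvd h1
  · obtain ⟨R, hR⟩ := h1
    apply not_isUnit_p (p := p)
    have h2 : P.P * 1 = P.P * ((p : IwasawaAlgebra p) * R) := by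
      rw [mul_one, mul_left_comm, ← hR]; exact hQ
    exact IsUnit.of_mul_eq_one R (mul_left_cancel₀ P.prime.ne_zero h2).symm

/-- The Weierstrass factorisation `P = f · h` over `ℤ_p` (`f` distinguished, `h` a unit). -/
theorem isWeierstrassFactorization :
    (P.P).IsWeierstrassFactorization ((P.P).weierstrassDistinguished P.map_residue_ne_zero)
      ((P.P).weierstrassUnit P.map_residue_ne_zero) :=
  PowerSeries.isWeierstrassFactorization_weierstrassDistinguished_weierstrassUnit P.map_residue_ne_zero

/-- `O_P` is a finite `ℤ_p`-module (Weierstrass preparation: `Λ₁/(P) ≅ ℤ_p[X]/(f)`, `f` distinguished). -/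
instance moduleFinite : Module.Finite ℤ_[p] P.O := by
  have H := P.isWeierstrassFactorization
  have hf : ((P.P).weierstrassDistinguished P.map_residue_ne_zero).Monic := H.isDistinguishedAt.monic
  haveI : Module.Finite ℤ_[p]
      (Polynomial ℤ_[p] ⧸ Ideal.span {(P.P).weierstrassDistinguished P.map_residue_ne_zero}) :=
    Module.Finite.of_basis (AdjoinRoot.powerBasis' hf).basis
  exact Module.Finite.equiv H.algEquivQuotient.toLinearEquiv

/-- The point `u_P = T₂ mod P ∈ O_P`. -/
noncomputable def u : P.O := Ideal.Quotient.mk _ PowerSeries.X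

end GoodPrime

variable (p) in
/-- Reduction of coefficients `Λ₁⟦T⟧ → O_P⟦T⟧`. -/
noncomputable def redP (P : GoodPrime p) : PowerSeries (IwasawaAlgebra p) →+* PowerSeries P.O :=
  PowerSeries.map (Ideal.Quotient.mk (Ideal.span {P.P}))

theorem redP_apply (P : GoodPrime p) (F : PowerSeries (IwasawaAlgebra p)) :
    redP p P F = PowerSeries.map (Ideal.Quotient.mk (Ideal.span {P.P})) F := rfl

theorem C_dvd_of_redP_eq_zero (P : GoodPrime p) {F : PowerSeries (IwasawaAlgebra p)} (hF : redP p P F = 0) :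
    PowerSeries.C P.P ∣ F := by
  apply C_dvd_of_forall_dvd_coeff
  intro n
  have := congrArg (PowerSeries.coeff n) hF
  rwa [redP_apply, PowerSeries.coeff_map, map_zero, Ideal.Quotient.eq_zero_iff_mem,
    Ideal.mem_span_singleton] at this

/-- `ker (Λ₂ → O_P⟦T⟧) = P·Λ₂`. -/
theorem ker_redP (P : GoodPrime p) :
    RingHom.ker (redP p P) = Ideal.span {(PowerSeries.C P.P : IwasawaAlgebra₂ p)} := by
  refine le_antisymm (fun F hF => Ideal.mem_span_singleton.mpr (C_dvd_of_redP_eq_zero P hF)) ?_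
  rw [Ideal.span_le, Set.singleton_subset_iff, SetLike.mem_coe, RingHom.mem_ker, redP_apply,
    PowerSeries.map_C, Ideal.Quotient.eq_zero_iff_mem.mpr (Ideal.mem_span_singleton_self _), map_zero]

theorem GoodPrime.C_ne_zero (P : GoodPrime p) : (PowerSeries.C P.P : IwasawaAlgebra₂ p) ≠ 0 := by
  intro h
  have := congrArg (PowerSeries.constantCoeff (R := IwasawaAlgebra p)) h
  rw [PowerSeries.constantCoeff_C, map_zero] at this
  exact P.prime.ne_zero this

/-- `P` stays prime in `Λ₂ = Λ₁⟦T₁⟧`: `Λ₂/PΛ₂ ≅ O_P⟦T₁⟧` is a domain. -/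
theorem GoodPrime.prime_C (P : GoodPrime p) : Prime (PowerSeries.C P.P : IwasawaAlgebra₂ p) := by
  rw [← Ideal.span_singleton_prime P.C_ne_zero, ← ker_redP]
  exact RingHom.ker_isPrime _

theorem natCast_p_eq_C : (p : IwasawaAlgebra₂ p) = PowerSeries.C (p : IwasawaAlgebra p) :=
  (map_natCast (PowerSeries.C (R := IwasawaAlgebra p)) p).symm

variable (p)

/-- The fibre bound of `PatchingBeta`'s hypothesis over a coefficient ring `O`, for `Λ_{2,O} ⊗_{Λ₂} X` and
the image of `G` (the `letI`-algebra structure and tensor product exactly as in `PatchingBeta`). -/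
def FibreBoundOver (O : Type) [CommRing O] [Algebra ℤ_[p] O] (X : Type) [AddCommGroup X]
    [Module (IwasawaAlgebra₂ p) X] (G : IwasawaAlgebra₂ p) (u : O) (t : ℕ) : Prop :=
  letI : Algebra (IwasawaAlgebra₂ p) (PowerSeries (PowerSeries O)) :=
    (PowerSeries.map (PowerSeries.map (algebraMap ℤ_[p] O))).toAlgebra
  FibreBoundAt O p ((PowerSeries (PowerSeries O)) ⊗[IwasawaAlgebra₂ p] X)
    (PowerSeries.map (PowerSeries.map (algebraMap ℤ_[p] O)) G) u t

variable {p}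

end GoodPrimes

/-! ## E1. The quantitative local endgame (PROVED)

Over a Noetherian domain `A` with a height-one prime `𝔔 ∋ q`: a finitely generated module `M` killed by some
`c ≠ 0`, `π = q^N · r ≠ 0`, `v ∉ 𝔔`. Then `k · ℓ_𝔔(A/π) ≤ ℓ_𝔔(M)` and `q^t · π^g · q^m · v ∈ ch_A(M)` with
`g < k` force `N ≤ t + m`: `ch_A(M) ⊆ 𝔔^ℓ` (`ℓ = ℓ_𝔔(M) < ∞`), `ℓ ≤ ℓ_𝔔(A/𝔔^ℓ) ≤ ℓ_𝔔(A/(q^t π^g q^m v)) =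
(t + m)·d + g·ℓ_𝔔(A/π)` (`d = ℓ_𝔔(A/q) ≥ 1`), while `ℓ_𝔔(A/π) ≥ N·d`. In the sketch's (LE) the slack `p^t` and
the prime `π̄` live at DIFFERENT primes (`v̄ ∉ 𝔔`); at a vertical prime they meet at `𝔔 = (p, T₂)/(Q)`, and the
contradiction becomes quantitative — distance `N` against slack `t` plus depth `m`. -/

section Endgame

open Summit.BirchSwinnertonDyer.BirchSwinnertonDyer.Theorems.SignedBaseChangeAcDivSpecialization

variable {A : Type*} [CommRing A] [IsNoetherianRing A] [IsDomain A]

/-- `n ≤ ℓ_𝔮(A/𝔮^n)` for a non-zero prime `𝔮` of a Noetherian domain (verbatim from the sketch §9.5). -/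
theorem natCast_le_lengthAt_quotient_pow (𝔮 : PrimeSpectrum A) (h𝔮 : 𝔮.asIdeal ≠ ⊥) (n : ℕ) :
    (n : ℕ∞) ≤ Module.lengthAt A (A ⧸ 𝔮.asIdeal ^ n) 𝔮 := by
  classical
  induction n with
  | zero => simp
  | succ n ih =>
    have hST : 𝔮.asIdeal ^ (n + 1) ≤ 𝔮.asIdeal ^ n := Ideal.pow_le_pow_right (Nat.le_succ n)
    -- the layer `K = 𝔮^n/𝔮^(n+1) ⊆ A/𝔮^(n+1)`
    let K : Submodule A (A ⧸ 𝔮.asIdeal ^ (n + 1)) :=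
      Submodule.map (𝔮.asIdeal ^ (n + 1)).mkQ (𝔮.asIdeal ^ n)
    have hsplit := Module.lengthAt_eq_add_quotient (R := A) (M := A ⧸ 𝔮.asIdeal ^ (n + 1)) K 𝔮
    have hquot : Module.lengthAt A ((A ⧸ 𝔮.asIdeal ^ (n + 1)) ⧸ K) 𝔮 =
        Module.lengthAt A (A ⧸ 𝔮.asIdeal ^ n) 𝔮 :=
      Module.lengthAt_eq_of_linearEquiv
        (Submodule.quotientQuotientEquivQuotient (𝔮.asIdeal ^ (n + 1)) (𝔮.asIdeal ^ n) hST) 𝔮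
    -- the layer is non-zero at `𝔮`
    have hK : Module.lengthAt A K 𝔮 ≠ 0 := by
      intro h0
      obtain ⟨u, hu, huK⟩ := LocalLength.exists_notMem_forall_smul_eq_zero_of_lengthAt_eq_zero h0
      -- `u • 𝔮^n ⊆ 𝔮^(n+1)`
      have hincl : ∀ x ∈ 𝔮.asIdeal ^ n, u * x ∈ 𝔮.asIdeal ^ (n + 1) := by
        intro x hx
        have h := congrArg Subtype.val
          (huK ⟨(𝔮.asIdeal ^ (n + 1)).mkQ x, Submodule.mem_map_of_mem (f := (𝔮.asIdeal ^ (n + 1)).mkQ) hx⟩)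
        simp only [Submodule.coe_smul, ZeroMemClass.coe_zero, Submodule.mkQ_apply] at h
        rw [← Submodule.Quotient.mk_smul, Submodule.Quotient.mk_eq_zero, smul_eq_mul] at h
        exact h
      -- so `𝔮^n` (a finitely generated torsion-free module) is zero at `𝔮`: absurd
      have hT0 : Module.lengthAt A ↥(𝔮.asIdeal ^ n) 𝔮 = 0 := by
        refine LocalLength.lengthAt_eq_zero_of_forall_exists_notMem 𝔮 fun m => ⟨u, hu, ?_⟩
        rw [Submodule.mem_smul_top_iff, Submodule.coe_smul, Ideal.smul_eq_mul, ← pow_succ']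
        exact hincl m m.2
      obtain ⟨w, hw, hwT⟩ := LocalLength.exists_notMem_forall_smul_eq_zero_of_lengthAt_eq_zero hT0
      obtain ⟨a, ha, ha0⟩ := Submodule.exists_mem_ne_zero_of_ne_bot h𝔮
      have h2 := congrArg Subtype.val (hwT ⟨a ^ n, Ideal.pow_mem_pow ha n⟩)
      simp only [Submodule.coe_smul, ZeroMemClass.coe_zero, smul_eq_mul] at h2
      rcases mul_eq_zero.mp h2 with h3 | h3
      · exact hw (h3 ▸ 𝔮.asIdeal.zero_mem)
      · exact pow_ne_zero n ha0 h3
    calc ((n + 1 : ℕ) : ℕ∞) = (n : ℕ∞) + 1 := by push_cast; rfl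
      _ ≤ Module.lengthAt A (A ⧸ 𝔮.asIdeal ^ n) 𝔮 + Module.lengthAt A K 𝔮 :=
          add_le_add ih (Order.one_le_iff_ne_zero.mpr hK)
      _ = Module.lengthAt A (A ⧸ 𝔮.asIdeal ^ (n + 1)) 𝔮 := by rw [hsplit, hquot, add_comm]

/-- A finite local length as a natural number. -/
theorem exists_eq_natCast_of_ne_top {x : ℕ∞} (h : x ≠ ⊤) : ∃ n : ℕ, x = n :=
  ⟨x.toNat, (ENat.coe_toNat h).symm⟩

/-- **The quantitative endgame.** See the section docstring. -/
theorem endgame_quant {M : Type*} [AddCommGroup M] [Module A M] [Module.Finite A M]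
    {c q π r v : A} {g k t m N : ℕ} (hc : c ≠ 0) (hcM : ∀ x : M, c • x = 0)
    (𝔔 : PrimeSpectrum A) (hht : 𝔔.asIdeal.height = 1) (hq𝔔 : q ∈ 𝔔.asIdeal) (hq : q ≠ 0)
    (hπ : π ≠ 0) (hπr : π = q ^ N * r) (hv𝔔 : v ∉ 𝔔.asIdeal) (hgk : g < k) (hN : t + m < N)
    (H1 : (k : ℕ∞) * Module.lengthAt A (A ⧸ Ideal.span {π}) 𝔔 ≤ Module.lengthAt A M 𝔔)
    (H2 : q ^ t * π ^ g * (q ^ m * v) ∈ Module.charIdeal A M) : False := by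
  classical
  have hr : r ≠ 0 := by rintro rfl; exact hπ (by rw [hπr, mul_zero])
  have hv0 : v ≠ 0 := fun h => hv𝔔 (h ▸ 𝔔.asIdeal.zero_mem)
  have hcM' : Module.IsTorsionBy A M c := fun x => hcM x
  have hT : Module.IsTorsion A M := fun x => ⟨⟨c, mem_nonZeroDivisors_of_ne_zero hc⟩, hcM x⟩
  -- `ℓ = ℓ_𝔔(M) < ∞`, `x ∈ 𝔔^ℓ`
  have hℓtop : Module.lengthAt A M 𝔔 ≠ ⊤ := Module.lengthAt_ne_top_of_isTorsionBy hc hcM' 𝔔 hht.le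
  have hmem : q ^ t * π ^ g * (q ^ m * v) ∈ 𝔔.asIdeal ^ (Module.lengthAt A M 𝔔).toNat :=
    Summit.BirchSwinnertonDyer.Rank1Residual.X11b.CongruenceLimit.charIdeal_le_pow_lengthAt
      (M := M) hT 𝔔 hht H2
  -- cyclic lengths are finite
  have hcyc_top : ∀ {a : A}, a ≠ 0 → Module.lengthAt A (A ⧸ Ideal.span {a}) 𝔔 ≠ ⊤ := by
    intro a ha
    refine Module.lengthAt_ne_top_of_isTorsionBy (M := A ⧸ Ideal.span {a}) ha (fun x => ?_) 𝔔 hht.le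
    obtain ⟨b, rfl⟩ := Ideal.Quotient.mk_surjective x
    rw [Algebra.smul_def, Ideal.Quotient.algebraMap_eq, ← map_mul, Ideal.Quotient.eq_zero_iff_mem]
    exact Ideal.mul_mem_right b _ (Ideal.mem_span_singleton_self a)
  -- `d = ℓ_𝔔(A/q) ≥ 1`
  have hd1 : 1 ≤ Module.lengthAt A (A ⧸ Ideal.span {q}) 𝔔 := by
    have hle : Ideal.span {q} ≤ 𝔔.asIdeal := (Ideal.span_singleton_le_iff_mem _).mpr hq𝔔
    calc (1 : ℕ∞) = Module.lengthAt A (A ⧸ 𝔔.asIdeal) 𝔔 := (Module.lengthAt_quotient_self 𝔔).symm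
      _ ≤ Module.lengthAt A (A ⧸ Ideal.span {q}) 𝔔 :=
          Module.lengthAt_le_of_surjective (Submodule.factor hle) (Submodule.factor_surjective hle) 𝔔
  -- `ℓ_𝔔(A/π) = N·d + ℓ_𝔔(A/r)`
  have hLeq : Module.lengthAt A (A ⧸ Ideal.span {π}) 𝔔 =
      N • Module.lengthAt A (A ⧸ Ideal.span {q}) 𝔔 + Module.lengthAt A (A ⧸ Ideal.span {r}) 𝔔 := by
    rw [hπr, Module.lengthAt_quotient_span_singleton_mul r (pow_ne_zero N hq) 𝔔,
      Module.lengthAt_quotient_span_singleton_pow hq N 𝔔]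
  -- `ℓ ≤ ℓ_𝔔(A/𝔔^ℓ) ≤ ℓ_𝔔(A/x) = t·d + g·ℓ_𝔔(A/π) + m·d + 0`
  have h𝔔ne : 𝔔.asIdeal ≠ ⊥ := fun h => hq (by rw [h, Ideal.mem_bot] at hq𝔔; exact hq𝔔)
  have hN1 := natCast_le_lengthAt_quotient_pow 𝔔 h𝔔ne (Module.lengthAt A M 𝔔).toNat
  have hle2 : Module.lengthAt A (A ⧸ 𝔔.asIdeal ^ (Module.lengthAt A M 𝔔).toNat) 𝔔 ≤
      Module.lengthAt A (A ⧸ Ideal.span {q ^ t * π ^ g * (q ^ m * v)}) 𝔔 := by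
    have hle : Ideal.span {q ^ t * π ^ g * (q ^ m * v)} ≤ 𝔔.asIdeal ^ (Module.lengthAt A M 𝔔).toNat :=
      (Ideal.span_singleton_le_iff_mem _).mpr hmem
    exact Module.lengthAt_le_of_surjective (Submodule.factor hle) (Submodule.factor_surjective hle) 𝔔
  have hxeq : Module.lengthAt A (A ⧸ Ideal.span {q ^ t * π ^ g * (q ^ m * v)}) 𝔔 =
      t • Module.lengthAt A (A ⧸ Ideal.span {q}) 𝔔 + g • Module.lengthAt A (A ⧸ Ideal.span {π}) 𝔔 +
        m • Module.lengthAt A (A ⧸ Ideal.span {q}) 𝔔 := by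
    rw [Module.lengthAt_quotient_span_singleton_mul (q ^ m * v)
        (mul_ne_zero (pow_ne_zero t hq) (pow_ne_zero g hπ)) 𝔔,
      Module.lengthAt_quotient_span_singleton_mul (π ^ g) (pow_ne_zero t hq) 𝔔,
      Module.lengthAt_quotient_span_singleton_mul v (pow_ne_zero m hq) 𝔔,
      Module.lengthAt_quotient_span_singleton_pow hq t 𝔔, Module.lengthAt_quotient_span_singleton_pow hπ g 𝔔,
      Module.lengthAt_quotient_span_singleton_pow hq m 𝔔,
      Module.lengthAt_quotient_eq_zero_of_not_le (I := Ideal.span {v})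
        (by rwa [Ideal.span_singleton_le_iff_mem]), add_zero]
  -- pass to `ℕ`
  obtain ⟨ℓ₀, hℓ₀⟩ := exists_eq_natCast_of_ne_top hℓtop
  obtain ⟨d₀, hd₀⟩ := exists_eq_natCast_of_ne_top (hcyc_top hq)
  obtain ⟨L₀, hL₀⟩ := exists_eq_natCast_of_ne_top (hcyc_top hπ)
  obtain ⟨R₀, hR₀⟩ := exists_eq_natCast_of_ne_top (hcyc_top hr)
  have key : (k : ℕ∞) * L₀ ≤ t • (d₀ : ℕ∞) + g • (L₀ : ℕ∞) + m • (d₀ : ℕ∞) := by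
    calc (k : ℕ∞) * L₀ = (k : ℕ∞) * Module.lengthAt A (A ⧸ Ideal.span {π}) 𝔔 := by rw [hL₀]
      _ ≤ Module.lengthAt A M 𝔔 := H1
      _ = (Module.lengthAt A M 𝔔).toNat := (ENat.coe_toNat hℓtop).symm
      _ ≤ _ := hN1
      _ ≤ _ := hle2
      _ = _ := hxeq
      _ = _ := by rw [hd₀, hL₀]
  rw [hd₀, hR₀, hL₀] at hLeq
  rw [hd₀] at hd1
  simp only [nsmul_eq_mul] at key hLeq
  have key' : k * L₀ ≤ t * d₀ + g * L₀ + m * d₀ := by exact_mod_cast key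
  have hLeq' : L₀ = N * d₀ + R₀ := by exact_mod_cast hLeq
  have hd1' : 1 ≤ d₀ := by exact_mod_cast hd1
  -- `(k - g)·L₀ ≤ (t + m)·d₀`, `L₀ ≥ N·d₀ ≥ (t + m + 1)·d₀`
  have h1 : (g + 1) * L₀ ≤ k * L₀ := Nat.mul_le_mul_right L₀ hgk
  have h2 : L₀ ≤ (t + m) * d₀ := by nlinarith
  have h3 : (t + m + 1) * d₀ ≤ N * d₀ := Nat.mul_le_mul_right d₀ hN
  nlinarith

end Endgame

/-! ## E2. The depth lemma (PROVED): `p`-adic depth of a non-zero element at a height-one prime -/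

section Depth

variable {A : Type*} [CommRing A] [IsNoetherianRing A] [IsDomain A]

/-- **Depth.** For a height-one prime `𝔔` of a Noetherian domain, `q ∈ 𝔔` and `y ≠ 0` there are `m`, `s ∉ 𝔔`
and `h` with `s · q^m = y · h` (if `y ∈ 𝔔`, `𝔔` is minimal over `(y)`, so `𝔔 A_𝔔 = √(y A_𝔔)` and
`q^m ∈ y A_𝔔`; if `y ∉ 𝔔` take `m = 0`, `s = y`). -/
theorem exists_depth (𝔔 : PrimeSpectrum A) (hht : 𝔔.asIdeal.height = 1) {q y : A}
    (hq : q ∈ 𝔔.asIdeal) (hy : y ≠ 0) :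
    ∃ (m : ℕ) (s h : A), s ∉ 𝔔.asIdeal ∧ s * q ^ m = y * h := by
  classical
  by_cases hy𝔔 : y ∈ 𝔔.asIdeal
  swap
  · exact ⟨0, y, 1, hy𝔔, by ring⟩
  -- `𝔔` is a minimal prime of `(y)`
  have hmin : 𝔔.asIdeal ∈ (Ideal.span {y}).minimalPrimes := by
    refine ⟨⟨𝔔.isPrime, (Ideal.span_singleton_le_iff_mem _).mpr hy𝔔⟩, ?_⟩
    rintro 𝔮 ⟨h𝔮, hy𝔮⟩ h𝔮𝔔
    haveI := h𝔮
    have h𝔮ne : 𝔮 ≠ ⊥ := fun h => hy (by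
      have := hy𝔮 (Ideal.mem_span_singleton_self y)
      rwa [h, Ideal.mem_bot] at this)
    have h1 : 𝔔.asIdeal.height ≤ 𝔮.height := by
      rw [hht, Order.one_le_iff_ne_zero, Ne, Ideal.height_eq_zero_iff_eq_bot]
      exact h𝔮ne
    exact (Ideal.eq_of_le_of_height_le (I := 𝔮) (J := 𝔔.asIdeal) h𝔮𝔔 h1).ge
  -- localise at `𝔔`
  let B := Localization.AtPrime 𝔔.asIdeal
  have hrad := IsLocalization.AtPrime.radical_map_of_mem_minimalPrimes (A := B) 𝔔.asIdeal
    (Ideal.span {y}) hmin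
  have hqrad : algebraMap A B q ∈ ((Ideal.span {y}).map (algebraMap A B)).radical := by
    rw [hrad]; exact Ideal.mem_map_of_mem _ hq
  obtain ⟨m, hm⟩ := hqrad
  rw [← map_pow, IsLocalization.mem_map_algebraMap_iff 𝔔.asIdeal.primeCompl B] at hm
  obtain ⟨⟨⟨a, ha⟩, ⟨b, hb⟩⟩, hab⟩ := hm
  simp only at hab
  rw [← map_mul, IsLocalization.eq_iff_exists 𝔔.asIdeal.primeCompl B] at hab
  obtain ⟨⟨e, he⟩, hab⟩ := hab
  simp only at hab
  obtain ⟨a', rfl⟩ := Ideal.mem_span_singleton'.mp ha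
  refine ⟨m, e * b, e * a', ?_, ?_⟩
  · intro hmem
    rcases 𝔔.isPrime.mem_or_mem hmem with h | h
    · exact he h
    · exact hb h
  · calc e * b * q ^ m = e * (q ^ m * b) := by ring
      _ = e * (a' * y) := hab
      _ = y * (e * a') := by ring

end Depth

/-! ## E3. The prime `𝔔̄_Q = (p, T₂)/(Q)` of `Λ₂/(Q)` (PROVED)

`𝔔₀ = ker (Λ₂ → 𝔽_p⟦T₁⟧) = (p, T₂)` has height `2` (`≠ 𝔪`, `dim Λ₂ = 3`); for a good prime `Q` of `Λ₁`,
`C Q ∈ 𝔔₀` and `𝔔̄_Q = 𝔔₀/(C Q)` is a height-one prime of the domain `Λ₂/(C Q)` through `p̄`: a prime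
`𝔮̄ ∋ p̄` below `𝔔̄_Q` lifts to `(C Q) ⊊ 𝔮 ⊆ 𝔔₀`, `ht 𝔮 ≥ 2 ≥ ht 𝔔₀`, so `𝔮 = 𝔔₀` — `𝔔̄_Q` is minimal over the
principal ideal `(p̄)` (Krull). It is the ONLY prime of `Λ₂/(C Q)` above `p̄`, for every `Q`: this is where the
fibres of all approximants of a vertical prime are read, with no comparison of residue orders. -/

section KerResidue

open Literature.NumberTheory.IwasawaTheory

variable {p : ℕ} [Fact p.Prime]

/-- In a Noetherian ring: a prime strictly above a principal prime `(π)`, `π` a non-zero-divisor, has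
height `≥ 2` (sketch §9.7). -/
theorem two_le_height_of_span_lt {R : Type*} [CommRing R] [IsNoetherianRing R] {π : R}
    (hπ : π ∈ nonZeroDivisors R) [(Ideal.span {π}).IsPrime] {𝔔 : Ideal R} [𝔔.IsPrime]
    (hlt : Ideal.span {π} < 𝔔) : (2 : ℕ∞) ≤ 𝔔.height := by
  have h1 := Ideal.one_le_height_span_singleton_of_mem_nonZeroDivisors hπ
  have h2 := Ideal.height_strict_mono_of_isPrime hlt
  calc (2 : ℕ∞) = 1 + 1 := one_add_one_eq_two.symm
    _ ≤ (Ideal.span {π}).height + 1 := add_le_add h1 le_rfl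
    _ ≤ 𝔔.height := Order.add_one_le_of_lt h2

end KerResidue

/-! ## E4. The vertical theorem for EVERY good prime (PROVED)

`P` a good prime of `Λ₁` (any Weierstrass degree), `π = C P`, `k = ℓ_{(π)}(X)`, `G = π^g · G₁`, `π ∤ G₁`.
Suppose `g < k`. DEPTH (E2 at `𝔔̄_P`): `s₀ p^m ≡ G₁ h₀ (mod π)` with `s₀ ∉ 𝔔₀`. AVOIDANCE (`exists_avoid`):
a non-zero `w ∈ Λ₁`, divisible by `P` and by one `Λ₁`-element under each of the finitely many height-one
support primes of `X`; a good prime `Q ∤ w` then has `Q ≁ P` and `ℓ_{(Q)}(X) = 0`, whence an annihilator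
`u ∉ (Q)`. FAMILY (`VFamily`): such a `Q` with `P ≡ Q (mod p^N)`, `N ≥ m + 1 + t`, and the fibre bound
`p^t G ∈ ch(fibre at Q)`. Read in `A = Λ₂/(Q)` at `𝔔 = 𝔔̄_Q ∋ q = p̄`: `π̄ = q^N · C r̄`, `Ḡ₁ h̄₀ = q^m · v̄`
with `v = s₀ - p^{N-m} (C r) r₁ ∉ 𝔔₀`; (FT) gives `q^t π̄^g q^m v̄ ∈ ch_A(X/QX)`, (LB) gives
`k · ℓ_𝔔(A/π̄) ≤ ℓ_𝔔(X/QX)`; `endgame_quant` ⟹ `N ≤ t + m`, contradiction. -/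

section Vertical

open Summit.BirchSwinnertonDyer.BirchSwinnertonDyer.Theorems.SignedBaseChangeAcDivSpecialization

variable {p : ℕ} [Fact p.Prime]

/-- The point `(C P) ∈ Spec Λ₂` of a good prime. -/
noncomputable def GoodPrime.pt (P : GoodPrime p) : PrimeSpectrum (IwasawaAlgebra₂ p) :=
  ⟨Ideal.span {(PowerSeries.C P.P : IwasawaAlgebra₂ p)},
    (Ideal.span_singleton_prime P.C_ne_zero).mpr P.prime_C⟩

theorem GoodPrime.pt_asIdeal (P : GoodPrime p) :
    P.pt.asIdeal = Ideal.span {(PowerSeries.C P.P : IwasawaAlgebra₂ p)} := rfl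

theorem GoodPrime.height_pt (P : GoodPrime p) : P.pt.asIdeal.height = 1 :=
  Ideal.height_span_singleton_eq_one_of_mem_nonZeroDivisors (mem_nonZeroDivisors_of_ne_zero P.C_ne_zero)
    P.prime_C.not_unit

end Vertical

/-! ## E6. Classification of the height-one primes `𝔓 ∌ p` and the END-TO-END engine (PROVED)

A height-one prime `𝔓` of `Λ₂` with `p ∉ 𝔓` is either NON-VERTICAL (`𝔓 ∩ Λ₁ = 0`, handled by `PatchingBeta`)
or `𝔓 ∩ Λ₁ ∋` a prime element `P` of the UFD `Λ₁` with `P ∤ p`, and then `𝔓 = (C P)` (a height-one prime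
containing a prime element is generated by it): `𝔓 = P.pt` for a GOOD prime `P`. At a good prime the exponent
bound comes from the First lemma (fibre torsion ⟹ exponent `0`) or from `vertical_dvd` (VFamily).
`PatchingTarget` then patches the exponents into `(p^a G) ⊆ ch_{Λ₂}(X)`. -/

section Engine

variable {p : ℕ} [Fact p.Prime]

/-- **Classification.** A height-one prime `𝔓 ∌ p` of `Λ₂` meeting `Λ₁ ∖ 0` is `(C P)` for a good prime `P`. -/
theorem exists_goodPrime_of_comap_ne_bot (𝔓 : PrimeSpectrum (IwasawaAlgebra₂ p))
    (hht : 𝔓.asIdeal.height = 1) (hp : (p : IwasawaAlgebra₂ p) ∉ 𝔓.asIdeal)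
    (hvert : Ideal.comap (PowerSeries.C (R := IwasawaAlgebra p)) 𝔓.asIdeal ≠ ⊥) :
    ∃ P : GoodPrime p, 𝔓 = P.pt := by
  obtain ⟨P₀, hmem, hprime⟩ := Ideal.IsPrime.exists_mem_prime_of_ne_bot
    (inferInstance : (Ideal.comap (PowerSeries.C (R := IwasawaAlgebra p)) 𝔓.asIdeal).IsPrime) hvert
  rw [Ideal.mem_comap] at hmem
  have hP₀p : ¬ P₀ ∣ (p : IwasawaAlgebra p) := fun h =>
    hp (by rw [natCast_p_eq_C]; exact mem_of_dvd_of_mem (map_dvd PowerSeries.C h) hmem)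
  refine ⟨⟨P₀, hprime, hP₀p⟩, PrimeSpectrum.ext ?_⟩
  exact Ideal.eq_span_singleton_of_height_eq_one hht hmem (GoodPrime.prime_C ⟨P₀, hprime, hP₀p⟩)
  where
  /-- `π ∣ z`, `π ∈ 𝔓` ⟹ `z ∈ 𝔓` -/
  mem_of_dvd_of_mem {π z : IwasawaAlgebra₂ p} {I : Ideal (IwasawaAlgebra₂ p)} (h : π ∣ z) (hπ : π ∈ I) :
      z ∈ I := by obtain ⟨c, rfl⟩ := h; exact I.mul_mem_right c hπ

variable (p) in
/-- **(FT_P) Fibre torsion at the good prime `P`**: the fibre `X/(C P)X` is killed by some `s ∉ (C P)` — the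
First lemma's hypothesis (at `P = T₂` this is the torsion of `X(K_Δ)`, supplied by Kato, sketch §G′/§H.2). -/
def FibreTorsionAt (P : GoodPrime p) (X : Type) [AddCommGroup X] [Module (IwasawaAlgebra₂ p) X] : Prop :=
  ∃ s : IwasawaAlgebra₂ p, s ∉ Ideal.span {(PowerSeries.C P.P : IwasawaAlgebra₂ p)} ∧
    ∀ x : X, s • x ∈ (PowerSeries.C P.P : IwasawaAlgebra₂ p) • (⊤ : Submodule (IwasawaAlgebra₂ p) X)

end Engine

/-! ## E7. Currencies of the two vertical inputs (PROVED)

(a) `FibreTorsionAt P X` ⟺ the fibre `X/(C P)X` is a torsion module over the domain `Λ₂/(C P)` — the standard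
currency; on the KATO LINE `P = T₂` (`katoLine`, the good prime `X ∈ Λ₁ = ℤ_p⟦T₂⟧`) this is «`X/T₂X` is
`Λ₂/(T₂) = ℤ_p⟦T₁⟧`-torsion», the output of the sketch's §H.2 rank bookkeeping (`D ≢ 0`).
(b) (UNIF) in the twisted-translate language — slack bounded by `t₀` on a punctured `p`-adic neighbourhood of
`P`, off finitely many exceptional twists (the (Q1-β) exceptions) — implies `TwistBounds` (sublinear slack):
the principal units `1 + p^N·n`, `n ∈ ℕ`, are infinitely many. -/

section Currencies

variable {p : ℕ} [Fact p.Prime]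

/-- `FibreTorsionAt` from torsion of the fibre over the quotient domain. -/
theorem fibreTorsionAt_of_isTorsion (P : GoodPrime p) (X : Type) [AddCommGroup X]
    [Module (IwasawaAlgebra₂ p) X] [Module.Finite (IwasawaAlgebra₂ p) X]
    (hT : Module.IsTorsion (IwasawaAlgebra₂ p ⧸ Ideal.span {(PowerSeries.C P.P : IwasawaAlgebra₂ p)})
      (QuotSMulTop (PowerSeries.C P.P : IwasawaAlgebra₂ p) X)) :
    FibreTorsionAt p P X := by
  classical
  set π : IwasawaAlgebra₂ p := PowerSeries.C P.P with hπdef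
  haveI : (Ideal.span {π}).IsPrime := (Ideal.span_singleton_prime P.prime_C.ne_zero).mpr P.prime_C
  haveI : IsScalarTower (IwasawaAlgebra₂ p) (IwasawaAlgebra₂ p ⧸ Ideal.span {π}) (QuotSMulTop π X) :=
    ⟨fun r' a x => by
      obtain ⟨a, rfl⟩ := Ideal.Quotient.mk_surjective a
      obtain ⟨x, rfl⟩ := Submodule.mkQ_surjective _ x
      show (r' * a) • (Submodule.Quotient.mk x : QuotSMulTop π X) =
        r' • a • (Submodule.Quotient.mk x : QuotSMulTop π X)
      rw [mul_smul]⟩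
  haveI : Module.Finite (IwasawaAlgebra₂ p ⧸ Ideal.span {π}) (QuotSMulTop π X) :=
    Module.Finite.of_restrictScalars_finite (IwasawaAlgebra₂ p) _ _
  obtain ⟨cbar, hc, hc0⟩ := Submodule.exists_mem_ne_zero_of_ne_bot
    (Module.annihilator_ne_bot_of_isTorsion (QuotSMulTop π X) hT)
  obtain ⟨s, rfl⟩ := Ideal.Quotient.mk_surjective cbar
  refine ⟨s, fun h => hc0 (Ideal.Quotient.eq_zero_iff_mem.mpr h), fun x => ?_⟩
  have h1 : (Ideal.Quotient.mk (Ideal.span {π}) s) • (Submodule.Quotient.mk x : QuotSMulTop π X) = 0 :=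
    Module.mem_annihilator.mp hc _
  have h2 : (Submodule.Quotient.mk (s • x) : QuotSMulTop π X) = 0 := by
    rw [Submodule.Quotient.mk_smul]; exact h1
  exact (Submodule.Quotient.mk_eq_zero _).mp h2

/-- **The Kato line** `T₂ = 0`: the good prime `X ∈ Λ₁ = ℤ_p⟦T₂⟧` (so `C X = T₂ ∈ Λ₂`). -/
noncomputable def katoLine (p : ℕ) [Fact p.Prime] : GoodPrime p where
  P := PowerSeries.X
  prime := PowerSeries.X_prime
  not_dvd := by
    intro h
    rw [PowerSeries.X_dvd_iff, map_natCast] at h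
    exact (NeZero.ne p) (by exact_mod_cast h)

/-- `FibreTorsionAt` depends only on the prime IDEAL `(C P)`. -/
theorem fibreTorsionAt_of_associated (P Q : GoodPrime p) (hPQ : Associated P.P Q.P) (X : Type)
    [AddCommGroup X] [Module (IwasawaAlgebra₂ p) X] (h : FibreTorsionAt p P X) :
    FibreTorsionAt p Q X := by
  have hC : Associated (PowerSeries.C P.P : IwasawaAlgebra₂ p) (PowerSeries.C Q.P) :=
    associated_of_dvd_dvd (map_dvd _ hPQ.dvd) (map_dvd _ hPQ.symm.dvd)
  have hspan : Ideal.span {(PowerSeries.C P.P : IwasawaAlgebra₂ p)} = Ideal.span {PowerSeries.C Q.P} :=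
    Ideal.span_singleton_eq_span_singleton.mpr hC
  have htop : (PowerSeries.C P.P : IwasawaAlgebra₂ p) • (⊤ : Submodule (IwasawaAlgebra₂ p) X) =
      (PowerSeries.C Q.P : IwasawaAlgebra₂ p) • (⊤ : Submodule (IwasawaAlgebra₂ p) X) := by
    rw [← Submodule.ideal_span_singleton_smul, ← Submodule.ideal_span_singleton_smul, hspan]
  obtain ⟨s, hs, hsX⟩ := h
  exact ⟨s, hspan ▸ hs, fun x => htop ▸ hsX x⟩

end Currencies

/-! ## E8 (v1.2, g16). THE DEPTH CURRENCY — CGLS20 §3.4 one dimension up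

(XS) `Module.IsTorsion Λ₂ X` follows from torsion of ONE fibre (Cayley–Hamilton for `s•` with `sX ⊆ πX`), so the
hypothesis «`X` is `Λ₂`-torsion» of `engine_std` is REDUNDANT given the Kato-line torsion (`engine_std'`).

(DEPTH) For a good prime `P` not associated to `T₂` the **depth** `#(O_Q / u_Q O_Q)` and the rank `rk_{ℤ_p} O_Q` of
the residue orders of the twisted translates `Q = ι_v(P)` are EVENTUALLY CONSTANT (equal to those of `P`) as
`v → 1` `p`-adically: `O_Q ≅ O_P` as `ℤ_p`-algebras via `ι_v`, under which `u_Q ↦ v⁻¹(u_P - (v - 1))`, and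
`(u_P - c) = (u_P)` as ideals once `p^{d+1} ∣ c` where `p^d ∈ (u_P)` (`u_P ≠ 0` is integral over `ℤ_p`; `O_P` is
local). This is the two-variable replica of «`C_{α_{𝔓_m}} = C_{α_𝔓}` and `rank S_{𝔓_m} = rank S_𝔓` for `m ≫ 0`,
hence the error term is bounded independently of `m`» in the proof of CGLS20 Thm 3.4.1 (Castella–Grossi–Lee–
Skinner, arXiv:2008.02571, p. 21), where `C_α = v_p(α(γ) - 1)` and the exceptional prime `𝔓₀ = (γ - 1)` (there
`C_α → ∞`) is our Kato line `T₂` (`u → 0`). CONSEQUENCE (`unifTwistBounds_of_depth`, `engine_depth`): fibre bounds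
whose slack is ANY function `F(depth, rank)` — the printed SHAPE of a Kolyvagin-system bound with error «depending
only on `C_α`, `T_pE` and `rank_{ℤ_p} R`» (CGLS20 Thm 3.2.1) — are automatically (UNIF); the engine's arithmetic
input becomes ONE statement `DepthFibreBounds` (+ Kato-line torsion).
-/

section DepthCurrency

variable {p : ℕ} [Fact p.Prime]

/-- **(XS)** A finitely generated `Λ₂`-module one of whose fibres `X/(C P)X` is killed by some `s ∉ (C P)` is
`Λ₂`-torsion: Cayley–Hamilton for the endomorphism `s•` (range in `(C P)·X`) gives a monic relation
`d := q(s) = s^n + ((C P)-multiples)` with `d ∉ (C P)` (prime) and `d·X = 0`. -/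
theorem isTorsion_of_fibreTorsionAt' (P : GoodPrime p) (X : Type) [AddCommGroup X]
    [Module (IwasawaAlgebra₂ p) X] [Module.Finite (IwasawaAlgebra₂ p) X] (h : FibreTorsionAt p P X) :
    Module.IsTorsion (IwasawaAlgebra₂ p) X := by
  classical
  obtain ⟨s, hs, hsX⟩ := h
  set π : IwasawaAlgebra₂ p := PowerSeries.C P.P with hπ
  set I : Ideal (IwasawaAlgebra₂ p) := Ideal.span {π} with hI
  haveI hIp : I.IsPrime := (Ideal.span_singleton_prime P.prime_C.ne_zero).mpr P.prime_C
  let f : Module.End (IwasawaAlgebra₂ p) X := algebraMap (IwasawaAlgebra₂ p) (Module.End (IwasawaAlgebra₂ p) X) s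
  have hf : LinearMap.range f ≤ I • ⊤ := by
    rintro _ ⟨x, rfl⟩
    rw [Module.algebraMap_end_apply, hI, Submodule.ideal_span_singleton_smul]
    exact hsX x
  obtain ⟨q, hmonic, -, hcoeff, hq⟩ :=
    LinearMap.exists_monic_and_natDegree_eq_and_coeff_mem_pow_and_aeval_eq_zero (IwasawaAlgebra₂ p) f I hf
  set d : IwasawaAlgebra₂ p := q.eval s with hd
  have hdX : ∀ x : X, d • x = 0 := by
    intro x
    have h1 : Polynomial.aeval f q = algebraMap (IwasawaAlgebra₂ p) (Module.End (IwasawaAlgebra₂ p) X) d :=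
      Polynomial.aeval_algebraMap_apply_eq_algebraMap_eval s q
    have h2 := congrArg (fun g : Module.End (IwasawaAlgebra₂ p) X => g x) hq
    simpa only [h1, Module.algebraMap_end_apply, LinearMap.zero_apply] using h2
  -- `d - s^n ∈ I`
  have hdiff : d - s ^ q.natDegree ∈ I := by
    rw [hd, Polynomial.eval_eq_sum_range, Finset.sum_range_succ, hmonic.coeff_natDegree, one_mul,
      add_sub_cancel_right]
    refine I.sum_mem fun k hk => ?_
    have hk' : k < q.natDegree := Finset.mem_range.mp hk
    exact I.mul_mem_right _ (Ideal.pow_le_self (by omega) (hcoeff k))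
  have hd0 : d ∉ I := by
    intro hdI
    have hsn : s ^ q.natDegree ∈ I := by
      have := I.sub_mem hdI hdiff
      rwa [sub_sub_cancel] at this
    exact hs (hIp.mem_of_pow_mem _ hsn)
  have hdne : d ≠ 0 := by
    rintro h0
    exact hd0 (h0 ▸ I.zero_mem)
  intro x
  exact ⟨⟨d, mem_nonZeroDivisors_of_ne_zero hdne⟩, hdX x⟩

end DepthCurrency

/-! ## E9 (v1.3, g17). THE S-DOOR: the vertical input over COMPLETE DVR coefficient rings (PROVED)

The critic's standing objection (V#16l, V#23i) to `VFamily` / `UnifTwistBounds` / `DepthFibreBounds` is their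
COEFFICIENT CLASS (residue orders `O_Q = Λ₁/(Q)`, non-maximal in general) versus the complete DVRs of every printed
Kolyvagin-system bound. The second door asked for in V#23i: §E9.1 (LB) over ANY Noetherian domain (sketch §9.6
verbatim; `fibreLengthLowerBound_holds`) · §E9.2 Weierstrass evaluation `ev_u : S⟦T⟧ → S` at `u ∈ 𝔪_S` (division by
`T - u`), kernel `(T - u)`, `ev_{u'} f ≡ ev_u f (mod u' - u)` · §E9.3 complete DVRs `S ⊇ ℤ_p` module-finite of
characteristic `0`: `p ∈ 𝔪_S`, `p^d ∈ (u)`, `(u + p^N) = (u)`, Krull · §E9.4 over `Λ_{2,S} = S⟦T₂⟧⟦T₁⟧`: `π_u = T₂ - u`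
prime, `Λ_{2,S}/(π_u) ≅ S⟦T₁⟧`, the height-one prime `𝔔̄_u ∋ p̄` of the fibre ring with a `u`-independent residue
criterion, (FT_S) · §E9.5 ISOLATED ZEROS `f(u₀ + p^N) ≠ 0` for `N ≫ 0` (replaces avoidance and twists) · §E9.6 the
degree-one vertical theorem **`verticalS_dvd`** (= `vertical_dvd` with good primes ↦ points of `𝔪_S`, `r = 1`) ·
§E9.7 FLAT base change `Λ₂ → Λ_{2,S}` (free of rank `rk S`) and `ord_π(C P)·ℓ_{(C P)}(X) ≤ ℓ_{(π)}(Λ_{2,S} ⊗ X)` ·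
§E9.8 descent `ker(a ↦ a(u₀)) = (P)` in `Λ₁`, `(C P)^{ℓ_{(C P)}(X)} ∣ G` (multiplicity of the root carried:
`m·k ≤ k_S ≤ m·g`) · §E9.9 `DepthFibreBoundsDVR`, `RootDatumS`, **`engine_doorS`**. Base change is used one good
prime at a time, BEFORE taking fibres (flat), so no comparison `O_Q⟦T₁⟧` vs `S⟦T₁⟧` (the non-flat dead end (N2))
ever occurs; no UFD / dimension / finite-support facts over `S` are needed. -/

set_option linter.unusedSectionVars false

/-! ### E9.1 (LB) over any Noetherian domain — the sketch's §9.6, verbatim (namespace `LB`) -/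

section LowerBoundGeneric

namespace LB

section LowerBoundProof

open Summit.BirchSwinnertonDyer.BirchSwinnertonDyer.Theorems.SignedBaseChangeAcDivSpecialization

variable {R : Type*} [CommRing R]

/-- `R → R̄ → N/sN`: scalar tower for the `R̄`-module structure of `N/sN`. -/
theorem isScalarTower_quotSMulTop (a : R) (N : Type*) [AddCommGroup N] [Module R N] :
    IsScalarTower R (R ⧸ Ideal.span {a}) (QuotSMulTop a N) :=
  ⟨fun r b m => by
    obtain ⟨b, rfl⟩ := Ideal.Quotient.mk_surjective b
    obtain ⟨x, rfl⟩ := Submodule.mkQ_surjective _ m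
    show (r * b) • (Submodule.Quotient.mk x : QuotSMulTop a N) =
      r • b • (Submodule.Quotient.mk x : QuotSMulTop a N)
    rw [mul_smul]⟩

/-- `R → R̄ → N[s]`: scalar tower for the `R̄`-module structure of the `s`-torsion. -/
theorem isScalarTower_torsionBy (a : R) (N : Type*) [AddCommGroup N] [Module R N] :
    IsScalarTower R (R ⧸ Ideal.span {a}) (Submodule.torsionBy R N a) :=
  ⟨fun r b m => by
    obtain ⟨b, rfl⟩ := Ideal.Quotient.mk_surjective b
    show (r * b) • m = r • b • m
    rw [mul_smul]⟩

/-- The snake for multiplication by `a` read over `R̄ = R/(a)` (six-term length identity at a prime of `R̄`;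
port of the tree's `LocalLength.lengthAt_smul_snake`). -/
theorem lengthAt_quot_snake (a : R) {N₁ N₂ N₃ : Type*} [AddCommGroup N₁] [Module R N₁]
    [AddCommGroup N₂] [Module R N₂] [AddCommGroup N₃] [Module R N₃]
    (f : N₁ →ₗ[R] N₂) (g : N₂ →ₗ[R] N₃) (hf : Function.Injective f) (hg : Function.Surjective g)
    (hfg : Function.Exact f g) (𝔔 : PrimeSpectrum (R ⧸ Ideal.span {a})) :
    Module.lengthAt (R ⧸ Ideal.span {a}) (Submodule.torsionBy R N₂ a) 𝔔 +
        Module.lengthAt (R ⧸ Ideal.span {a}) (QuotSMulTop a N₁) 𝔔 +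
        Module.lengthAt (R ⧸ Ideal.span {a}) (QuotSMulTop a N₃) 𝔔 =
      Module.lengthAt (R ⧸ Ideal.span {a}) (Submodule.torsionBy R N₁ a) 𝔔 +
        Module.lengthAt (R ⧸ Ideal.span {a}) (Submodule.torsionBy R N₃ a) 𝔔 +
        Module.lengthAt (R ⧸ Ideal.span {a}) (QuotSMulTop a N₂) 𝔔 := by
  haveI := isScalarTower_torsionBy a N₁
  haveI := isScalarTower_torsionBy a N₂
  haveI := isScalarTower_torsionBy a N₃
  haveI := isScalarTower_quotSMulTop a N₁
  haveI := isScalarTower_quotSMulTop a N₂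
  haveI := isScalarTower_quotSMulTop a N₃
  have hsurj : Function.Surjective (algebraMap R (R ⧸ Ideal.span {a})) := Ideal.Quotient.mk_surjective
  have hsq₁ : f.comp (DistribSMul.toLinearMap R N₁ a) = (DistribSMul.toLinearMap R N₂ a).comp f := by
    ext; simp
  have hsq₂ : g.comp (DistribSMul.toLinearMap R N₂ a) = (DistribSMul.toLinearMap R N₃ a).comp g := by
    ext; simp
  let δ := SnakeLemma.δ' (DistribSMul.toLinearMap R N₁ a) (DistribSMul.toLinearMap R N₂ a)
    (DistribSMul.toLinearMap R N₃ a) f g hfg f g hfg hsq₁ hsq₂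
    (Submodule.torsionBy R N₃ a).subtype (Literature.RingTheory.Length.exact_subtype_smulMap a N₃)
    (Submodule.mkQ (a • ⊤)) (Literature.RingTheory.Length.exact_smulMap_mkQ a N₁) hg hf
  have e₁ : Function.Injective (f.restrict (Literature.RingTheory.Length.mapsTo_torsionBy a f)) :=
    Literature.RingTheory.Length.restrict_torsionBy_injective a f hf
  have e₂ := Literature.RingTheory.Length.exact_restrict_torsionBy a f g hf hfg
  have e₃ : Function.Exact (g.restrict (Literature.RingTheory.Length.mapsTo_torsionBy a g)) δ :=
    SnakeLemma.exact_δ'_right (DistribSMul.toLinearMap R N₁ a) (DistribSMul.toLinearMap R N₂ a)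
      (DistribSMul.toLinearMap R N₃ a) f g hfg f g hfg hsq₁ hsq₂
      (Submodule.torsionBy R N₂ a).subtype (Literature.RingTheory.Length.exact_subtype_smulMap a N₂)
      (Submodule.torsionBy R N₃ a).subtype (Literature.RingTheory.Length.exact_subtype_smulMap a N₃)
      (Submodule.mkQ (a • ⊤)) (Literature.RingTheory.Length.exact_smulMap_mkQ a N₁) hg hf
      (g.restrict (Literature.RingTheory.Length.mapsTo_torsionBy a g)) rfl
      (Submodule.injective_subtype _)
  have e₄ : Function.Exact δ (QuotSMulTop.map a f) :=
    SnakeLemma.exact_δ'_left (DistribSMul.toLinearMap R N₁ a) (DistribSMul.toLinearMap R N₂ a)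
      (DistribSMul.toLinearMap R N₃ a) f g hfg f g hfg hsq₁ hsq₂
      (Submodule.torsionBy R N₃ a).subtype (Literature.RingTheory.Length.exact_subtype_smulMap a N₃)
      (Submodule.mkQ (a • ⊤)) (Literature.RingTheory.Length.exact_smulMap_mkQ a N₁)
      (Submodule.mkQ (a • ⊤)) (Literature.RingTheory.Length.exact_smulMap_mkQ a N₂) hg hf
      (QuotSMulTop.map a f) (QuotSMulTop.map_comp_mkQ a f) (Submodule.mkQ_surjective _)
  have e₅ := QuotSMulTop.map_exact a hfg hg
  have e₆ := QuotSMulTop.map_surjective a hg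
  exact LocalLength.lengthAt_six_term
    ((f.restrict (Literature.RingTheory.Length.mapsTo_torsionBy a f)).extendScalarsOfSurjective hsurj)
    ((g.restrict (Literature.RingTheory.Length.mapsTo_torsionBy a g)).extendScalarsOfSurjective hsurj)
    (δ.extendScalarsOfSurjective hsurj) ((QuotSMulTop.map a f).extendScalarsOfSurjective hsurj)
    ((QuotSMulTop.map a g).extendScalarsOfSurjective hsurj) e₁ e₂ e₃ e₄ e₅ e₆ 𝔔

/-- On a module `N ≃ R/𝔮`, every `q ∈ 𝔮` acts as `0`. -/
theorem smul_eq_zero_of_equiv_quotient {N : Type*} [AddCommGroup N] [Module R N] {𝔮 : Ideal R}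
    (e : N ≃ₗ[R] R ⧸ 𝔮) {q : R} (hq : q ∈ 𝔮) (x : N) : q • x = 0 := by
  apply e.injective
  rw [map_smul, map_zero, ← IsScalarTower.algebraMap_smul (R ⧸ 𝔮) q (e x), smul_eq_mul,
    Ideal.Quotient.algebraMap_eq, Ideal.Quotient.eq_zero_iff_mem.mpr hq, zero_mul]

/-- On a module `N ≃ R/𝔮`, an element acting as `0` lies in `𝔮`. -/
theorem mem_of_equiv_quotient {N : Type*} [AddCommGroup N] [Module R N] {𝔮 : Ideal R}
    (e : N ≃ₗ[R] R ⧸ 𝔮) {q : R} (hq : ∀ x : N, q • x = 0) : q ∈ 𝔮 := by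
  have h := congrArg e (hq (e.symm (Ideal.Quotient.mk 𝔮 1)))
  rw [map_smul, LinearEquiv.apply_symm_apply, map_zero,
    ← IsScalarTower.algebraMap_smul (R ⧸ 𝔮) q, smul_eq_mul, Ideal.Quotient.algebraMap_eq, ← map_mul,
    mul_one, Ideal.Quotient.eq_zero_iff_mem] at h
  exact h

/-- `R/𝔮` for `t ∉ 𝔮` (prime) has no `t`-torsion. -/
theorem subsingleton_torsionBy_of_equiv_quotient {t : R} {N : Type*} [AddCommGroup N] [Module R N]
    {𝔮 : Ideal R} (h𝔮 : 𝔮.IsPrime) (e : N ≃ₗ[R] R ⧸ 𝔮) (htq : t ∉ 𝔮) :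
    Subsingleton (Submodule.torsionBy R N t) := by
  have hz : ∀ z : Submodule.torsionBy R N t, z = 0 := by
    intro ⟨z, hz⟩
    rw [Submodule.mem_torsionBy_iff] at hz
    obtain ⟨r, hr⟩ := Ideal.Quotient.mk_surjective (e z)
    have h0 : t • e z = 0 := by rw [← map_smul, hz, map_zero]
    rw [← hr, ← IsScalarTower.algebraMap_smul (R ⧸ 𝔮) t, smul_eq_mul, Ideal.Quotient.algebraMap_eq,
      ← map_mul, Ideal.Quotient.eq_zero_iff_mem] at h0
    have hr𝔮 : r ∈ 𝔮 := (h𝔮.mem_or_mem h0).resolve_left htq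
    have hez : e z = 0 := by rw [← hr, Ideal.Quotient.eq_zero_iff_mem.mpr hr𝔮]
    exact Subtype.ext ((map_eq_zero_iff e e.injective).mp hez)
  exact ⟨fun x y => by rw [hz x, hz y]⟩

/-- `ℓ_𝔔(N[s]) < ∞` over `R̄ = R/(s)` for `N` finitely generated and killed by `c`, `s ∤ c`, `ht 𝔔 = 1`:
`N[s]` is a finitely generated `R̄`-module killed by `c̄ ≠ 0`. -/
theorem lengthAt_torsionBy_ne_top [IsNoetherianRing R] {s c : R} (hs : Prime s) (hsc : ¬ s ∣ c)
    (𝔔 : PrimeSpectrum (R ⧸ Ideal.span {s})) (hht : 𝔔.asIdeal.height = 1)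
    (N : Type*) [AddCommGroup N] [Module R N] [Module.Finite R N] (hcN : ∀ x : N, c • x = 0) :
    Module.lengthAt (R ⧸ Ideal.span {s}) (Submodule.torsionBy R N s) 𝔔 ≠ ⊤ := by
  haveI : (Ideal.span {s}).IsPrime := (Ideal.span_singleton_prime hs.ne_zero).mpr hs
  haveI := isScalarTower_torsionBy s N
  haveI : Module.Finite (R ⧸ Ideal.span {s}) (Submodule.torsionBy R N s) :=
    Module.Finite.of_restrictScalars_finite R _ _
  have hcbar : Ideal.Quotient.mk (Ideal.span {s}) c ≠ 0 := by
    rw [Ne, Ideal.Quotient.eq_zero_iff_mem, Ideal.mem_span_singleton]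
    exact hsc
  refine Module.lengthAt_ne_top_of_isTorsionBy hcbar (fun x => ?_) 𝔔 hht.le
  show c • x = 0
  exact Subtype.ext (by rw [Submodule.coe_smul, ZeroMemClass.coe_zero]; exact hcN x)

variable [IsNoetherianRing R] [IsDomain R]

/-- Bookkeeping in `ℕ∞` for the exact case of the dévissage. -/
theorem enat_devissage_step {E₁ E₃ m B₁ B₂ B₃ A₁ A₂ A₃ : ℕ∞} (I₁ : E₁ * m + B₁ ≤ A₁)
    (I₃ : E₃ * m + B₃ ≤ A₃) (six : B₂ + A₁ + A₃ = B₁ + B₃ + A₂) (h₁ : B₁ ≠ ⊤) (h₃ : B₃ ≠ ⊤) :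
    (E₁ + E₃) * m + B₂ ≤ A₂ := by
  have hB : B₁ + B₃ ≠ ⊤ := WithTop.add_ne_top.mpr ⟨h₁, h₃⟩
  rw [← ENat.add_le_add_iff_right hB]
  calc (E₁ + E₃) * m + B₂ + (B₁ + B₃) = (E₁ * m + B₁) + (E₃ * m + B₃) + B₂ := by ring
    _ ≤ A₁ + A₃ + B₂ := add_le_add (add_le_add I₁ I₃) le_rfl
    _ = B₂ + A₁ + A₃ := by ring
    _ = B₁ + B₃ + A₂ := six
    _ = A₂ + (B₁ + B₃) := by ring

/-- **The dévissage inequality** `e(N)·m̄ + b(N) ≤ a(N)` (notation of the section docstring). -/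
theorem lowerBound_devissage {s π c : R} (hs : Prime s) (hπ : Prime π) (hπs : ¬ π ∣ s)
    (hsc : ¬ s ∣ c) (𝔔 : PrimeSpectrum (R ⧸ Ideal.span {s})) (hht : 𝔔.asIdeal.height = 1)
    (N : Type*) [AddCommGroup N] [Module R N] [hN : Module.Finite R N] (hcN : ∀ x : N, c • x = 0) :
    Module.lengthAt R N ⟨Ideal.span {π}, (Ideal.span_singleton_prime hπ.ne_zero).mpr hπ⟩ *
          Module.lengthAt (R ⧸ Ideal.span {s})
            ((R ⧸ Ideal.span {s}) ⧸ Ideal.span {Ideal.Quotient.mk (Ideal.span {s}) π}) 𝔔 +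
        Module.lengthAt (R ⧸ Ideal.span {s}) (Submodule.torsionBy R N s) 𝔔 ≤
      Module.lengthAt (R ⧸ Ideal.span {s}) (QuotSMulTop s N) 𝔔 := by
  classical
  haveI hsP : (Ideal.span {s}).IsPrime := (Ideal.span_singleton_prime hs.ne_zero).mpr hs
  have hsurj : Function.Surjective (algebraMap R (R ⧸ Ideal.span {s})) :=
    Ideal.Quotient.mk_surjective
  have hc0 : c ≠ 0 := fun h => hsc (h ▸ dvd_zero s)
  set 𝔓 : PrimeSpectrum R := ⟨Ideal.span {π}, (Ideal.span_singleton_prime hπ.ne_zero).mpr hπ⟩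
    with h𝔓def
  revert hcN
  induction hN using IsNoetherianRing.induction_on_isQuotientEquivQuotientPrime R with
  | subsingleton N =>
    intro hcN
    rw [Module.lengthAt_eq_zero_of_subsingleton (R := R) (M := N),
      Module.lengthAt_eq_zero_of_subsingleton (R := R ⧸ Ideal.span {s})
        (M := Submodule.torsionBy R N s), zero_mul, zero_add]
    exact bot_le
  | quotient N q e =>
    intro hcN
    haveI := isScalarTower_quotSMulTop s N
    haveI := isScalarTower_torsionBy s N
    have hcq : c ∈ q.asIdeal := mem_of_equiv_quotient e hcN
    have hq0 : q.asIdeal ≠ ⊥ := by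
      intro h
      rw [h, Ideal.mem_bot] at hcq
      exact hc0 hcq
    by_cases hqπ : q.asIdeal = Ideal.span {π}
    · -- `𝔮 = (π)`: `e = 1`, `b = 0`, `a ≥ m̄`
      have hsq : s ∉ q.asIdeal := by
        rw [hqπ, Ideal.mem_span_singleton]
        exact hπs
      haveI := subsingleton_torsionBy_of_equiv_quotient q.isPrime e hsq
      obtain rfl : q = 𝔓 := PrimeSpectrum.ext hqπ
      rw [Module.lengthAt_eq_zero_of_subsingleton (R := R ⧸ Ideal.span {s})
        (M := Submodule.torsionBy R N s), add_zero, Module.lengthAt_eq_of_linearEquiv e,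
        Module.lengthAt_quotient_self, one_mul]
      -- the surjection `N/sN ↠ R̄/(π̄)`
      have hker : (𝔓.asIdeal : Submodule R R) ≤ LinearMap.ker (Algebra.linearMap R
          ((R ⧸ Ideal.span {s}) ⧸ Ideal.span {Ideal.Quotient.mk (Ideal.span {s}) π})) := by
        show Ideal.span {π} ≤ _
        rw [Ideal.span_le, Set.singleton_subset_iff, SetLike.mem_coe, LinearMap.mem_ker,
          Algebra.linearMap_apply, ← Ideal.Quotient.mk_algebraMap, Ideal.Quotient.algebraMap_eq,
          Ideal.Quotient.eq_zero_iff_mem]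
        exact Ideal.mem_span_singleton_self _
      let ψ : N →ₗ[R] ((R ⧸ Ideal.span {s}) ⧸ Ideal.span {Ideal.Quotient.mk (Ideal.span {s}) π}) :=
        (Submodule.liftQ 𝔓.asIdeal (Algebra.linearMap R _) hker) ∘ₗ e.toLinearMap
      have hkerψ : (s • ⊤ : Submodule R N) ≤ LinearMap.ker ψ := by
        intro z hz
        obtain ⟨y, -, rfl⟩ := (Submodule.mem_smul_pointwise_iff_exists _ _ _).mp hz
        rw [LinearMap.mem_ker, map_smul,
          ← IsScalarTower.algebraMap_smul (R ⧸ Ideal.span {s}) s (ψ y), Ideal.Quotient.algebraMap_eq,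
          Ideal.Quotient.eq_zero_iff_mem.mpr (Ideal.mem_span_singleton_self s), zero_smul]
      let ψq := ((s • ⊤ : Submodule R N).liftQ ψ hkerψ).extendScalarsOfSurjective hsurj
      refine Module.lengthAt_le_of_surjective ψq (fun y => ?_) 𝔔
      obtain ⟨z, rfl⟩ := Ideal.Quotient.mk_surjective y
      obtain ⟨r, rfl⟩ := Ideal.Quotient.mk_surjective z
      refine ⟨Submodule.Quotient.mk (e.symm (Submodule.Quotient.mk r)), ?_⟩
      rw [LinearMap.extendScalarsOfSurjective_apply, Submodule.liftQ_apply, LinearMap.comp_apply,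
        LinearEquiv.coe_coe, LinearEquiv.apply_symm_apply, Submodule.liftQ_apply, Algebra.linearMap_apply]
      rfl
    · -- `𝔮 ≠ (π)`: `e = 0`
      have hnle : ¬ q.asIdeal ≤ Ideal.span {π} := by
        intro hle
        obtain ⟨x, hx, hx0⟩ := Submodule.exists_mem_ne_zero_of_ne_bot hq0
        obtain ⟨n, y, hy, rfl⟩ := WfDvdMonoid.max_power_factor hx0 hπ.irreducible
        rcases q.isPrime.mem_or_mem hx with h | h
        · have hπq : π ∈ q.asIdeal := q.isPrime.mem_of_pow_mem n h
          exact hqπ (le_antisymm hle ((Ideal.span_singleton_le_iff_mem _).mpr hπq))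
        · exact hy (Ideal.mem_span_singleton.mp (hle h))
      rw [Module.lengthAt_eq_of_linearEquiv e, Module.lengthAt_quotient_eq_zero_of_not_le hnle,
        zero_mul, zero_add]
      by_cases hsq : s ∈ q.asIdeal
      · -- `s ∈ 𝔮`: `sN = 0`, so `N[s] ↪ N/sN`
        have hkill : ∀ x : N, s • x = 0 := smul_eq_zero_of_equiv_quotient e hsq
        have hbot : (s • ⊤ : Submodule R N) = ⊥ := by
          rw [eq_bot_iff]
          intro x hx
          obtain ⟨y, -, rfl⟩ := (Submodule.mem_smul_pointwise_iff_exists _ _ _).mp hx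
          exact (Submodule.mem_bot R).mpr (hkill y)
        let φ := ((s • ⊤ : Submodule R N).mkQ ∘ₗ (Submodule.torsionBy R N s).subtype)
          |>.extendScalarsOfSurjective hsurj
        refine Module.lengthAt_le_of_injective φ (fun x y hxy => ?_) 𝔔
        have : ((x : N) - y) ∈ (s • ⊤ : Submodule R N) := by
          rw [← Submodule.Quotient.eq]; exact hxy
        rw [hbot, Submodule.mem_bot, sub_eq_zero] at this
        exact Subtype.ext this
      · haveI := subsingleton_torsionBy_of_equiv_quotient q.isPrime e hsq
        rw [Module.lengthAt_eq_zero_of_subsingleton (R := R ⧸ Ideal.span {s})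
          (M := Submodule.torsionBy R N s)]
        exact bot_le
  | exact N₁ N₂ N₃ f g hf hg hfg ih₁ ih₃ =>
    intro hc₂
    have hc₁ : ∀ x : N₁, c • x = 0 := fun x => hf (by rw [map_smul, hc₂, map_zero])
    have hc₃ : ∀ x : N₃, c • x = 0 := fun x => by
      obtain ⟨y, rfl⟩ := hg x
      rw [← map_smul, hc₂, map_zero]
    exact enat_devissage_step (ih₁ hc₁) (ih₃ hc₃) (lengthAt_quot_snake s f g hf hg hfg 𝔔)
      (lengthAt_torsionBy_ne_top hs hsc 𝔔 hht N₁ hc₁) (lengthAt_torsionBy_ne_top hs hsc 𝔔 hht N₃ hc₃)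
      |> fun h => by rwa [Module.lengthAt_eq_add_of_exact f g hf hg hfg 𝔓]

end LowerBoundProof

end LB

end LowerBoundGeneric

/-! ### E9.2 Evaluation at a point of `𝔪_S` of a complete local ring `S` (Weierstrass division by `T - u`) -/

section EvalS

variable {S : Type} [CommRing S] [IsLocalRing S] [IsAdicComplete (IsLocalRing.maximalIdeal S) S]

/-- `T - u` is distinguished for `u ∈ 𝔪_S`. -/
theorem isDistinguishedAt_X_sub_C {u : S} (hu : u ∈ IsLocalRing.maximalIdeal S) :
    (Polynomial.X - Polynomial.C u).IsDistinguishedAt (IsLocalRing.maximalIdeal S) := by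
  refine ⟨⟨fun {n} hn => ?_⟩, Polynomial.monic_X_sub_C _⟩
  rw [Polynomial.natDegree_X_sub_C, Nat.lt_one_iff] at hn
  subst hn
  rwa [Polynomial.coeff_sub, Polynomial.coeff_X_zero, Polynomial.coeff_C_zero, zero_sub, neg_mem_iff]

theorem coe_X_sub_C (u : S) :
    ((Polynomial.X - Polynomial.C u : Polynomial S) : PowerSeries S) = PowerSeries.X - PowerSeries.C u := by
  rw [Polynomial.coe_sub, Polynomial.coe_X, Polynomial.coe_C]

/-- Weierstrass division by `T - u`: `S[T]/(T - u) ≅ S⟦T⟧/(T - u)` (`Polynomial.IsDistinguishedAt.algEquivQuotient`;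
the `Algebra S S⟦T⟧` instance is pinned by unification). -/
noncomputable def weqvS {u : S} (hu : u ∈ IsLocalRing.maximalIdeal S) :
    (Polynomial S ⧸ Ideal.span {Polynomial.X - Polynomial.C u}) ≃+*
      (PowerSeries S ⧸ Ideal.span {((Polynomial.X - Polynomial.C u : Polynomial S) : PowerSeries S)}) :=
  @AlgEquiv.toRingEquiv _ _ _ _ _ _ (_) (_) (isDistinguishedAt_X_sub_C hu).algEquivQuotient

theorem weqvS_mk {u : S} (hu : u ∈ IsLocalRing.maximalIdeal S) (q : Polynomial S) :
    weqvS hu (Ideal.Quotient.mk _ q) = Ideal.Quotient.mk _ (q : PowerSeries S) := by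
  show Ideal.Quotient.mk _ (PowerSeries.map (algebraMap S S) (q : PowerSeries S)) = _
  rw [Algebra.algebraMap_self, PowerSeries.map_id, id_eq]

/-- **Evaluation at `u ∈ 𝔪_S`**: `ev_u : S⟦T⟧ → S`, `T ↦ u`, constants fixed (reduction modulo the
distinguished polynomial `T - u`, then `S[T]/(T - u) ≅ S`). -/
noncomputable def evS {u : S} (hu : u ∈ IsLocalRing.maximalIdeal S) : PowerSeries S →+* S :=
  (Polynomial.quotientSpanXSubCAlgEquiv u).toRingEquiv.toRingHom.comp
    ((weqvS hu).symm.toRingHom.comp (Ideal.Quotient.mk _))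

theorem evS_apply {u : S} (hu : u ∈ IsLocalRing.maximalIdeal S) (F : PowerSeries S) :
    evS hu F = Polynomial.quotientSpanXSubCAlgEquiv u ((weqvS hu).symm (Ideal.Quotient.mk _ F)) := rfl

theorem evS_coe {u : S} (hu : u ∈ IsLocalRing.maximalIdeal S) (q : Polynomial S) :
    evS hu (q : PowerSeries S) = q.eval u := by
  rw [evS_apply, ← weqvS_mk hu, RingEquiv.symm_apply_apply, Polynomial.quotientSpanXSubCAlgEquiv_mk]

theorem evS_C {u : S} (hu : u ∈ IsLocalRing.maximalIdeal S) (a : S) : evS hu (PowerSeries.C a) = a := by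
  rw [← Polynomial.coe_C, evS_coe, Polynomial.eval_C]

theorem evS_X {u : S} (hu : u ∈ IsLocalRing.maximalIdeal S) : evS hu PowerSeries.X = u := by
  rw [← Polynomial.coe_X, evS_coe, Polynomial.eval_X]

/-- `ker ev_u = (T - u)`. -/
theorem evS_eq_zero_iff {u : S} (hu : u ∈ IsLocalRing.maximalIdeal S) (F : PowerSeries S) :
    evS hu F = 0 ↔ PowerSeries.X - PowerSeries.C u ∣ F := by
  rw [← Ideal.mem_span_singleton, ← coe_X_sub_C, ← Ideal.Quotient.eq_zero_iff_mem, evS_apply,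
    map_eq_zero_iff _ (AlgEquiv.injective _), map_eq_zero_iff _ (RingEquiv.injective _)]

/-- **Congruence**: `u' - u ∣ ev_{u'} F - ev_u F`. -/
theorem sub_dvd_evS_sub {u u' : S} (hu : u ∈ IsLocalRing.maximalIdeal S)
    (hu' : u' ∈ IsLocalRing.maximalIdeal S) (F : PowerSeries S) : u' - u ∣ evS hu' F - evS hu F := by
  have hdvd : PowerSeries.X - PowerSeries.C u ∣ F - PowerSeries.C (evS hu F) := by
    rw [← evS_eq_zero_iff hu, map_sub, evS_C, sub_self]
  obtain ⟨H, hH⟩ := hdvd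
  have h1 := congrArg (evS hu') hH
  rw [map_sub, evS_C, map_mul, map_sub, evS_X, evS_C] at h1
  exact ⟨evS hu' H, h1⟩

/-- `ev_u F ≡ F(0) (mod 𝔪_S)`. -/
theorem evS_sub_constantCoeff_mem {u : S} (hu : u ∈ IsLocalRing.maximalIdeal S) (F : PowerSeries S) :
    evS hu F - PowerSeries.constantCoeff F ∈ IsLocalRing.maximalIdeal S := by
  have hdvd : PowerSeries.X ∣ F - PowerSeries.C (PowerSeries.constantCoeff F) := by
    rw [PowerSeries.X_dvd_iff, map_sub, PowerSeries.constantCoeff_C, sub_self]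
  obtain ⟨H, hH⟩ := hdvd
  have h1 := congrArg (evS hu) hH
  rw [map_sub, evS_C, map_mul, evS_X] at h1
  rw [h1]
  exact Ideal.mul_mem_right _ _ hu

end EvalS

/-! ### E9.3 The coefficient rings `S`: complete DVRs, module-finite over `ℤ_p`, of characteristic zero -/

section SFacts

variable {p : ℕ} [Fact p.Prime]
variable (S : Type) [CommRing S] [IsDomain S] [IsDiscreteValuationRing S] [CharZero S]
  [Algebra ℤ_[p] S] [Module.Finite ℤ_[p] S]

/-- `p ∈ 𝔪_S` (Nakayama: `S = p·S` would force `S = 0`). -/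
theorem natCast_p_mem_maximalIdeal : (p : S) ∈ IsLocalRing.maximalIdeal S := by
  by_contra h
  have hu : IsUnit (p : S) := by
    rwa [IsLocalRing.mem_maximalIdeal, mem_nonunits_iff, not_not] at h
  obtain ⟨v, hv⟩ := hu.exists_left_inv
  have hle : (⊤ : Submodule ℤ_[p] S) ≤ IsLocalRing.maximalIdeal ℤ_[p] • (⊤ : Submodule ℤ_[p] S) := by
    intro s _
    have hs : s = (p : ℤ_[p]) • (v * s) := by
      rw [Algebra.smul_def, map_natCast, ← mul_assoc, mul_comm (p : S) v, hv, one_mul]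
    rw [hs]
    refine Submodule.smul_mem_smul ?_ Submodule.mem_top
    rw [PadicInt.maximalIdeal_eq_span_p]; exact Ideal.mem_span_singleton_self _
  have htop := Submodule.eq_bot_of_le_smul_of_le_jacobson_bot _ _ Module.Finite.fg_top hle
    (IsLocalRing.maximalIdeal_le_jacobson _)
  have h1 : (1 : S) ∈ (⊤ : Submodule ℤ_[p] S) := Submodule.mem_top
  rw [htop, Submodule.mem_bot] at h1
  exact one_ne_zero h1

theorem isUnit_one_sub_p_mulS (x : S) : IsUnit (1 - (p : S) * x) :=
  IsLocalRing.isUnit_one_sub_self_of_mem_nonunits _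
    ((IsLocalRing.maximalIdeal S).mul_mem_right x (natCast_p_mem_maximalIdeal S))

theorem natCast_p_ne_zeroS : (p : S) ≠ 0 := Nat.cast_ne_zero.mpr (Fact.out : p.Prime).ne_zero

theorem algebraMap_injectiveS : Function.Injective (algebraMap ℤ_[p] S) := by
  rw [injective_iff_map_eq_zero]
  intro c hc
  by_contra h0
  rw [PadicInt.unitCoeff_spec h0, map_mul, map_pow, map_natCast] at hc
  rcases mul_eq_zero.mp hc with h | h
  · exact ((PadicInt.unitCoeff h0).isUnit.map (algebraMap ℤ_[p] S)).ne_zero h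
  · exact pow_ne_zero _ (natCast_p_ne_zeroS S) h

/-- Some power of `p` lies in `(u)` for `u ≠ 0` (`u` is integral over `ℤ_p`; the constant term of a monic relation
with non-zero constant term is a multiple of `u` and divides a power of `p`). -/
theorem exists_pow_p_mem_spanS {u : S} (hu0 : u ≠ 0) : ∃ d : ℕ, (p : S) ^ d ∈ Ideal.span {u} := by
  classical
  obtain ⟨q, hqm, hq⟩ := (Algebra.IsIntegral.isIntegral (R := ℤ_[p]) u)
  rw [← Polynomial.aeval_def] at hq
  obtain ⟨q', hqq', hXq'⟩ := Polynomial.exists_eq_pow_rootMultiplicity_mul_and_not_dvd q hqm.ne_zero 0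
  rw [map_zero, sub_zero] at hqq' hXq'
  have hq'0 : Polynomial.aeval u q' = 0 := by
    rw [hqq', map_mul, map_pow, Polynomial.aeval_X] at hq
    exact (mul_eq_zero.mp hq).resolve_left (pow_ne_zero _ hu0)
  have hc0 : q'.coeff 0 ≠ 0 := fun h0 => hXq' (Polynomial.X_dvd_iff.mpr h0)
  have hc_mem : algebraMap ℤ_[p] S (q'.coeff 0) ∈ Ideal.span {u} := by
    have h1 := congrArg (Polynomial.aeval u) (Polynomial.X_mul_divX_add q')
    rw [hq'0, map_add, map_mul, Polynomial.aeval_X, Polynomial.aeval_C] at h1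
    have h2 : algebraMap ℤ_[p] S (q'.coeff 0) = u * (-(Polynomial.aeval u q'.divX)) := by
      linear_combination h1
    rw [h2]
    exact Ideal.mul_mem_right _ _ (Ideal.mem_span_singleton_self _)
  obtain ⟨n, hn⟩ := PadicInt.ideal_eq_span_pow_p (s := Ideal.span {q'.coeff 0})
    (by rwa [Ne, Ideal.span_singleton_eq_bot])
  have hpn : (p : ℤ_[p]) ^ n ∈ Ideal.span {q'.coeff 0} := hn ▸ Ideal.mem_span_singleton_self _
  obtain ⟨r, hr⟩ := Ideal.mem_span_singleton'.mp hpn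
  refine ⟨n, ?_⟩
  have : (p : S) ^ n = algebraMap ℤ_[p] S r * algebraMap ℤ_[p] S (q'.coeff 0) := by
    rw [← map_mul, hr, map_pow, map_natCast]
  rw [this]
  exact Ideal.mul_mem_left _ _ hc_mem

/-- **Depth is locally constant**: `(u + p^N a) = (u)` for `N > d`, `p^d ∈ (u)`. -/
theorem span_add_eqS {u : S} {d : ℕ} (hd : (p : S) ^ d ∈ Ideal.span {u}) {N : ℕ} (hN : d + 1 ≤ N) (a : S) :
    Ideal.span {u + (p : S) ^ N * a} = Ideal.span {u} := by
  obtain ⟨r, hr⟩ := Ideal.mem_span_singleton'.mp hd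
  obtain ⟨e, rfl⟩ := Nat.exists_eq_add_of_le hN
  have key : u + (p : S) ^ (d + 1 + e) * a = u * (1 - (p : S) * (-(r * (p : S) ^ e * a))) := by
    rw [show d + 1 + e = d + (e + 1) from by ring, pow_add, ← hr]; ring
  rw [key]
  exact Ideal.span_singleton_mul_right_unit (isUnit_one_sub_p_mulS S _) _

/-- Krull: a non-zero element of `S` is not divisible by every power of `p`. -/
theorem exists_not_pow_dvdS {a : S} (ha : a ≠ 0) : ∃ N : ℕ, ¬ (p : S) ^ N ∣ a := by
  by_contra h
  have h' : ∀ N : ℕ, (p : S) ^ N ∣ a := fun N => not_not.mp (not_exists.mp h N)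
  have hmem : a ∈ ⨅ n : ℕ, (Ideal.span {(p : S)}) ^ n := by
    rw [Ideal.mem_iInf]
    intro n
    rw [Ideal.span_singleton_pow, Ideal.mem_span_singleton]
    exact h' n
  have hne : Ideal.span {(p : S)} ≠ ⊤ := by
    rw [Ne, Ideal.eq_top_iff_one, Ideal.mem_span_singleton]
    exact fun h1 => natCast_p_mem_maximalIdeal S (isUnit_of_dvd_one h1)
  rw [Ideal.iInf_pow_eq_bot_of_isLocalRing _ hne, Ideal.mem_bot] at hmem
  exact ha hmem

/-- `u + p^{N+1} ∈ 𝔪_S` for `u ∈ 𝔪_S`: the APPROXIMANTS of a point. -/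
theorem approx_mem {u : S} (hu : u ∈ IsLocalRing.maximalIdeal S) (N : ℕ) :
    u + (p : S) ^ (N + 1) ∈ IsLocalRing.maximalIdeal S := by
  rw [pow_succ]
  exact Ideal.add_mem _ hu (Ideal.mul_mem_left _ _ (natCast_p_mem_maximalIdeal S))

end SFacts

/-! ### E9.4 `Λ_{2,S} = S⟦T₂⟧⟦T₁⟧`: the vertical prime through `u ∈ 𝔪_S`, `ev₂`, `𝔔̄_u`, (FT_S) -/

section LamS

open Summit.BirchSwinnertonDyer.BirchSwinnertonDyer.Theorems.SignedBaseChangeAcDivSpecialization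

variable {p : ℕ} [Fact p.Prime]
variable {S : Type} [CommRing S] [IsDomain S] [IsDiscreteValuationRing S]
  [IsAdicComplete (IsLocalRing.maximalIdeal S) S] [CharZero S] [Algebra ℤ_[p] S] [Module.Finite ℤ_[p] S]

theorem natCast_p_eq_CC : (p : PowerSeries (PowerSeries S)) = PowerSeries.C (PowerSeries.C (p : S)) := by
  rw [map_natCast, map_natCast]

theorem X_sub_C_ne_zero (u : S) : (PowerSeries.X - PowerSeries.C u : PowerSeries S) ≠ 0 := fun h => by
  have h1 := congrArg (PowerSeries.coeff 1) h
  rw [map_sub, PowerSeries.coeff_one_X, PowerSeries.coeff_C, if_neg one_ne_zero, sub_zero, map_zero] at h1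
  exact one_ne_zero h1

theorem verticalPrimeO_ne_zero (u : S) : verticalPrimeO S u ≠ 0 := fun h => by
  have h1 : PowerSeries.constantCoeff (verticalPrimeO S u) = PowerSeries.X - PowerSeries.C u :=
    PowerSeries.constantCoeff_C _
  rw [h, map_zero] at h1
  exact X_sub_C_ne_zero u h1.symm

/-- `T₂ - u` is prime in `S⟦T₂⟧` (`u ∈ 𝔪_S`): the kernel of `ev_u` onto the domain `S`. -/
theorem prime_X_sub_C {u : S} (hu : u ∈ IsLocalRing.maximalIdeal S) :
    Prime (PowerSeries.X - PowerSeries.C u : PowerSeries S) := by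
  have hker : RingHom.ker (evS hu) = Ideal.span {PowerSeries.X - PowerSeries.C u} := by
    ext F; rw [RingHom.mem_ker, evS_eq_zero_iff, Ideal.mem_span_singleton]
  rw [← Ideal.span_singleton_prime (X_sub_C_ne_zero u), ← hker]
  exact RingHom.ker_isPrime _

/-- **Evaluation `T₂ ↦ u` on `Λ_{2,S}`**: `S⟦T₂⟧⟦T₁⟧ → S⟦T₁⟧`, `T₁`-coefficientwise `ev_u`. -/
noncomputable def ev₂ {u : S} (hu : u ∈ IsLocalRing.maximalIdeal S) :
    PowerSeries (PowerSeries S) →+* PowerSeries S :=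
  PowerSeries.map (evS hu)

theorem coeff_ev₂ {u : S} (hu : u ∈ IsLocalRing.maximalIdeal S) (F : PowerSeries (PowerSeries S)) (n : ℕ) :
    PowerSeries.coeff n (ev₂ hu F) = evS hu (PowerSeries.coeff n F) := by
  rw [ev₂, PowerSeries.coeff_map]

theorem ev₂_fibreSection {u : S} (hu : u ∈ IsLocalRing.maximalIdeal S) (b : PowerSeries S) :
    ev₂ hu (fibreSection S b) = b := by
  ext n
  rw [coeff_ev₂, fibreSection, PowerSeries.coeff_map, evS_C]

theorem ev₂_comp_fibreSection {u : S} (hu : u ∈ IsLocalRing.maximalIdeal S) :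
    (ev₂ hu).comp (fibreSection S) = RingHom.id _ :=
  RingHom.ext (ev₂_fibreSection hu)

theorem ev₂_C {u : S} (hu : u ∈ IsLocalRing.maximalIdeal S) (f : PowerSeries S) :
    ev₂ hu (PowerSeries.C f) = PowerSeries.C (evS hu f) := by
  rw [ev₂, PowerSeries.map_C]

theorem ev₂_verticalPrimeO {u : S} (hu : u ∈ IsLocalRing.maximalIdeal S) : ev₂ hu (verticalPrimeO S u) = 0 := by
  rw [verticalPrimeO, ev₂_C, map_sub, evS_X, evS_C, sub_self, map_zero]

/-- `ker ev₂ = (T₂ - u)`. -/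
theorem ev₂_eq_zero_iff {u : S} (hu : u ∈ IsLocalRing.maximalIdeal S) (F : PowerSeries (PowerSeries S)) :
    ev₂ hu F = 0 ↔ verticalPrimeO S u ∣ F := by
  constructor
  · intro h
    show PowerSeries.C (PowerSeries.X - PowerSeries.C u) ∣ F
    refine C_dvd_of_forall_dvd_coeff fun n => (evS_eq_zero_iff hu _).mp ?_
    rw [← coeff_ev₂, h, map_zero]
  · rintro ⟨H, rfl⟩
    rw [map_mul, ev₂_verticalPrimeO, zero_mul]

theorem ev₂_surjective {u : S} (hu : u ∈ IsLocalRing.maximalIdeal S) : Function.Surjective (ev₂ hu) :=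
  fun b => ⟨fibreSection S b, ev₂_fibreSection hu b⟩

theorem ker_ev₂ {u : S} (hu : u ∈ IsLocalRing.maximalIdeal S) :
    RingHom.ker (ev₂ hu) = Ideal.span {verticalPrimeO S u} := by
  ext F; rw [RingHom.mem_ker, ev₂_eq_zero_iff, Ideal.mem_span_singleton]

/-- `T₂ - u` is PRIME in `Λ_{2,S}`. -/
theorem prime_verticalPrimeO {u : S} (hu : u ∈ IsLocalRing.maximalIdeal S) : Prime (verticalPrimeO S u) := by
  rw [← Ideal.span_singleton_prime (verticalPrimeO_ne_zero u), ← ker_ev₂ hu]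
  exact RingHom.ker_isPrime _

/-- The point `(T₂ - u) ∈ Spec Λ_{2,S}`. -/
noncomputable def ptS {u : S} (hu : u ∈ IsLocalRing.maximalIdeal S) : PrimeSpectrum (PowerSeries (PowerSeries S)) :=
  ⟨Ideal.span {verticalPrimeO S u},
    (Ideal.span_singleton_prime (verticalPrimeO_ne_zero u)).mpr (prime_verticalPrimeO hu)⟩

theorem ptS_asIdeal {u : S} (hu : u ∈ IsLocalRing.maximalIdeal S) :
    (ptS hu).asIdeal = Ideal.span {verticalPrimeO S u} := rfl

theorem height_ptS {u : S} (hu : u ∈ IsLocalRing.maximalIdeal S) : (ptS hu).asIdeal.height = 1 :=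
  Ideal.height_span_singleton_eq_one_of_mem_nonZeroDivisors
    (mem_nonZeroDivisors_of_ne_zero (verticalPrimeO_ne_zero u)) (prime_verticalPrimeO hu).not_unit

/-- **`S⟦T₁⟧ ≅ Λ_{2,S}/(T₂ - u)`** induced by `ev₂`. -/
noncomputable def eqvS {u : S} (hu : u ∈ IsLocalRing.maximalIdeal S) :
    PowerSeries S ≃+* (PowerSeries (PowerSeries S) ⧸ Ideal.span {verticalPrimeO S u}) :=
  ((ev₂ hu).quotientKerEquivOfSurjective (ev₂_surjective hu)).symm.trans (Ideal.quotEquivOfEq (ker_ev₂ hu))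

theorem eqvS_ev₂ {u : S} (hu : u ∈ IsLocalRing.maximalIdeal S) (x : PowerSeries (PowerSeries S)) :
    eqvS hu (ev₂ hu x) = Ideal.Quotient.mk _ x := by
  rw [eqvS, RingEquiv.trans_apply, RingHom.quotientKerEquivOfSurjective_symm_apply, Ideal.quotEquivOfEq_mk]

theorem eqvS_apply {u : S} (hu : u ∈ IsLocalRing.maximalIdeal S) (b : PowerSeries S) :
    eqvS hu b = Ideal.Quotient.mk _ (fibreSection S b) := by
  rw [← eqvS_ev₂ hu, ev₂_fibreSection]

theorem eqvS_symm_mk {u : S} (hu : u ∈ IsLocalRing.maximalIdeal S) (x : PowerSeries (PowerSeries S)) :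
    (eqvS hu).symm (Ideal.Quotient.mk _ x) = ev₂ hu x := by
  rw [← eqvS_ev₂ hu, RingEquiv.symm_apply_apply]

variable (S) in
/-- `𝔫_S = ker(S⟦T₁⟧ → κ_S⟦T₁⟧) = 𝔪_S · S⟦T₁⟧`. -/
noncomputable def kerRes₁ : Ideal (PowerSeries S) := RingHom.ker (PowerSeries.map (IsLocalRing.residue S))

theorem mem_kerRes₁_iff {f : PowerSeries S} :
    f ∈ kerRes₁ S ↔ ∀ n, PowerSeries.coeff n f ∈ IsLocalRing.maximalIdeal S := by
  rw [kerRes₁, RingHom.mem_ker, PowerSeries.ext_iff]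
  refine forall_congr' fun n => ?_
  rw [PowerSeries.coeff_map, map_zero, IsLocalRing.residue_eq_zero_iff]

theorem kerRes₁_isPrime : (kerRes₁ S).IsPrime := RingHom.ker_isPrime _

theorem kerRes₁_eq_span {ϖ : S} (hϖ : IsLocalRing.maximalIdeal S = Ideal.span {ϖ}) :
    kerRes₁ S = Ideal.span {PowerSeries.C ϖ} := by
  ext f
  rw [mem_kerRes₁_iff, Ideal.mem_span_singleton, hϖ]
  simp_rw [Ideal.mem_span_singleton]
  exact ⟨C_dvd_of_forall_dvd_coeff, dvd_coeff_of_C_dvd⟩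

variable (S) in
/-- `𝔔₀,S = ker(Λ_{2,S} → κ_{S⟦T₂⟧}⟦T₁⟧)`: `T₁`-coefficientwise reduction modulo `𝔪_{S⟦T₂⟧} = (ϖ, T₂)`. -/
noncomputable def kerResS : Ideal (PowerSeries (PowerSeries S)) :=
  RingHom.ker (PowerSeries.map (IsLocalRing.residue (PowerSeries S)))

theorem mem_kerResS_iff {F : PowerSeries (PowerSeries S)} :
    F ∈ kerResS S ↔ ∀ n, PowerSeries.constantCoeff (PowerSeries.coeff n F) ∈ IsLocalRing.maximalIdeal S := by
  rw [kerResS, RingHom.mem_ker, PowerSeries.ext_iff]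
  refine forall_congr' fun n => ?_
  rw [PowerSeries.coeff_map, map_zero, IsLocalRing.residue_eq_zero_iff, IsLocalRing.mem_maximalIdeal,
    IsLocalRing.mem_maximalIdeal, mem_nonunits_iff, mem_nonunits_iff, PowerSeries.isUnit_iff_constantCoeff]

theorem natCast_mem_kerResS : (p : PowerSeries (PowerSeries S)) ∈ kerResS S := by
  rw [mem_kerResS_iff]
  intro n
  rw [natCast_p_eq_CC, PowerSeries.coeff_C]
  split_ifs
  · rw [PowerSeries.constantCoeff_C]; exact natCast_p_mem_maximalIdeal S
  · rw [map_zero]; exact Ideal.zero_mem _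

/-- **The residue criterion**: `ev₂_u F ∈ 𝔫_S ⟺ F ∈ 𝔔₀,S` — independent of `u ∈ 𝔪_S`. -/
theorem ev₂_mem_kerRes₁_iff {u : S} (hu : u ∈ IsLocalRing.maximalIdeal S) (F : PowerSeries (PowerSeries S)) :
    ev₂ hu F ∈ kerRes₁ S ↔ F ∈ kerResS S := by
  rw [mem_kerRes₁_iff, mem_kerResS_iff]
  refine forall_congr' fun n => ?_
  rw [coeff_ev₂]
  have h := evS_sub_constantCoeff_mem hu (PowerSeries.coeff n F)
  constructor
  · intro h1; have := Ideal.sub_mem _ h1 h; rwa [sub_sub_cancel] at this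
  · intro h1; have := Ideal.add_mem _ h h1; rwa [sub_add_cancel] at this

/-- The prime `𝔔̄_u` of the fibre ring `Λ_{2,S}/(T₂ - u)`: the transport of `𝔫_S` along `eqvS`. -/
noncomputable def qbarS {u : S} (hu : u ∈ IsLocalRing.maximalIdeal S) :
    PrimeSpectrum (PowerSeries (PowerSeries S) ⧸ Ideal.span {verticalPrimeO S u}) :=
  ⟨(kerRes₁ S).comap (eqvS hu).symm, by haveI := kerRes₁_isPrime (S := S); infer_instance⟩

theorem qbarS_asIdeal {u : S} (hu : u ∈ IsLocalRing.maximalIdeal S) :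
    (qbarS hu).asIdeal = (kerRes₁ S).comap (eqvS hu).symm := rfl

/-- `v̄ ∈ 𝔔̄_u ⟺ v ∈ 𝔔₀,S`. -/
theorem mk_mem_qbarS_iff {u : S} (hu : u ∈ IsLocalRing.maximalIdeal S) {v : PowerSeries (PowerSeries S)} :
    Ideal.Quotient.mk (Ideal.span {verticalPrimeO S u}) v ∈ (qbarS hu).asIdeal ↔ v ∈ kerResS S := by
  show (eqvS hu).symm (Ideal.Quotient.mk _ v) ∈ kerRes₁ S ↔ _
  rw [eqvS_symm_mk, ev₂_mem_kerRes₁_iff]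

theorem natCast_mem_qbarS {u : S} (hu : u ∈ IsLocalRing.maximalIdeal S) :
    Ideal.Quotient.mk (Ideal.span {verticalPrimeO S u}) (p : PowerSeries (PowerSeries S)) ∈
      (qbarS hu).asIdeal :=
  (mk_mem_qbarS_iff hu).mpr natCast_mem_kerResS

theorem not_verticalPrimeO_dvd_natCast {u : S} (hu : u ∈ IsLocalRing.maximalIdeal S) :
    ¬ verticalPrimeO S u ∣ (p : PowerSeries (PowerSeries S)) := by
  rw [← ev₂_eq_zero_iff hu, map_natCast]
  intro h
  have := congrArg PowerSeries.constantCoeff h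
  rw [map_natCast, map_zero] at this
  exact natCast_p_ne_zeroS S this

theorem mk_natCast_ne_zeroS {u : S} (hu : u ∈ IsLocalRing.maximalIdeal S) :
    Ideal.Quotient.mk (Ideal.span {verticalPrimeO S u}) (p : PowerSeries (PowerSeries S)) ≠ 0 := by
  rw [Ne, Ideal.Quotient.eq_zero_iff_mem, Ideal.mem_span_singleton]
  exact not_verticalPrimeO_dvd_natCast hu

/-- `𝔔̄_u = (ϖ̄)` for a uniformiser `ϖ` of `S`. -/
theorem qbarS_asIdeal_eq_span {u : S} (hu : u ∈ IsLocalRing.maximalIdeal S) {ϖ : S}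
    (hϖ : IsLocalRing.maximalIdeal S = Ideal.span {ϖ}) :
    (qbarS hu).asIdeal = Ideal.span {Ideal.Quotient.mk (Ideal.span {verticalPrimeO S u})
      (PowerSeries.C (PowerSeries.C ϖ))} := by
  rw [qbarS_asIdeal, Ideal.comap_symm, kerRes₁_eq_span hϖ, Ideal.map_span, Set.image_singleton, eqvS_apply,
    fibreSection, PowerSeries.map_C]

/-- **`𝔔̄_u` has height one.** -/
theorem height_qbarS {u : S} (hu : u ∈ IsLocalRing.maximalIdeal S) : (qbarS hu).asIdeal.height = 1 := by
  obtain ⟨ϖ, hirr⟩ := IsDiscreteValuationRing.exists_irreducible S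
  have hϖ := (IsDiscreteValuationRing.irreducible_iff_uniformizer ϖ).mp hirr
  have heq := qbarS_asIdeal_eq_span hu hϖ
  haveI : (Ideal.span {verticalPrimeO S u}).IsPrime := (ptS hu).isPrime
  rw [heq]
  refine Ideal.height_span_singleton_eq_one_of_mem_nonZeroDivisors (mem_nonZeroDivisors_of_ne_zero ?_) ?_
  · rw [Ne, Ideal.Quotient.eq_zero_iff_mem, Ideal.mem_span_singleton, ← ev₂_eq_zero_iff hu, ev₂_C, evS_C]
    intro h
    have := congrArg PowerSeries.constantCoeff h
    rw [PowerSeries.constantCoeff_C, map_zero] at this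
    exact hirr.ne_zero this
  · intro hunit
    refine (qbarS hu).isPrime.ne_top (Ideal.eq_top_of_isUnit_mem _ ?_ hunit)
    rw [heq]; exact Ideal.mem_span_singleton_self _

/-- **(FT_S) fibre transport over `S`**: the fibre bound `p^t G ∈ ch(Y/(T₂-u)Y)·section + (T₂ - u)` (the
`S⟦T₁⟧`-structure through the section) IS `p^t · Ḡ ∈ ch_{Λ_{2,S}/(T₂-u)}(Y/(T₂-u)Y)` along `eqvS`. -/
theorem fibre_transportS {u : S} (hu : u ∈ IsLocalRing.maximalIdeal S) (Y : Type) [AddCommGroup Y]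
    [Module (PowerSeries (PowerSeries S)) Y] (G : PowerSeries (PowerSeries S)) (t : ℕ)
    (h : FibreBoundAt S p Y G u t) :
    Ideal.Quotient.mk (Ideal.span {verticalPrimeO S u}) ((p : PowerSeries (PowerSeries S)) ^ t * G) ∈
      Module.charIdeal (PowerSeries (PowerSeries S) ⧸ Ideal.span {verticalPrimeO S u})
        (QuotSMulTop (verticalPrimeO S u) Y) := by
  letI inst : Module (PowerSeries S) (QuotSMulTop (verticalPrimeO S u) Y) := Module.compHom _ (fibreSection S)
  have h0 : (p : PowerSeries (PowerSeries S)) ^ t * G ∈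
      (Module.charIdeal (PowerSeries S) (QuotSMulTop (verticalPrimeO S u) Y)).map (fibreSection S) ⊔
        Ideal.span {verticalPrimeO S u} := h
  have h1 := Ideal.mem_map_of_mem (ev₂ hu) h0
  rw [Ideal.map_sup, Ideal.map_map, ev₂_comp_fibreSection, Ideal.map_id, Ideal.map_span, Set.image_singleton,
    ev₂_verticalPrimeO, Ideal.span_singleton_zero, sup_bot_eq] at h1
  have he : ∀ (b : PowerSeries S) (f : QuotSMulTop (verticalPrimeO S u) Y),
      (AddEquiv.refl _) (b • f) = eqvS hu b • (AddEquiv.refl _) f := by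
    intro b f
    obtain ⟨y, rfl⟩ := Submodule.Quotient.mk_surjective _ f
    rw [AddEquiv.refl_apply, AddEquiv.refl_apply, eqvS_apply]
    rfl
  rw [Module.charIdeal_eq_map_of_semilinearEquiv (eqvS hu) (AddEquiv.refl _) he, ← eqvS_ev₂]
  exact Ideal.mem_map_of_mem _ h1

/-! ### E9.5 Isolated zeros along the approximants `u₀ + p^{N+1}` -/

/-- **Isolated zeros**: `f ≠ 0` in `S⟦T₂⟧` ⟹ `f(u₀ + p^{N+1}) ≠ 0` for all `N ≥ N₁` (`f = (T₂-u₀)^r d`,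
`d(u₀) ≠ 0`, Krull `p^{N₁} ∤ d(u₀)`, congruence `d(u') ≡ d(u₀) mod p^{N+1}`). -/
theorem eventually_evS_ne_zero {u₀ : S} (hu₀ : u₀ ∈ IsLocalRing.maximalIdeal S) {f : PowerSeries S}
    (hf : f ≠ 0) : ∃ N₁ : ℕ, ∀ N, N₁ ≤ N → evS (approx_mem (p := p) S hu₀ N) f ≠ 0 := by
  classical
  obtain ⟨r, d, hd, rfl⟩ := WfDvdMonoid.max_power_factor hf (prime_X_sub_C hu₀).irreducible
  have ha : evS hu₀ d ≠ 0 := fun h => hd ((evS_eq_zero_iff hu₀ d).mp h)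
  obtain ⟨N₁, hN₁⟩ := exists_not_pow_dvdS (p := p) S ha
  refine ⟨N₁, fun N hN h0 => hN₁ ?_⟩
  rw [map_mul, map_pow, map_sub, evS_X, evS_C, add_sub_cancel_left, mul_eq_zero] at h0
  have h1 : evS (approx_mem (p := p) S hu₀ N) d = 0 :=
    h0.resolve_left (pow_ne_zero _ (pow_ne_zero _ (natCast_p_ne_zeroS S)))
  have h2 := sub_dvd_evS_sub hu₀ (approx_mem (p := p) S hu₀ N) d
  rw [add_sub_cancel_left, h1, zero_sub, dvd_neg] at h2
  exact (pow_dvd_pow _ (by omega : N₁ ≤ N + 1)).trans h2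

theorem exists_coeff_ne_zero' {F : PowerSeries (PowerSeries S)} (hF : F ≠ 0) :
    ∃ n, PowerSeries.coeff n F ≠ 0 := by
  by_contra h
  exact hF (PowerSeries.ext fun n => by rw [map_zero]; exact not_not.mp (not_exists.mp h n))

/-- **Annihilator avoidance along the approximants**: `(T₂ - u₀ - p^{N+1}) ∤ c` for `N ≥ N₁` (`c ≠ 0`). -/
theorem eventually_not_dvd {u₀ : S} (hu₀ : u₀ ∈ IsLocalRing.maximalIdeal S)
    {c : PowerSeries (PowerSeries S)} (hc : c ≠ 0) :
    ∃ N₁ : ℕ, ∀ N, N₁ ≤ N → ¬ verticalPrimeO S (u₀ + (p : S) ^ (N + 1)) ∣ c := by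
  obtain ⟨n, hn⟩ := exists_coeff_ne_zero' hc
  obtain ⟨N₁, hN₁⟩ := eventually_evS_ne_zero (p := p) hu₀ hn
  refine ⟨N₁, fun N hN hdvd => hN₁ N hN ?_⟩
  rw [← ev₂_eq_zero_iff (approx_mem S hu₀ N)] at hdvd
  rw [← coeff_ev₂, hdvd, map_zero]

/-- `T₂ - u₀ = (T₂ - u₀ - p^{N+1}) + p^{N+1}` in `Λ_{2,S}`. -/
theorem verticalPrimeO_eq_add (u₀ : S) (N : ℕ) :
    verticalPrimeO S u₀ = verticalPrimeO S (u₀ + (p : S) ^ (N + 1)) +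
      (p : PowerSeries (PowerSeries S)) ^ (N + 1) := by
  show PowerSeries.C (PowerSeries.X - PowerSeries.C u₀) =
    PowerSeries.C (PowerSeries.X - PowerSeries.C (u₀ + (p : S) ^ (N + 1))) +
      (p : PowerSeries (PowerSeries S)) ^ (N + 1)
  rw [natCast_p_eq_CC, ← map_pow, ← map_pow, ← map_add, map_add (PowerSeries.C (R := S)) u₀]
  congr 1
  ring

/-! ### E9.6 The degree-one vertical theorem over `S` (PROVED) -/

/-- **The vertical theorem over `S`**: `Y` f.g. over `Λ_{2,S}` killed by `c ≠ 0`, fibre bounds of slack `≤ t₀`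
at `u' = u₀ + p^{N+1}` (`N ≥ N₀`) ⟹ `(T₂-u₀)^{ℓ(Y)} ∣ G` (= `vertical_dvd` with `r = 1`, isolated zeros). -/
theorem verticalS_dvd {u₀ : S} (hu₀ : u₀ ∈ IsLocalRing.maximalIdeal S)
    (Y : Type) [AddCommGroup Y] [Module (PowerSeries (PowerSeries S)) Y]
    [Module.Finite (PowerSeries (PowerSeries S)) Y]
    {c : PowerSeries (PowerSeries S)} (hc0 : c ≠ 0) (hcY : ∀ y : Y, c • y = 0)
    (G : PowerSeries (PowerSeries S)) (N₀ t₀ : ℕ)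
    (hbd : ∀ N, N₀ ≤ N → ∃ t, t ≤ t₀ ∧ FibreBoundAt S p Y G (u₀ + (p : S) ^ (N + 1)) t) :
    verticalPrimeO S u₀ ^ (Module.lengthAt (PowerSeries (PowerSeries S)) Y (ptS hu₀)).toNat ∣ G := by
  classical
  have hπ : Prime (verticalPrimeO S u₀) := prime_verticalPrimeO hu₀
  set k := (Module.lengthAt (PowerSeries (PowerSeries S)) Y (ptS hu₀)).toNat with hk
  by_cases hG0 : G = 0
  · rw [hG0]; exact dvd_zero _
  obtain ⟨g, G₁, hG₁, rfl⟩ := WfDvdMonoid.max_power_factor hG0 hπ.irreducible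
  by_cases hkg : k ≤ g
  · exact (pow_dvd_pow _ hkg).trans (dvd_mul_right _ _)
  exfalso
  have hgk : g < k := by omega
  have hktop : Module.lengthAt (PowerSeries (PowerSeries S)) Y (ptS hu₀) ≠ ⊤ :=
    Module.lengthAt_ne_top_of_isTorsionBy hc0 (fun y => hcY y) _ (height_ptS hu₀).le
  have hkeq : (k : ℕ∞) = Module.lengthAt (PowerSeries (PowerSeries S)) Y (ptS hu₀) := by
    rw [hk]; exact ENat.coe_toNat hktop
  -- DEPTH of `G₁` at `u₀`, read at `𝔔̄_{u₀}`
  haveI : (Ideal.span {verticalPrimeO S u₀}).IsPrime := (ptS hu₀).isPrime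
  have hG₁bar : Ideal.Quotient.mk (Ideal.span {verticalPrimeO S u₀}) G₁ ≠ 0 := by
    rw [Ne, Ideal.Quotient.eq_zero_iff_mem, Ideal.mem_span_singleton]; exact hG₁
  obtain ⟨m, sbar, hbar, hs𝔔, hdepth⟩ :=
    exists_depth (qbarS hu₀) (height_qbarS hu₀) (natCast_mem_qbarS (p := p) hu₀) hG₁bar
  obtain ⟨s₀, rfl⟩ := Ideal.Quotient.mk_surjective sbar
  obtain ⟨h₀, rfl⟩ := Ideal.Quotient.mk_surjective hbar
  have hs₀ : s₀ ∉ kerResS S := fun h => hs𝔔 ((mk_mem_qbarS_iff hu₀).mpr h)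
  have hr₁ : ∃ r₁ : PowerSeries (PowerSeries S),
      s₀ * (p : PowerSeries (PowerSeries S)) ^ m = G₁ * h₀ + verticalPrimeO S u₀ * r₁ := by
    have h1 : Ideal.Quotient.mk (Ideal.span {verticalPrimeO S u₀}) (s₀ * (p : PowerSeries (PowerSeries S)) ^ m) =
        Ideal.Quotient.mk (Ideal.span {verticalPrimeO S u₀}) (G₁ * h₀) := by
      rw [map_mul, map_mul, map_pow]; exact hdepth
    rw [Ideal.Quotient.eq, Ideal.mem_span_singleton] at h1
    obtain ⟨r₁, hr₁⟩ := h1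
    exact ⟨r₁, by rw [← hr₁]; ring⟩
  obtain ⟨r₁, hr₁⟩ := hr₁
  -- ISOLATED ZEROS: the approximant `u' = u₀ + p^{N+1}` with `π' ∤ c`, `N ≥ N₀`, `N ≥ m + 1 + t₀`
  obtain ⟨N₁, hN₁⟩ := eventually_not_dvd (p := p) hu₀ hc0
  obtain ⟨N, hNN₀, hNN₁, hNm⟩ : ∃ N, N₀ ≤ N ∧ N₁ ≤ N ∧ m + 1 + t₀ ≤ N :=
    ⟨N₀ + N₁ + (m + 1 + t₀), by omega, by omega, by omega⟩
  obtain ⟨t, ht, hFB⟩ := hbd N hNN₀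
  have hcN : ¬ verticalPrimeO S (u₀ + (p : S) ^ (N + 1)) ∣ c := hN₁ N hNN₁
  have hu' : u₀ + (p : S) ^ (N + 1) ∈ IsLocalRing.maximalIdeal S := approx_mem S hu₀ N
  have hCP := verticalPrimeO_eq_add (p := p) u₀ N
  set π' := verticalPrimeO S (u₀ + (p : S) ^ (N + 1)) with hπ'def
  have hs : Prime π' := prime_verticalPrimeO hu'
  -- `π ∤ π'` and `π' ∤ π` (else a vertical prime divides `p`)
  have hπs : ¬ verticalPrimeO S u₀ ∣ π' := fun h => by
    have h2 : verticalPrimeO S u₀ ∣ (p : PowerSeries (PowerSeries S)) ^ (N + 1) := by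
      have h3 := dvd_sub (dvd_refl (verticalPrimeO S u₀)) h
      rwa [hCP, add_sub_cancel_left, ← hCP] at h3
    exact not_verticalPrimeO_dvd_natCast hu₀ (hπ.dvd_of_dvd_pow h2)
  have hsπ : ¬ π' ∣ verticalPrimeO S u₀ := fun h => by
    have h2 : π' ∣ (p : PowerSeries (PowerSeries S)) ^ (N + 1) := by
      have h3 := dvd_sub h (dvd_refl π')
      rwa [hCP, add_sub_cancel_left] at h3
    exact not_verticalPrimeO_dvd_natCast hu' (hs.dvd_of_dvd_pow h2)
  obtain ⟨e, hNe⟩ : ∃ e, N + 1 = m + (1 + t + e) := ⟨N - m - t, by omega⟩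
  -- currency `A = Λ_{2,S}/(π')`, `M = Y/π'Y`
  haveI : (Ideal.span {π'}).IsPrime := (Ideal.span_singleton_prime hs.ne_zero).mpr hs
  haveI := LB.isScalarTower_quotSMulTop π' Y
  haveI : Module.Finite (PowerSeries (PowerSeries S) ⧸ Ideal.span {π'}) (QuotSMulTop π' Y) :=
    Module.Finite.of_restrictScalars_finite (PowerSeries (PowerSeries S)) _ _
  -- (FT_S) and (LB) at `u'`
  have hmem := fibre_transportS hu' Y (verticalPrimeO S u₀ ^ g * G₁) t hFB
  have hlen := le_trans le_self_add
    (LB.lowerBound_devissage hs hπ hπs hcN (qbarS hu') (height_qbarS hu') Y hcY)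
  have hpt : (⟨Ideal.span {verticalPrimeO S u₀}, (Ideal.span_singleton_prime hπ.ne_zero).mpr hπ⟩ :
      PrimeSpectrum (PowerSeries (PowerSeries S))) = ptS hu₀ := rfl
  rw [hpt, ← hkeq] at hlen
  -- the elements of `A`
  set mk := Ideal.Quotient.mk (Ideal.span {π'}) with hmk
  have hcbar : mk c ≠ 0 := by
    rw [Ne, hmk, Ideal.Quotient.eq_zero_iff_mem, Ideal.mem_span_singleton]; exact hcN
  have hcM : ∀ x : QuotSMulTop π' Y, mk c • x = 0 := by
    intro x
    obtain ⟨x, rfl⟩ := Submodule.mkQ_surjective _ x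
    show c • (Submodule.Quotient.mk x : QuotSMulTop π' Y) = 0
    rw [← Submodule.Quotient.mk_smul, hcY, Submodule.Quotient.mk_zero]
  have hq0 : mk (p : PowerSeries (PowerSeries S)) ≠ 0 := mk_natCast_ne_zeroS hu'
  have hπ0 : mk (verticalPrimeO S u₀) ≠ 0 := by
    rw [Ne, hmk, Ideal.Quotient.eq_zero_iff_mem, Ideal.mem_span_singleton]; exact hsπ
  have hπr : mk (verticalPrimeO S u₀) = mk (p : PowerSeries (PowerSeries S)) ^ (N + 1) * 1 := by
    rw [hCP, map_add, map_pow, hmk, Ideal.Quotient.eq_zero_iff_mem.mpr (Ideal.mem_span_singleton_self _),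
      zero_add, mul_one]
  -- `v = s₀ - p^{1+t+e} r₁ ∉ 𝔔₀,S`, `Ḡ₁ h̄₀ = q^m v̄`
  set v : PowerSeries (PowerSeries S) := s₀ - (p : PowerSeries (PowerSeries S)) ^ (1 + t + e) * r₁ with hv
  have hv𝔔 : mk v ∉ (qbarS hu').asIdeal := by
    intro h
    rw [hmk, mk_mem_qbarS_iff] at h
    apply hs₀
    have hmem' : (p : PowerSeries (PowerSeries S)) ^ (1 + t + e) * r₁ ∈ kerResS S := by
      rw [pow_add, pow_add, pow_one, mul_assoc, mul_assoc]
      exact Ideal.mul_mem_right _ _ (natCast_mem_kerResS (p := p))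
    have := (kerResS S).add_mem h hmem'
    rwa [hv, sub_add_cancel] at this
  have hGh : mk (G₁ * h₀) = mk (p : PowerSeries (PowerSeries S)) ^ m * mk v := by
    have hid : G₁ * h₀ = (p : PowerSeries (PowerSeries S)) ^ m * v - π' * r₁ := by
      have hN' : (p : PowerSeries (PowerSeries S)) ^ (N + 1) = (p : PowerSeries (PowerSeries S)) ^ m *
          (p : PowerSeries (PowerSeries S)) ^ (1 + t + e) := by
        rw [← pow_add, hNe]
      have h1 : G₁ * h₀ = s₀ * (p : PowerSeries (PowerSeries S)) ^ m - verticalPrimeO S u₀ * r₁ := by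
        rw [hr₁]; ring
      rw [h1, hCP, hN', hv]; ring
    rw [hid, map_sub, map_mul, map_mul, map_pow, hmk,
      Ideal.Quotient.eq_zero_iff_mem.mpr (Ideal.mem_span_singleton_self _), zero_mul, sub_zero]
  -- H2: `q^t π̄^g (q^m v̄) ∈ ch_A(M)`
  have H2 : mk (p : PowerSeries (PowerSeries S)) ^ t * mk (verticalPrimeO S u₀) ^ g *
      (mk (p : PowerSeries (PowerSeries S)) ^ m * mk v) ∈
      Module.charIdeal (PowerSeries (PowerSeries S) ⧸ Ideal.span {π'}) (QuotSMulTop π' Y) := by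
    have h2 := Ideal.mul_mem_right (mk h₀) _ hmem
    have heq : mk ((p : PowerSeries (PowerSeries S)) ^ t * (verticalPrimeO S u₀ ^ g * G₁)) * mk h₀ =
        mk (p : PowerSeries (PowerSeries S)) ^ t * mk (verticalPrimeO S u₀) ^ g *
          (mk (p : PowerSeries (PowerSeries S)) ^ m * mk v) := by
      rw [← hGh]; simp only [map_mul, map_pow]; ring
    rw [hmk] at heq h2
    rw [hmk, ← heq]; exact h2
  have hN : t + m < N + 1 := by omega
  exact endgame_quant hcbar hcM (qbarS hu') (height_qbarS hu') (natCast_mem_qbarS (p := p) hu') hq0 hπ0 hπr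
    hv𝔔 hgk hN hlen H2

end LamS

/-! ### E9.7 Flat base change `Λ₂ → Λ_{2,S}` (free on `C C bⱼ`) and the dévissage inequality
`ℓ_{𝔓'}(Λ_{2,S}/C P) · ℓ_𝔓(N) ≤ ℓ_{𝔓'}(Λ_{2,S} ⊗_{Λ₂} N)` -/

section DoorS

variable {p : ℕ} [Fact p.Prime]

/-- `Λ_{2,S}` as a `Λ₂`-algebra by coefficient extension — the `letI` structure of `PatchingBeta` /
`FibreBoundOver` (a local instance for §E9.7–E9.9). -/
@[reducible] noncomputable def algS (p : ℕ) [Fact p.Prime] (S : Type) [CommRing S] [Algebra ℤ_[p] S] :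
    Algebra (IwasawaAlgebra₂ p) (PowerSeries (PowerSeries S)) :=
  (PowerSeries.map (PowerSeries.map (algebraMap ℤ_[p] S))).toAlgebra

attribute [local instance] algS

section BaseChange

variable (S : Type) [CommRing S] [IsDomain S] [IsDiscreteValuationRing S]
  [IsAdicComplete (IsLocalRing.maximalIdeal S) S] [CharZero S] [Algebra ℤ_[p] S] [Module.Finite ℤ_[p] S]

theorem algebraMap_S (r : IwasawaAlgebra₂ p) :
    algebraMap (IwasawaAlgebra₂ p) (PowerSeries (PowerSeries S)) r =
      PowerSeries.map (PowerSeries.map (algebraMap ℤ_[p] S)) r := rfl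

theorem coeff_coeff_algebraMap (r : IwasawaAlgebra₂ p) (i k : ℕ) :
    PowerSeries.coeff k (PowerSeries.coeff i (algebraMap (IwasawaAlgebra₂ p) (PowerSeries (PowerSeries S)) r)) =
      algebraMap ℤ_[p] S (PowerSeries.coeff k (PowerSeries.coeff i r)) := by
  rw [algebraMap_S, PowerSeries.coeff_map, PowerSeries.coeff_map]

theorem algebraMap_injective₂ :
    Function.Injective (algebraMap (IwasawaAlgebra₂ p) (PowerSeries (PowerSeries S))) := by
  intro a b h
  ext i k
  apply algebraMap_injectiveS S
  rw [← coeff_coeff_algebraMap, ← coeff_coeff_algebraMap, h]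

theorem algebraMap_ne_zero₂ {r : IwasawaAlgebra₂ p} (hr : r ≠ 0) :
    algebraMap (IwasawaAlgebra₂ p) (PowerSeries (PowerSeries S)) r ≠ 0 :=
  fun h => hr (algebraMap_injective₂ S (by rw [h, map_zero]))

/-- `r • C (C s)` coefficientwise. -/
theorem coeff_coeff_smul_CC (r : IwasawaAlgebra₂ p) (s : S) (i k : ℕ) :
    PowerSeries.coeff k (PowerSeries.coeff i
        (r • (PowerSeries.C (PowerSeries.C s) : PowerSeries (PowerSeries S)))) =
      PowerSeries.coeff k (PowerSeries.coeff i r) • s := by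
  rw [Algebra.smul_def, algebraMap_S, PowerSeries.coeff_mul_C, PowerSeries.coeff_map, PowerSeries.coeff_mul_C,
    PowerSeries.coeff_map, Algebra.smul_def]

/-- **`Λ_{2,S}` is free of finite rank over `Λ₂`** (on `C C bⱼ` for a `ℤ_p`-basis `bⱼ` of the finite
torsion-free, hence free, `ℤ_p`-module `S`). -/
theorem exists_linearEquiv_pi :
    ∃ n : ℕ, Nonempty (PowerSeries (PowerSeries S) ≃ₗ[IwasawaAlgebra₂ p] (Fin n → IwasawaAlgebra₂ p)) := by
  classical
  haveI : Module.IsTorsionFree ℤ_[p] S := Module.isTorsionFree_iff_smul_eq_zero.mpr fun r m h => by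
    rw [Algebra.smul_def, mul_eq_zero] at h
    exact h.imp_left fun h0 => algebraMap_injectiveS S (by rw [h0, map_zero])
  haveI : Module.Free ℤ_[p] S := Module.free_of_finite_type_torsion_free'
  let b := Module.finBasis ℤ_[p] S
  refine ⟨Module.finrank ℤ_[p] S, ⟨?_⟩⟩
  let Φ : (Fin (Module.finrank ℤ_[p] S) → IwasawaAlgebra₂ p) →ₗ[IwasawaAlgebra₂ p]
      PowerSeries (PowerSeries S) :=
    { toFun := fun f => ∑ j, f j • (PowerSeries.C (PowerSeries.C (b j)) : PowerSeries (PowerSeries S))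
      map_add' := fun f g => by
        simp only [Pi.add_apply, add_smul, Finset.sum_add_distrib]
      map_smul' := fun r f => by
        simp only [Pi.smul_apply, smul_eq_mul, mul_smul, Finset.smul_sum, RingHom.id_apply] }
  have hΦ : ∀ f i k, PowerSeries.coeff k (PowerSeries.coeff i (Φ f)) =
      b.equivFun.symm (fun j => PowerSeries.coeff k (PowerSeries.coeff i (f j))) := by
    intro f i k
    rw [b.equivFun_symm_apply]
    show PowerSeries.coeff k (PowerSeries.coeff i
      (∑ j, f j • (PowerSeries.C (PowerSeries.C (b j)) : PowerSeries (PowerSeries S)))) = _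
    rw [map_sum, map_sum]
    exact Finset.sum_congr rfl fun j _ => coeff_coeff_smul_CC S (f j) (b j) i k
  have hinj : Function.Injective Φ := by
    intro f g h
    funext j
    ext i k
    have h1 := congrArg (fun F => b.equivFun (PowerSeries.coeff k (PowerSeries.coeff i F))) h
    simp only [hΦ, LinearEquiv.apply_symm_apply] at h1
    exact congrFun h1 j
  have hsurj : Function.Surjective Φ := by
    intro F
    refine ⟨fun j => PowerSeries.mk fun i => PowerSeries.mk fun k =>
      b.equivFun (PowerSeries.coeff k (PowerSeries.coeff i F)) j, ?_⟩
    ext i k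
    rw [hΦ]
    simp only [PowerSeries.coeff_mk]
    exact b.equivFun.symm_apply_apply _
  exact (LinearEquiv.ofBijective Φ ⟨hinj, hsurj⟩).symm

/-- Hence `Λ_{2,S}` is flat over `Λ₂`. -/
theorem flatS : Module.Flat (IwasawaAlgebra₂ p) (PowerSeries (PowerSeries S)) := by
  obtain ⟨n, ⟨e⟩⟩ := exists_linearEquiv_pi (p := p) S
  exact Module.Flat.of_linearEquiv e

/-- **Length under the flat base change**: `ℓ_{𝔓'}(Λ_{2,S}/C P) · ℓ_{(C P)}(N) ≤ ℓ_{𝔓'}(Λ_{2,S} ⊗_{Λ₂} N)`. -/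
theorem lengthAt_baseChange_ge (P : GoodPrime p) (𝔓' : PrimeSpectrum (PowerSeries (PowerSeries S)))
    (N : Type) [AddCommGroup N] [Module (IwasawaAlgebra₂ p) N] [hN : Module.Finite (IwasawaAlgebra₂ p) N]
    {c : IwasawaAlgebra₂ p} (hc : c ≠ 0) (hcN : ∀ x : N, c • x = 0) :
    Module.lengthAt (PowerSeries (PowerSeries S))
        (PowerSeries (PowerSeries S) ⧸ Ideal.span
          {algebraMap (IwasawaAlgebra₂ p) (PowerSeries (PowerSeries S)) (PowerSeries.C P.P)}) 𝔓' *
      Module.lengthAt (IwasawaAlgebra₂ p) N P.pt ≤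
    Module.lengthAt (PowerSeries (PowerSeries S)) ((PowerSeries (PowerSeries S)) ⊗[IwasawaAlgebra₂ p] N) 𝔓' := by
  classical
  haveI := flatS (p := p) S
  revert hcN
  induction hN using IsNoetherianRing.induction_on_isQuotientEquivQuotientPrime (IwasawaAlgebra₂ p) with
  | subsingleton N =>
    intro _
    rw [Module.lengthAt_eq_zero_of_subsingleton (R := IwasawaAlgebra₂ p) (M := N), mul_zero]
    exact bot_le
  | quotient N 𝔮 e =>
    intro hcN
    have hc𝔮 : c ∈ 𝔮.asIdeal := LB.mem_of_equiv_quotient e hcN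
    by_cases h𝔮 : 𝔮 = P.pt
    · subst h𝔮
      rw [Module.lengthAt_eq_of_linearEquiv e, Module.lengthAt_quotient_self, mul_one]
      have hmap : Ideal.span {algebraMap (IwasawaAlgebra₂ p) (PowerSeries (PowerSeries S)) (PowerSeries.C P.P)} =
          P.pt.asIdeal.map (algebraMap (IwasawaAlgebra₂ p) (PowerSeries (PowerSeries S))) := by
        rw [GoodPrime.pt_asIdeal, Ideal.map_span, Set.image_singleton]
      have e' := ((Ideal.quotientEquivAlgOfEq (PowerSeries (PowerSeries S)) hmap).trans
        (Algebra.TensorProduct.quotIdealMapEquivTensorQuot (PowerSeries (PowerSeries S))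
          P.pt.asIdeal)).toLinearEquiv
      exact (Module.lengthAt_eq_of_linearEquiv
        (e'.trans (LinearEquiv.baseChange (IwasawaAlgebra₂ p) (PowerSeries (PowerSeries S)) _ _ e).symm) 𝔓').le
    · have hne : ¬ 𝔮.asIdeal ≤ P.pt.asIdeal := by
        intro hle
        have h0 : 𝔮.asIdeal ≠ ⊥ := by
          intro h
          rw [h, Ideal.mem_bot] at hc𝔮
          exact hc hc𝔮
        have h1 : P.pt.asIdeal.height ≤ 𝔮.asIdeal.height := by
          rw [GoodPrime.height_pt, Order.one_le_iff_ne_zero, Ne, Ideal.height_eq_zero_iff_eq_bot]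
          exact h0
        exact h𝔮 (PrimeSpectrum.ext (Ideal.eq_of_le_of_height_le (I := 𝔮.asIdeal) (J := P.pt.asIdeal) hle h1))
      rw [Module.lengthAt_eq_of_linearEquiv e, Module.lengthAt_quotient_eq_zero_of_not_le hne, mul_zero]
      exact bot_le
  | exact N₁ N₂ N₃ f g hf hg hfg ih₁ ih₃ =>
    intro hcN₂
    have hcN₁ : ∀ x : N₁, c • x = 0 := fun x => hf (by rw [map_smul, hcN₂, map_zero])
    have hcN₃ : ∀ x : N₃, c • x = 0 := fun x => by
      obtain ⟨y, rfl⟩ := hg x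
      rw [← map_smul, hcN₂, map_zero]
    have hf' : Function.Injective (f.baseChange (PowerSeries (PowerSeries S))) := by
      rw [LinearMap.baseChange_eq_ltensor]
      exact Module.Flat.lTensor_preserves_injective_linearMap f hf
    have hg' : Function.Surjective (g.baseChange (PowerSeries (PowerSeries S))) := by
      rw [LinearMap.baseChange_eq_ltensor]
      exact LinearMap.lTensor_surjective _ hg
    have hfg' : Function.Exact (f.baseChange (PowerSeries (PowerSeries S)))
        (g.baseChange (PowerSeries (PowerSeries S))) := by
      rw [LinearMap.baseChange_eq_ltensor, LinearMap.baseChange_eq_ltensor]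
      exact lTensor_exact _ hfg hg
    rw [Module.lengthAt_eq_add_of_exact f g hf hg hfg P.pt,
      Module.lengthAt_eq_add_of_exact _ _ hf' hg' hfg' 𝔓', mul_add]
    exact add_le_add (ih₁ hcN₁) (ih₃ hcN₃)

/-! ### E9.8 Descent `Λ_{2,S} → Λ₂` at a root `u₀ ∈ 𝔪_S` of `P`: (K) `a(u₀) = 0 ⟹ P ∣ a` (heights in `Λ₁`),
(D1) `π_{u₀} ∣ H ⟹ C P ∣ H`, (D) `m'k ≤ k_S ≤ m'g` ⟹ `(C P)^k ∣ G` in `Λ₂` -/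

variable {S}

/-- (K) **Kernel of evaluation at a root.** -/
theorem dvd_of_evS_eq_zero (P : GoodPrime p) {u₀ : S} (hu₀ : u₀ ∈ IsLocalRing.maximalIdeal S)
    (hroot : evS hu₀ (PowerSeries.map (algebraMap ℤ_[p] S) P.P) = 0) {a : IwasawaAlgebra p}
    (ha : evS hu₀ (PowerSeries.map (algebraMap ℤ_[p] S) a) = 0) : P.P ∣ a := by
  classical
  by_contra hPa
  let φ : IwasawaAlgebra p →+* S := (evS hu₀).comp (PowerSeries.map (algebraMap ℤ_[p] S))
  haveI hI : (RingHom.ker φ).IsPrime := RingHom.ker_isPrime φ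
  haveI : (Ideal.span {P.P}).IsPrime := (Ideal.span_singleton_prime P.prime.ne_zero).mpr P.prime
  have hlt : Ideal.span {P.P} < RingHom.ker φ := by
    refine lt_of_le_of_ne ?_ fun h => hPa ?_
    · rw [Ideal.span_le, Set.singleton_subset_iff, SetLike.mem_coe, RingHom.mem_ker]
      exact hroot
    · have ha' : a ∈ RingHom.ker φ := ha
      rw [← h, Ideal.mem_span_singleton] at ha'
      exact ha'
  have h2 := two_le_height_of_span_lt (mem_nonZeroDivisors_of_ne_zero P.prime.ne_zero) hlt
  have hm : (IsLocalRing.maximalIdeal (IwasawaAlgebra p)).height = 2 := by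
    have h : ((IsLocalRing.maximalIdeal (IwasawaAlgebra p)).height : WithBot ℕ∞) =
        ((2 : ℕ∞) : WithBot ℕ∞) := by
      rw [IsLocalRing.maximalIdeal_height_eq_ringKrullDim]
      exact IwasawaAlgebra.ringKrullDim_eq_two p
    exact_mod_cast h
  have heq : RingHom.ker φ = IsLocalRing.maximalIdeal (IwasawaAlgebra p) :=
    Ideal.eq_of_le_of_height_le (I := RingHom.ker φ) (J := IsLocalRing.maximalIdeal (IwasawaAlgebra p))
      (IsLocalRing.le_maximalIdeal hI.ne_top) (by rw [hm]; exact h2)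
  have hp : (p : IwasawaAlgebra p) ∈ RingHom.ker φ := by
    rw [heq]
    exact GoodPrime.not_isUnit_p
  rw [RingHom.mem_ker, map_natCast] at hp
  exact natCast_p_ne_zeroS S hp

/-- (D1) `π_{u₀} ∣ H` in `Λ_{2,S}` for `H ∈ Λ₂` ⟹ `C P ∣ H` in `Λ₂`. -/
theorem C_dvd_of_verticalPrimeO_dvd (P : GoodPrime p) {u₀ : S} (hu₀ : u₀ ∈ IsLocalRing.maximalIdeal S)
    (hroot : evS hu₀ (PowerSeries.map (algebraMap ℤ_[p] S) P.P) = 0) {H : IwasawaAlgebra₂ p}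
    (h : verticalPrimeO S u₀ ∣ algebraMap (IwasawaAlgebra₂ p) (PowerSeries (PowerSeries S)) H) :
    (PowerSeries.C P.P : IwasawaAlgebra₂ p) ∣ H := by
  refine C_dvd_of_forall_dvd_coeff fun n => dvd_of_evS_eq_zero P hu₀ hroot ?_
  rw [evS_eq_zero_iff]
  have h1 := dvd_coeff_of_C_dvd h n
  rwa [algebraMap_S, PowerSeries.coeff_map] at h1

/-- **(D) Descent**: `verticalS_dvd` for `Λ_{2,S} ⊗ X` at a root `u₀` gives `(C P)^{ℓ_𝔓(X)} ∣ G` in `Λ₂`. -/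
theorem GoodPrime.C_pow_dvd_of_root (P : GoodPrime p) (X : Type) [AddCommGroup X]
    [Module (IwasawaAlgebra₂ p) X] [Module.Finite (IwasawaAlgebra₂ p) X] (G : IwasawaAlgebra₂ p)
    {c : IwasawaAlgebra₂ p} (hc0 : c ≠ 0) (hcX : ∀ x : X, c • x = 0)
    {u₀ : S} (hu₀ : u₀ ∈ IsLocalRing.maximalIdeal S)
    (hroot : evS hu₀ (PowerSeries.map (algebraMap ℤ_[p] S) P.P) = 0) (N₀ t₀ : ℕ)
    (hbd : ∀ N, N₀ ≤ N → ∃ t, t ≤ t₀ ∧ FibreBoundOver p S X G (u₀ + (p : S) ^ (N + 1)) t) :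
    (PowerSeries.C P.P : IwasawaAlgebra₂ p) ^ (Module.lengthAt (IwasawaAlgebra₂ p) X P.pt).toNat ∣ G := by
  classical
  have hπ : Prime (verticalPrimeO S u₀) := prime_verticalPrimeO hu₀
  -- `c_S` kills `Y = Λ_{2,S} ⊗ X`
  have hcS0 : algebraMap (IwasawaAlgebra₂ p) (PowerSeries (PowerSeries S)) c ≠ 0 := algebraMap_ne_zero₂ S hc0
  have hcY : ∀ y : (PowerSeries (PowerSeries S)) ⊗[IwasawaAlgebra₂ p] X,
      algebraMap (IwasawaAlgebra₂ p) (PowerSeries (PowerSeries S)) c • y = 0 := by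
    intro y
    induction y using TensorProduct.induction_on with
    | zero => rw [smul_zero]
    | tmul a x =>
      rw [TensorProduct.smul_tmul', smul_eq_mul, ← Algebra.smul_def, TensorProduct.smul_tmul, hcX,
        TensorProduct.tmul_zero]
    | add y z hy hz => rw [smul_add, hy, hz, add_zero]
  -- the vertical theorem over `Λ_{2,S}`
  have hv := verticalS_dvd (p := p) hu₀ ((PowerSeries (PowerSeries S)) ⊗[IwasawaAlgebra₂ p] X) hcS0 hcY
    (algebraMap (IwasawaAlgebra₂ p) (PowerSeries (PowerSeries S)) G) N₀ t₀
    (fun N hN => by obtain ⟨t, ht, hF⟩ := hbd N hN; exact ⟨t, ht, hF⟩)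
  -- `algebraMap (C P) = π^{m'} · w`, `π ∤ w`, `m' ≥ 1`
  have hCP0 : algebraMap (IwasawaAlgebra₂ p) (PowerSeries (PowerSeries S)) (PowerSeries.C P.P) ≠ 0 :=
    algebraMap_ne_zero₂ S P.C_ne_zero
  obtain ⟨m', w, hw, hfac⟩ := WfDvdMonoid.max_power_factor hCP0 hπ.irreducible
  have hπCP : verticalPrimeO S u₀ ∣
      algebraMap (IwasawaAlgebra₂ p) (PowerSeries (PowerSeries S)) (PowerSeries.C P.P) := by
    rw [algebraMap_S, PowerSeries.map_C]
    exact map_dvd PowerSeries.C ((evS_eq_zero_iff hu₀ _).mp hroot)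
  have hm' : 0 < m' := by
    rcases Nat.eq_zero_or_pos m' with h0 | h0
    · rw [hfac, h0, pow_zero, one_mul] at hπCP; exact absurd hπCP hw
    · exact h0
  by_cases hG0 : G = 0
  · rw [hG0]; exact dvd_zero _
  obtain ⟨g, G₁, hG₁, hGfac⟩ := WfDvdMonoid.max_power_factor hG0 P.prime_C.irreducible
  -- (D3) `k_S ≤ m' g`
  have hndvd : ¬ verticalPrimeO S u₀ ∣
      w ^ g * algebraMap (IwasawaAlgebra₂ p) (PowerSeries (PowerSeries S)) G₁ := by
    intro h
    rcases hπ.dvd_or_dvd h with h1 | h1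
    · exact hw (hπ.dvd_of_dvd_pow h1)
    · exact hG₁ (C_dvd_of_verticalPrimeO_dvd P hu₀ hroot h1)
  have h3 : (Module.lengthAt (PowerSeries (PowerSeries S))
      ((PowerSeries (PowerSeries S)) ⊗[IwasawaAlgebra₂ p] X) (ptS hu₀)).toNat ≤ m' * g := by
    have heq : algebraMap (IwasawaAlgebra₂ p) (PowerSeries (PowerSeries S)) G =
        verticalPrimeO S u₀ ^ (m' * g) *
          (w ^ g * algebraMap (IwasawaAlgebra₂ p) (PowerSeries (PowerSeries S)) G₁) := by
      rw [hGfac, map_mul, map_pow, hfac, mul_pow, ← pow_mul, mul_assoc]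
    rw [heq] at hv
    exact (pow_dvd_pow_iff hπ.ne_zero hπ.not_unit).mp (hπ.pow_dvd_of_dvd_mul_right _ hndvd hv)
  -- (D4) `m' k ≤ k_S`
  have hmS : Module.lengthAt (PowerSeries (PowerSeries S))
      (PowerSeries (PowerSeries S) ⧸ Ideal.span
        {algebraMap (IwasawaAlgebra₂ p) (PowerSeries (PowerSeries S)) (PowerSeries.C P.P)}) (ptS hu₀) = m' := by
    rw [Module.lengthAt_eq_of_linearEquiv (Ideal.quotientEquivAlgOfEq (PowerSeries (PowerSeries S))
      (show Ideal.span {algebraMap (IwasawaAlgebra₂ p) (PowerSeries (PowerSeries S)) (PowerSeries.C P.P)} =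
        Ideal.span {verticalPrimeO S u₀ ^ m' * w} by rw [hfac])).toLinearEquiv]
    exact Module.lengthAt_quotient_span_singleton_pow_mul hπ m' hw (ptS hu₀) (ptS_asIdeal hu₀)
  have hdev := lengthAt_baseChange_ge S P (ptS hu₀) X hc0 hcX
  rw [hmS] at hdev
  have hXfin : Module.lengthAt (IwasawaAlgebra₂ p) X P.pt ≠ ⊤ :=
    Module.lengthAt_ne_top_of_isTorsionBy hc0 hcX P.pt (by rw [GoodPrime.height_pt])
  have hYfin : Module.lengthAt (PowerSeries (PowerSeries S))
      ((PowerSeries (PowerSeries S)) ⊗[IwasawaAlgebra₂ p] X) (ptS hu₀) ≠ ⊤ :=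
    Module.lengthAt_ne_top_of_isTorsionBy hcS0 hcY (ptS hu₀) (by rw [height_ptS])
  have h4 : m' * (Module.lengthAt (IwasawaAlgebra₂ p) X P.pt).toNat ≤
      (Module.lengthAt (PowerSeries (PowerSeries S))
        ((PowerSeries (PowerSeries S)) ⊗[IwasawaAlgebra₂ p] X) (ptS hu₀)).toNat := by
    rw [← ENat.coe_toNat hXfin, ← ENat.coe_toNat hYfin] at hdev
    exact_mod_cast hdev
  -- (D5) `k ≤ g`
  have hkg : (Module.lengthAt (IwasawaAlgebra₂ p) X P.pt).toNat ≤ g := Nat.le_of_mul_le_mul_left (h4.trans h3) hm'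
  rw [hGfac]
  exact (pow_dvd_pow _ hkg).mul_right _

/-! ### E9.9 The binder over the DVR class and the second door -/

variable (p) in
/-- **(Q1-S) fibre bounds over the DVR class, depth currency**: ONE `F` and ONE `z ≠ 0` such that at every
point `u ∈ 𝔪_S` (any complete DVR `S` finite over `ℤ_p`) off the zeros of `z` the fibre class of `Λ_{2,S} ⊗ X`
at `T₂ = u` has exponent `≤ F(#(S/u), rk S)` (shape of CGLS20 Thm 3.2.1's error term). -/
def DepthFibreBoundsDVR (X : Type) [AddCommGroup X] [Module (IwasawaAlgebra₂ p) X] (G : IwasawaAlgebra₂ p) :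
    Prop :=
  ∃ (F : ℕ → ℕ → ℕ) (z : Polynomial ℤ_[p]), z ≠ 0 ∧
    ∀ (S : Type) [CommRing S] [IsDomain S] [IsDiscreteValuationRing S]
      [IsAdicComplete (IsLocalRing.maximalIdeal S) S] [CharZero S] [Algebra ℤ_[p] S] [Module.Finite ℤ_[p] S]
      (u : S), u ∈ IsLocalRing.maximalIdeal S → Polynomial.aeval u z ≠ 0 →
      ∃ t : ℕ, t ≤ F (Nat.card (S ⧸ Ideal.span {u})) (Module.finrank ℤ_[p] S) ∧ FibreBoundOver p S X G u t

variable (p) in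
/-- **Root datum** of a good prime `P`: a complete DVR `S`, finite over `ℤ_p`, with a root `u₀ ∈ 𝔪_S` of `P`
(constructed for every `P` in §E10, `rootDatumS`). -/
def RootDatumS (P : GoodPrime p) : Prop :=
  ∃ (S : Type) (_ : CommRing S) (_ : IsDomain S) (_ : IsDiscreteValuationRing S)
    (_ : IsAdicComplete (IsLocalRing.maximalIdeal S) S) (_ : CharZero S) (_ : Algebra ℤ_[p] S)
    (_ : Module.Finite ℤ_[p] S) (u₀ : S) (hu₀ : u₀ ∈ IsLocalRing.maximalIdeal S),
    evS hu₀ (PowerSeries.map (algebraMap ℤ_[p] S) P.P) = 0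

end BaseChange

end DoorS

/-! ## E10 (v1.4, g17) ROOT DATA EXIST — `hroot` of `engine_doorS` discharged

For a good prime `P` (`P = f · h`, `f` distinguished of degree `≥ 1`): `K` = a splitting field of `f` over `ℚ_p`
with the spectral norm (`spectralNorm.nontriviallyNormedField`, ultrametric), `S = O_K` its closed unit ball —
compact (`FiniteDimensional.proper`) ⟹ DVR (`Valued.integer.isDiscreteValuationRing_of_compactSpace`), `𝔪`-adically
complete (closed ideals + Cantor intersection, as in Mathlib's `IsNonarchimedeanLocalField` instance), module-finite
over `ℤ_p` (continuous coordinates ⟹ `p^k · O_K ↪ ℤ_p^n`), characteristic `0`; a root `α` of `f` has `‖α‖ < 1`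
(ultrametric inequality), so `u₀ = α ∈ 𝔪_S` and `P(u₀) = f(u₀) h(u₀) = 0`. Hence `rootDatumS` and **`engine_doorS'`**. -/

namespace RD

open scoped NNReal
section Generic

variable (p : ℕ) [Fact p.Prime]
variable (L : Type) [NontriviallyNormedField L] [IsUltrametricDist L] [NormedAlgebra ℚ_[p] L]
  [FiniteDimensional ℚ_[p] L]

/-- The closed unit ball of `L`, as a subring (valuation ring of the norm). -/
noncomputable abbrev O : Subring L := (NormedField.valuation (K := L)).integer

omit [NormedAlgebra ℚ_[p] L] [FiniteDimensional ℚ_[p] L] in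
theorem mem_O_iff (x : L) : x ∈ O L ↔ ‖x‖ ≤ 1 := by
  rw [Valuation.mem_integer_iff, NormedField.valuation_apply, ← NNReal.coe_le_coe, coe_nnnorm, NNReal.coe_one]

include p in
theorem properSpace' : ProperSpace L := FiniteDimensional.proper ℚ_[p] L

theorem norm_algebraMap_padic (x : ℚ_[p]) : ‖algebraMap ℚ_[p] L x‖ = ‖x‖ := norm_algebraMap' L x

/-- `ι : ℤ_p → O_L`. -/
noncomputable def ι : ℤ_[p] →+* O L :=
  ((algebraMap ℚ_[p] L).comp (PadicInt.Coe.ringHom (p := p))).codRestrict (O L) (fun x => by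
    rw [mem_O_iff]
    show ‖algebraMap ℚ_[p] L (x : ℚ_[p])‖ ≤ 1
    rw [norm_algebraMap_padic]
    exact PadicInt.norm_le_one x)

include p in
theorem isCompact_O : IsCompact (O L : Set L) := by
  haveI := properSpace' p L
  have h : (O L : Set L) = Metric.closedBall (0 : L) 1 := by
    ext x
    simp only [SetLike.mem_coe, mem_O_iff, Metric.mem_closedBall, dist_zero_right]
  rw [h]
  exact isCompact_closedBall (0 : L) 1

include p in
theorem compactSpace_O : CompactSpace (O L) :=
  isCompact_iff_compactSpace.mp (isCompact_O p L)

theorem norm_p_lt_one : ‖algebraMap ℚ_[p] L (p : ℚ_[p])‖ < 1 := by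
  rw [norm_algebraMap_padic, Padic.norm_p]
  have hp : (1 : ℝ) < p := by exact_mod_cast (Fact.out : p.Prime).one_lt
  exact inv_lt_one_of_one_lt₀ hp

theorem norm_p_ne_zero : ‖algebraMap ℚ_[p] L (p : ℚ_[p])‖ ≠ 0 := by
  rw [norm_algebraMap_padic, Padic.norm_p]
  have hp : (0 : ℝ) < p := by exact_mod_cast (Fact.out : p.Prime).pos
  exact (inv_pos.mpr hp).ne'

include p in
/-- `O_L` is a DVR (compact valuation ring with a non-trivial valuation). -/
theorem isDVR : IsDiscreteValuationRing (O L) := by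
  letI : Valued L ℝ≥0 := NormedField.toValued
  haveI : CompactSpace (Valued.integer L) := compactSpace_O p L
  haveI : (Valued.v : Valuation L ℝ≥0).IsNontrivial := by
    refine ⟨algebraMap ℚ_[p] L (p : ℚ_[p]), ?_, ?_⟩
    · show NormedField.valuation (algebraMap ℚ_[p] L (p : ℚ_[p])) ≠ 0
      rw [ne_eq, NormedField.valuation_apply, ← NNReal.coe_eq_zero, coe_nnnorm]
      exact norm_p_ne_zero p L
    · show NormedField.valuation (algebraMap ℚ_[p] L (p : ℚ_[p])) ≠ 1
      rw [ne_eq, NormedField.valuation_apply, ← NNReal.coe_eq_one, coe_nnnorm]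
      exact (norm_p_lt_one p L).ne
  exact Valued.integer.isDiscreteValuationRing_of_compactSpace

include p in
/-- `O_L` is `𝔪`-adically complete (compact + Noetherian: ideals are closed). -/
theorem isAdicComplete :
    haveI := isDVR p L
    IsAdicComplete (IsLocalRing.maximalIdeal (O L)) (O L) := by
  haveI := isDVR p L
  haveI : CompactSpace (O L) := compactSpace_O p L
  exact
  { prec' := fun f hf => by
      open scoped Pointwise in
      let S : ℕ → Set (O L) := fun n =>
        f n +ᵥ ((IsLocalRing.maximalIdeal (O L) ^ n : Ideal (O L)) : Set (O L))
      have hS : ∀ n, S (n + 1) ⊆ S n := by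
        intro n
        apply (Set.vadd_set_subset_vadd_set_iff.mpr (Ideal.pow_le_pow_right n.le_succ)).trans
        simpa [S] using (hf n.le_succ).symm
      have h : ∀ n, IsClosed (S n) := fun n =>
        (IsNoetherianRing.isClosed_ideal (IsLocalRing.maximalIdeal (O L) ^ n)).vadd (f n)
      obtain ⟨x, hx⟩ := (h 0).isCompact.nonempty_iInter_of_sequence_nonempty_isCompact_isClosed S hS
        (fun n => by simp [S]) h
      refine ⟨x, fun n => ?_⟩
      obtain ⟨y, hy, rfl⟩ := Set.mem_iInter.mp hx n
      simpa [SModEq.sub_mem] using hy }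

/-- The `ℤ_p`-algebra structure on `O_L` (restriction of `ℚ_p → L`). -/
@[reducible] noncomputable def algZp : Algebra ℤ_[p] (O L) := (ι p L).toAlgebra

include p in
theorem charZero_L : CharZero L := charZero_of_injective_algebraMap (algebraMap ℚ_[p] L).injective

include p in
theorem charZero_O : CharZero (O L) := by
  haveI := charZero_L p L
  infer_instance

include p in
/-- `O_L` is module-finite over `ℤ_p`: bounded coordinates w.r.t. a `ℚ_p`-basis embed `O_L` into `ℤ_p^n`. -/
theorem moduleFinite_O : letI := algZp p L; Module.Finite ℤ_[p] (O L) := by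
  letI := algZp p L
  haveI : CompleteSpace ℚ_[p] := inferInstance
  set n := Module.finrank ℚ_[p] L
  let b := Module.finBasis ℚ_[p] L
  let ℓ : Fin n → (L →L[ℚ_[p]] ℚ_[p]) := fun i => LinearMap.toContinuousLinearMap (b.coord i)
  have hℓ : ∀ i (x : L), ℓ i x = b.coord i x := fun i x => rfl
  obtain ⟨C, hC0, hC⟩ : ∃ C : ℝ, 0 ≤ C ∧ ∀ i, ‖ℓ i‖ ≤ C :=
    ⟨∑ i, ‖ℓ i‖, Finset.sum_nonneg (fun i _ => norm_nonneg _),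
      fun i => Finset.single_le_sum (fun j _ => norm_nonneg (ℓ j)) (Finset.mem_univ i)⟩
  have hp1 : (1 : ℝ) < p := by exact_mod_cast (Fact.out : p.Prime).one_lt
  obtain ⟨k, hk⟩ := pow_unbounded_of_one_lt C hp1
  -- the scaled coordinates of a point of `O_L` are `p`-adic integers
  have hint : ∀ (x : O L) (i : Fin n), ‖(p : ℚ_[p]) ^ k * b.coord i (x : L)‖ ≤ 1 := by
    intro x i
    have hx : ‖(x : L)‖ ≤ 1 := (mem_O_iff L x).mp x.2
    have h1 : ‖b.coord i (x : L)‖ ≤ C := by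
      rw [← hℓ]
      calc ‖ℓ i (x : L)‖ ≤ ‖ℓ i‖ * ‖(x : L)‖ := (ℓ i).le_opNorm _
        _ ≤ C * 1 := mul_le_mul (hC i) hx (norm_nonneg _) hC0
        _ = C := mul_one C
    rw [norm_mul, norm_pow, Padic.norm_p]
    have hpk : (0 : ℝ) < (p : ℝ) ^ k := pow_pos (by exact_mod_cast (Fact.out : p.Prime).pos) k
    rw [inv_pow, ← div_eq_inv_mul, div_le_one hpk]
    exact h1.trans hk.le
  let φ : O L →ₗ[ℤ_[p]] (Fin n → ℤ_[p]) :=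
    { toFun := fun x i => ⟨(p : ℚ_[p]) ^ k * b.coord i (x : L), hint x i⟩
      map_add' := fun x y => by
        funext i
        apply Subtype.ext
        show (p : ℚ_[p]) ^ k * b.coord i ((x : L) + (y : L)) =
          (p : ℚ_[p]) ^ k * b.coord i (x : L) + (p : ℚ_[p]) ^ k * b.coord i (y : L)
        rw [map_add, mul_add]
      map_smul' := fun r x => by
        funext i
        apply Subtype.ext
        have hrx : ((r • x : O L) : L) = (r : ℚ_[p]) • (x : L) := by
          rw [Algebra.smul_def, Subring.coe_mul, Algebra.smul_def]
          rfl
        show (p : ℚ_[p]) ^ k * b.coord i ((r • x : O L) : L) =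
          (r : ℚ_[p]) * ((p : ℚ_[p]) ^ k * b.coord i (x : L))
        rw [hrx, map_smul, smul_eq_mul]
        ring }
  have hφ : Function.Injective φ := by
    intro x y hxy
    apply Subtype.ext
    rw [b.ext_elem_iff]
    intro i
    have h := congrArg (fun v : Fin n → ℤ_[p] => ((v i : ℤ_[p]) : ℚ_[p])) hxy
    simp only [φ, LinearMap.coe_mk, AddHom.coe_mk] at h
    have hpk : ((p : ℚ_[p]) ^ k) ≠ 0 := pow_ne_zero _ (by exact_mod_cast (Fact.out : p.Prime).ne_zero)
    exact mul_left_cancel₀ hpk h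
  exact Module.Finite.of_injective φ hφ

/-- `j : ℤ_p → L`. -/
noncomputable def j : ℤ_[p] →+* L := (algebraMap ℚ_[p] L).comp (PadicInt.Coe.ringHom (p := p))

theorem norm_j (a : ℤ_[p]) : ‖j p L a‖ = ‖a‖ := by
  show ‖algebraMap ℚ_[p] L (a : ℚ_[p])‖ = ‖a‖
  rw [norm_algebraMap_padic]
  rfl

theorem subtype_comp_ι : (O L).subtype.comp (ι p L) = j p L := RingHom.ext (fun _ => rfl)

include p in
/-- A root in `L` of a distinguished polynomial over `ℤ_p` of positive degree has norm `< 1`. -/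
theorem norm_lt_one_of_root (f : Polynomial ℤ_[p])
    (hf : f.IsDistinguishedAt (IsLocalRing.maximalIdeal ℤ_[p])) (hdeg : 0 < f.natDegree) (α : L)
    (hα : f.eval₂ (j p L) α = 0) : ‖α‖ < 1 := by
  by_contra h
  rw [not_lt] at h
  set m := f.natDegree with hm
  have hαm : 0 < ‖α‖ ^ m := pow_pos (lt_of_lt_of_le one_pos h) m
  rw [Polynomial.eval₂_eq_sum_range, Finset.sum_range_succ, hf.monic.coeff_natDegree, map_one, one_mul]
    at hα
  have hsum : α ^ m = -(∑ i ∈ Finset.range m, j p L (f.coeff i) * α ^ i) :=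
    eq_neg_of_add_eq_zero_right hα
  have hne : (Finset.range m).Nonempty := Finset.nonempty_range_iff.mpr hdeg.ne'
  obtain ⟨i, hi, hle⟩ := IsUltrametricDist.exists_norm_finsetSum_le_of_nonempty hne
    (fun i => j p L (f.coeff i) * α ^ i)
  rw [Finset.mem_range] at hi
  have hai : ‖f.coeff i‖ < 1 := PadicInt.mem_nonunits.mp (hf.mem hi)
  have hterm : ‖j p L (f.coeff i) * α ^ i‖ < ‖α‖ ^ m := by
    rw [norm_mul, norm_pow, norm_j]
    calc ‖f.coeff i‖ * ‖α‖ ^ i ≤ ‖f.coeff i‖ * ‖α‖ ^ m :=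
          mul_le_mul_of_nonneg_left (pow_le_pow_right₀ h hi.le) (norm_nonneg _)
      _ < ‖α‖ ^ m := mul_lt_of_lt_one_left hαm hai
  have : ‖α‖ ^ m < ‖α‖ ^ m := by
    calc ‖α‖ ^ m = ‖α ^ m‖ := (norm_pow α m).symm
      _ = ‖∑ i ∈ Finset.range m, j p L (f.coeff i) * α ^ i‖ := by rw [hsum, norm_neg]
      _ ≤ _ := hle
      _ < ‖α‖ ^ m := hterm
  exact lt_irrefl _ this

include p in
/-- Such a root is a point of `𝔪_{O_L}` and a root of `f` mapped to `O_L`. -/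
theorem exists_root_O (f : Polynomial ℤ_[p])
    (hf : f.IsDistinguishedAt (IsLocalRing.maximalIdeal ℤ_[p])) (hdeg : 0 < f.natDegree) (α : L)
    (hα : f.eval₂ (j p L) α = 0) :
    haveI := isDVR p L
    ∃ u₀ : O L, u₀ ∈ IsLocalRing.maximalIdeal (O L) ∧ f.eval₂ (ι p L) u₀ = 0 := by
  haveI := isDVR p L
  have hlt := norm_lt_one_of_root p L f hf hdeg α hα
  refine ⟨⟨α, (mem_O_iff L α).mpr hlt.le⟩, ?_, ?_⟩
  · rw [IsLocalRing.mem_maximalIdeal, mem_nonunits_iff, Valuation.Integer.not_isUnit_iff_valuation_lt_one]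
    show NormedField.valuation α < 1
    rw [NormedField.valuation_apply, ← NNReal.coe_lt_coe, coe_nnnorm, NNReal.coe_one]
    exact hlt
  · apply (injective_iff_map_eq_zero (O L).subtype).mp Subtype.val_injective
    rw [Polynomial.hom_eval₂, subtype_comp_ι]
    exact hα

end Generic

/-! ### The field: a splitting field of the distinguished polynomial, with the spectral norm -/

section Field

variable (p : ℕ) [Fact p.Prime]

theorem exists_dvr_root (f : Polynomial ℤ_[p])
    (hf : f.IsDistinguishedAt (IsLocalRing.maximalIdeal ℤ_[p])) (hdeg : 0 < f.natDegree) :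
    ∃ (S : Type) (_ : CommRing S) (_ : IsDomain S) (_ : IsDiscreteValuationRing S)
      (_ : IsAdicComplete (IsLocalRing.maximalIdeal S) S) (_ : CharZero S) (_ : Algebra ℤ_[p] S)
      (_ : Module.Finite ℤ_[p] S) (u₀ : S),
      u₀ ∈ IsLocalRing.maximalIdeal S ∧ f.eval₂ (algebraMap ℤ_[p] S) u₀ = 0 := by
  let f₀ : Polynomial ℚ_[p] := f.map (PadicInt.Coe.ringHom (p := p))
  let K : Type := f₀.SplittingField
  letI : NontriviallyNormedField K := spectralNorm.nontriviallyNormedField ℚ_[p] K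
  letI : NormedAlgebra ℚ_[p] K := spectralNorm.normedAlgebra ℚ_[p] K
  haveI : IsUltrametricDist K :=
    IsUltrametricDist.isUltrametricDist_of_forall_norm_add_le_max_norm isNonarchimedean_spectralNorm
  -- a root of `f` in `K`
  have hdeg₀ : f₀.degree ≠ 0 := by
    have hinj : Function.Injective (PadicInt.Coe.ringHom (p := p)) := Subtype.val_injective
    show (f.map (PadicInt.Coe.ringHom (p := p))).degree ≠ 0
    rw [Polynomial.degree_map_eq_of_injective hinj, Polynomial.degree_eq_natDegree hf.monic.ne_zero]
    exact_mod_cast hdeg.ne'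
  obtain ⟨α, hα⟩ := (Polynomial.SplittingField.splits f₀).exists_eval_eq_zero (by
    rwa [Polynomial.degree_map])
  have hα' : f.eval₂ (j p K) α = 0 := by
    rw [Polynomial.eval_map, Polynomial.eval₂_map] at hα
    exact hα
  obtain ⟨u₀, hu₀, hroot⟩ := exists_root_O p K f hf hdeg α hα'
  exact ⟨O K, inferInstance, inferInstance, isDVR p K, isAdicComplete p K, charZero_O p K, algZp p K,
    moduleFinite_O p K, u₀, hu₀, hroot⟩

end Field
end RD

/-! ### E10.3 Root data for every good prime; door 2 without `hroot` -/

section RootDatum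

variable {p : ℕ} [Fact p.Prime]

attribute [local instance] algS

/-- **Root data exist** for every good prime (`S = O_K`, `K` a splitting field of the Weierstrass polynomial of
`P` over `ℚ_p` with the spectral norm, `u₀` a root). -/
theorem rootDatumS (P : GoodPrime p) : RootDatumS p P := by
  have hres := P.map_residue_ne_zero
  have HW := P.isWeierstrassFactorization
  set f := (P.P).weierstrassDistinguished hres with hfdef
  set h := (P.P).weierstrassUnit hres with hhdef
  have hf : f.IsDistinguishedAt (IsLocalRing.maximalIdeal ℤ_[p]) := HW.isDistinguishedAt
  have hdeg : 0 < f.natDegree := by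
    rw [Nat.pos_iff_ne_zero]
    intro h0
    have hf1 : f = 1 := (hf.monic.natDegree_eq_zero).mp h0
    apply P.prime.not_unit
    rw [HW.eq_mul, hf1, Polynomial.coe_one, one_mul]
    exact HW.isUnit
  obtain ⟨S, _, _, _, _, _, _, _, u₀, hu₀, hroot⟩ := RD.exists_dvr_root p f hf hdeg
  refine ⟨S, inferInstance, inferInstance, inferInstance, inferInstance, inferInstance, inferInstance,
    inferInstance, u₀, hu₀, ?_⟩
  rw [HW.eq_mul, map_mul, map_mul, ← Polynomial.polynomial_map_coe, evS_coe, Polynomial.eval_map, hroot,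
    zero_mul]

end RootDatum

/-! ## E11 (g17″). DOOR 3: the non-vertical primes from the DVR-class fibre bounds (no `PatchingBeta`, no `hnv`)

§E11.1 (LB) for finitely many height-one primes at once; §E11.2 the cyclic upper bound
`ℓ_𝔔(R̄/(x̄)) ≤ Σ_𝔭 ℓ_𝔭(R/(x))·ℓ_𝔔(R̄/𝔭̄)` in a UFD; §E11.3 (GP) restated verbatim from the sketch; §E11.4 flat base
change at a general height-one prime of `Λ₂`; §E11.5 the fibre ring `Λ_{2,S}/(T₂ - u) ≅ S⟦T₁⟧` (dimension, heights);
§E11.6 the good-point inequality `ℓ_{(F)}(X) ≤ g`; §E11.7 `nonvertical_dvd`, `engine_of_dvd3`, **`engine_door3`**. -/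

section LowerBoundFinset

namespace LB

open Summit.BirchSwinnertonDyer.BirchSwinnertonDyer.Theorems.SignedBaseChangeAcDivSpecialization

variable {R : Type*} [CommRing R] [IsNoetherianRing R] [IsDomain R]

/-- Bookkeeping in `ℕ∞` for the exact case (sum version). -/
theorem enat_devissage_step' {E₁ E₃ B₁ B₂ B₃ A₁ A₂ A₃ : ℕ∞} (I₁ : E₁ + B₁ ≤ A₁)
    (I₃ : E₃ + B₃ ≤ A₃) (six : B₂ + A₁ + A₃ = B₁ + B₃ + A₂) (h₁ : B₁ ≠ ⊤) (h₃ : B₃ ≠ ⊤) :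
    (E₁ + E₃) + B₂ ≤ A₂ := by
  have h := enat_devissage_step (m := 1) (by rwa [mul_one]) (by rwa [mul_one]) six h₁ h₃
  rwa [mul_one] at h

/-- **§E11.1 The dévissage inequality for a finite set `J` of height-one primes not containing `s`:**
`Σ_{𝔭 ∈ J} ℓ_𝔭(N) · ℓ_𝔔(R̄/𝔭̄) + ℓ_𝔔(N[s]) ≤ ℓ_𝔔(N/sN)` (`R̄ = R/(s)`, `𝔭̄ = 𝔭R̄`, `ht 𝔔 = 1`, `N` killed by
`c` with `s ∤ c`). Same prime-filtration induction as `lowerBound_devissage`. -/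
theorem lowerBound_devissage_finset {s c : R} (hs : Prime s) (hsc : ¬ s ∣ c)
    (J : Finset (PrimeSpectrum R)) (hJ1 : ∀ 𝔭 ∈ J, 𝔭.asIdeal.height = 1)
    (hJs : ∀ 𝔭 ∈ J, s ∉ 𝔭.asIdeal)
    (𝔔 : PrimeSpectrum (R ⧸ Ideal.span {s})) (hht : 𝔔.asIdeal.height = 1)
    (N : Type*) [AddCommGroup N] [Module R N] [hN : Module.Finite R N] (hcN : ∀ x : N, c • x = 0) :
    (∑ 𝔭 ∈ J, Module.lengthAt R N 𝔭 *
          Module.lengthAt (R ⧸ Ideal.span {s})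
            ((R ⧸ Ideal.span {s}) ⧸ 𝔭.asIdeal.map (Ideal.Quotient.mk (Ideal.span {s}))) 𝔔) +
        Module.lengthAt (R ⧸ Ideal.span {s}) (Submodule.torsionBy R N s) 𝔔 ≤
      Module.lengthAt (R ⧸ Ideal.span {s}) (QuotSMulTop s N) 𝔔 := by
  classical
  haveI hsP : (Ideal.span {s}).IsPrime := (Ideal.span_singleton_prime hs.ne_zero).mpr hs
  have hsurj : Function.Surjective (algebraMap R (R ⧸ Ideal.span {s})) :=
    Ideal.Quotient.mk_surjective
  have hc0 : c ≠ 0 := fun h => hsc (h ▸ dvd_zero s)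
  revert hcN
  induction hN using IsNoetherianRing.induction_on_isQuotientEquivQuotientPrime R with
  | subsingleton N =>
    intro hcN
    rw [Finset.sum_eq_zero (fun 𝔭 _ => by
        rw [Module.lengthAt_eq_zero_of_subsingleton (R := R) (M := N), zero_mul]),
      Module.lengthAt_eq_zero_of_subsingleton (R := R ⧸ Ideal.span {s})
        (M := Submodule.torsionBy R N s), zero_add]
    exact bot_le
  | quotient N q e =>
    intro hcN
    haveI := isScalarTower_quotSMulTop s N
    haveI := isScalarTower_torsionBy s N
    have hcq : c ∈ q.asIdeal := mem_of_equiv_quotient e hcN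
    have hq0 : q.asIdeal ≠ ⊥ := by
      intro h
      rw [h, Ideal.mem_bot] at hcq
      exact hc0 hcq
    -- `ℓ_𝔭(R/𝔮) = 0` for `𝔭 ∈ J`, `𝔭 ≠ 𝔮`
    have hzero : ∀ 𝔭 ∈ J, 𝔭 ≠ q → Module.lengthAt R N 𝔭 = 0 := by
      intro 𝔭 h𝔭 hne
      have hnle : ¬ q.asIdeal ≤ 𝔭.asIdeal := by
        intro hle
        have h1 : 𝔭.asIdeal.height ≤ q.asIdeal.height := by
          rw [hJ1 𝔭 h𝔭, Order.one_le_iff_ne_zero, Ne, Ideal.height_eq_zero_iff_eq_bot]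
          exact hq0
        exact hne (PrimeSpectrum.ext (Ideal.eq_of_le_of_height_le (I := q.asIdeal) (J := 𝔭.asIdeal) hle h1)).symm
      rw [Module.lengthAt_eq_of_linearEquiv e, Module.lengthAt_quotient_eq_zero_of_not_le hnle]
    by_cases hqJ : q ∈ J
    · -- `𝔮 ∈ J`: the sum is `ℓ_𝔔(R̄/𝔮̄)`, `b = 0`
      have hsq : s ∉ q.asIdeal := hJs q hqJ
      haveI := subsingleton_torsionBy_of_equiv_quotient q.isPrime e hsq
      rw [← Finset.add_sum_erase J _ hqJ, Finset.sum_eq_zero (fun 𝔭 h𝔭 => by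
          rw [hzero 𝔭 (Finset.mem_of_mem_erase h𝔭) (Finset.ne_of_mem_erase h𝔭), zero_mul]), add_zero,
        Module.lengthAt_eq_of_linearEquiv e, Module.lengthAt_quotient_self, one_mul,
        Module.lengthAt_eq_zero_of_subsingleton (R := R ⧸ Ideal.span {s})
          (M := Submodule.torsionBy R N s), add_zero]
      -- the surjection `N/sN ↠ R̄/𝔮̄`
      have hker : (q.asIdeal : Submodule R R) ≤ LinearMap.ker (Algebra.linearMap R
          ((R ⧸ Ideal.span {s}) ⧸ q.asIdeal.map (Ideal.Quotient.mk (Ideal.span {s})))) := by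
        intro x hx
        rw [LinearMap.mem_ker, Algebra.linearMap_apply, ← Ideal.Quotient.mk_algebraMap,
          Ideal.Quotient.algebraMap_eq, Ideal.Quotient.eq_zero_iff_mem]
        exact Ideal.mem_map_of_mem _ hx
      let ψ : N →ₗ[R] ((R ⧸ Ideal.span {s}) ⧸ q.asIdeal.map (Ideal.Quotient.mk (Ideal.span {s}))) :=
        (Submodule.liftQ q.asIdeal (Algebra.linearMap R _) hker) ∘ₗ e.toLinearMap
      have hkerψ : (s • ⊤ : Submodule R N) ≤ LinearMap.ker ψ := by
        intro z hz
        obtain ⟨y, -, rfl⟩ := (Submodule.mem_smul_pointwise_iff_exists _ _ _).mp hz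
        rw [LinearMap.mem_ker, map_smul,
          ← IsScalarTower.algebraMap_smul (R ⧸ Ideal.span {s}) s (ψ y), Ideal.Quotient.algebraMap_eq,
          Ideal.Quotient.eq_zero_iff_mem.mpr (Ideal.mem_span_singleton_self s), zero_smul]
      let ψq := ((s • ⊤ : Submodule R N).liftQ ψ hkerψ).extendScalarsOfSurjective hsurj
      refine Module.lengthAt_le_of_surjective ψq (fun y => ?_) 𝔔
      obtain ⟨z, rfl⟩ := Ideal.Quotient.mk_surjective y
      obtain ⟨r, rfl⟩ := Ideal.Quotient.mk_surjective z
      refine ⟨Submodule.Quotient.mk (e.symm (Submodule.Quotient.mk r)), ?_⟩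
      rw [LinearMap.extendScalarsOfSurjective_apply, Submodule.liftQ_apply, LinearMap.comp_apply,
        LinearEquiv.coe_coe, LinearEquiv.apply_symm_apply, Submodule.liftQ_apply, Algebra.linearMap_apply]
      rfl
    · -- `𝔮 ∉ J`: every `e`-term vanishes
      rw [Finset.sum_eq_zero (fun 𝔭 h𝔭 => by
          rw [hzero 𝔭 h𝔭 (fun h => hqJ (h ▸ h𝔭)), zero_mul]), zero_add]
      by_cases hsq : s ∈ q.asIdeal
      · -- `s ∈ 𝔮`: `sN = 0`, so `N[s] ↪ N/sN`
        have hkill : ∀ x : N, s • x = 0 := smul_eq_zero_of_equiv_quotient e hsq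
        have hbot : (s • ⊤ : Submodule R N) = ⊥ := by
          rw [eq_bot_iff]
          intro x hx
          obtain ⟨y, -, rfl⟩ := (Submodule.mem_smul_pointwise_iff_exists _ _ _).mp hx
          exact (Submodule.mem_bot R).mpr (hkill y)
        let φ := ((s • ⊤ : Submodule R N).mkQ ∘ₗ (Submodule.torsionBy R N s).subtype)
          |>.extendScalarsOfSurjective hsurj
        refine Module.lengthAt_le_of_injective φ (fun x y hxy => ?_) 𝔔
        have : ((x : N) - y) ∈ (s • ⊤ : Submodule R N) := by
          rw [← Submodule.Quotient.eq]; exact hxy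
        rw [hbot, Submodule.mem_bot, sub_eq_zero] at this
        exact Subtype.ext this
      · haveI := subsingleton_torsionBy_of_equiv_quotient q.isPrime e hsq
        rw [Module.lengthAt_eq_zero_of_subsingleton (R := R ⧸ Ideal.span {s})
          (M := Submodule.torsionBy R N s)]
        exact bot_le
  | exact N₁ N₂ N₃ f g hf hg hfg ih₁ ih₃ =>
    intro hc₂
    have hc₁ : ∀ x : N₁, c • x = 0 := fun x => hf (by rw [map_smul, hc₂, map_zero])
    have hc₃ : ∀ x : N₃, c • x = 0 := fun x => by
      obtain ⟨y, rfl⟩ := hg x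
      rw [← map_smul, hc₂, map_zero]
    have hsplit : (∑ 𝔭 ∈ J, Module.lengthAt R N₂ 𝔭 *
          Module.lengthAt (R ⧸ Ideal.span {s})
            ((R ⧸ Ideal.span {s}) ⧸ 𝔭.asIdeal.map (Ideal.Quotient.mk (Ideal.span {s}))) 𝔔) =
        (∑ 𝔭 ∈ J, Module.lengthAt R N₁ 𝔭 *
          Module.lengthAt (R ⧸ Ideal.span {s})
            ((R ⧸ Ideal.span {s}) ⧸ 𝔭.asIdeal.map (Ideal.Quotient.mk (Ideal.span {s}))) 𝔔) +
        ∑ 𝔭 ∈ J, Module.lengthAt R N₃ 𝔭 *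
          Module.lengthAt (R ⧸ Ideal.span {s})
            ((R ⧸ Ideal.span {s}) ⧸ 𝔭.asIdeal.map (Ideal.Quotient.mk (Ideal.span {s}))) 𝔔 := by
      rw [← Finset.sum_add_distrib]
      refine Finset.sum_congr rfl fun 𝔭 _ => ?_
      rw [Module.lengthAt_eq_add_of_exact f g hf hg hfg 𝔭, add_mul]
    rw [hsplit]
    exact enat_devissage_step' (ih₁ hc₁) (ih₃ hc₃) (lengthAt_quot_snake s f g hf hg hfg 𝔔)
      (lengthAt_torsionBy_ne_top hs hsc 𝔔 hht N₁ hc₁) (lengthAt_torsionBy_ne_top hs hsc 𝔔 hht N₃ hc₃)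

/-- **§E11.2 The cyclic upper bound.** In a Noetherian UFD `R` with `s` prime, `𝔔` a prime of `R̄ = R/(s)`,
`x ≠ 0` with `s ∤ x`, and `J` a finite set of height-one primes containing every height-one prime through `x`:
`ℓ_𝔔(R̄/(x̄)) ≤ Σ_{𝔭 ∈ J} ℓ_𝔭(R/(x)) · ℓ_𝔔(R̄/𝔭̄)` (induction on the prime factorisation of `x`; additivity of
`ℓ_𝔔(R̄/(·))` in the domain `R̄`). -/
theorem lengthAt_quot_le_sum [UniqueFactorizationMonoid R] {s : R} (hs : Prime s)
    (𝔔 : PrimeSpectrum (R ⧸ Ideal.span {s})) (J : Finset (PrimeSpectrum R))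
    {x : R} (hx : x ≠ 0) (hsx : ¬ s ∣ x)
    (hJ : ∀ 𝔭 : PrimeSpectrum R, 𝔭.asIdeal.height = 1 → x ∈ 𝔭.asIdeal → 𝔭 ∈ J) :
    Module.lengthAt (R ⧸ Ideal.span {s})
        ((R ⧸ Ideal.span {s}) ⧸ Ideal.span {Ideal.Quotient.mk (Ideal.span {s}) x}) 𝔔 ≤
      ∑ 𝔭 ∈ J, Module.lengthAt R (R ⧸ Ideal.span {x}) 𝔭 *
          Module.lengthAt (R ⧸ Ideal.span {s})
            ((R ⧸ Ideal.span {s}) ⧸ 𝔭.asIdeal.map (Ideal.Quotient.mk (Ideal.span {s}))) 𝔔 := by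
  classical
  haveI hsP : (Ideal.span {s}).IsPrime := (Ideal.span_singleton_prime hs.ne_zero).mpr hs
  haveI : IsDomain (R ⧸ Ideal.span {s}) := Ideal.Quotient.isDomain _
  revert hx hsx hJ
  refine UniqueFactorizationMonoid.induction_on_prime x ?_ ?_ ?_
  · intro h; exact absurd rfl h
  · -- units
    intro u hu _ _ _
    have h0 : Module.lengthAt (R ⧸ Ideal.span {s})
        ((R ⧸ Ideal.span {s}) ⧸ Ideal.span {Ideal.Quotient.mk (Ideal.span {s}) u}) 𝔔 = 0 := by
      haveI : Subsingleton ((R ⧸ Ideal.span {s}) ⧸ Ideal.span {Ideal.Quotient.mk (Ideal.span {s}) u}) := by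
        rw [Ideal.span_singleton_eq_top.mpr (hu.map _)]
        exact Ideal.Quotient.subsingleton_iff.mpr rfl
      exact Module.lengthAt_eq_zero_of_subsingleton (R := R ⧸ Ideal.span {s})
        (M := (R ⧸ Ideal.span {s}) ⧸ Ideal.span {Ideal.Quotient.mk (Ideal.span {s}) u}) 𝔔
    rw [h0]
    exact bot_le
  · -- `x = q * a`, `q` prime
    intro a q ha hq ih _ hsqa hJ
    have hsa : ¬ s ∣ a := fun h => hsqa (h.mul_left q)
    have hsq : ¬ s ∣ q := fun h => hsqa (h.mul_right a)
    have hJa : ∀ 𝔭 : PrimeSpectrum R, 𝔭.asIdeal.height = 1 → a ∈ 𝔭.asIdeal → 𝔭 ∈ J :=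
      fun 𝔭 h1 hm => hJ 𝔭 h1 (Ideal.mul_mem_left _ q hm)
    -- the point `(q)` of `J`
    let 𝔮 : PrimeSpectrum R := ⟨Ideal.span {q}, (Ideal.span_singleton_prime hq.ne_zero).mpr hq⟩
    have h𝔮1 : 𝔮.asIdeal.height = 1 :=
      Ideal.height_span_singleton_eq_one_of_mem_nonZeroDivisors (mem_nonZeroDivisors_of_ne_zero hq.ne_zero)
        hq.not_unit
    have h𝔮J : 𝔮 ∈ J := hJ 𝔮 h𝔮1 (Ideal.mem_span_singleton.mpr (dvd_mul_right q a))
    have hqbar : Ideal.Quotient.mk (Ideal.span {s}) q ≠ 0 := by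
      rw [Ne, Ideal.Quotient.eq_zero_iff_mem, Ideal.mem_span_singleton]; exact hsq
    -- additivity on both sides
    rw [map_mul, Module.lengthAt_quotient_span_singleton_mul _ hqbar 𝔔]
    have hsplit : ∑ 𝔭 ∈ J, Module.lengthAt R (R ⧸ Ideal.span {q * a}) 𝔭 *
          Module.lengthAt (R ⧸ Ideal.span {s})
            ((R ⧸ Ideal.span {s}) ⧸ 𝔭.asIdeal.map (Ideal.Quotient.mk (Ideal.span {s}))) 𝔔 =
        (∑ 𝔭 ∈ J, Module.lengthAt R (R ⧸ Ideal.span {q}) 𝔭 *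
          Module.lengthAt (R ⧸ Ideal.span {s})
            ((R ⧸ Ideal.span {s}) ⧸ 𝔭.asIdeal.map (Ideal.Quotient.mk (Ideal.span {s}))) 𝔔) +
        ∑ 𝔭 ∈ J, Module.lengthAt R (R ⧸ Ideal.span {a}) 𝔭 *
          Module.lengthAt (R ⧸ Ideal.span {s})
            ((R ⧸ Ideal.span {s}) ⧸ 𝔭.asIdeal.map (Ideal.Quotient.mk (Ideal.span {s}))) 𝔔 := by
      rw [← Finset.sum_add_distrib]
      refine Finset.sum_congr rfl fun 𝔭 _ => ?_
      rw [Module.lengthAt_quotient_span_singleton_mul a hq.ne_zero 𝔭, add_mul]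
    rw [hsplit]
    refine add_le_add ?_ (ih ha hsa hJa)
    -- `ℓ_𝔔(R̄/(q̄)) = 1 · ℓ_𝔔(R̄/𝔮̄) ≤` the `𝔮`-term of the first sum
    have hterm : Module.lengthAt (R ⧸ Ideal.span {s})
        ((R ⧸ Ideal.span {s}) ⧸ Ideal.span {Ideal.Quotient.mk (Ideal.span {s}) q}) 𝔔 =
        Module.lengthAt R (R ⧸ Ideal.span {q}) 𝔮 *
          Module.lengthAt (R ⧸ Ideal.span {s})
            ((R ⧸ Ideal.span {s}) ⧸ 𝔮.asIdeal.map (Ideal.Quotient.mk (Ideal.span {s}))) 𝔔 := by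
      rw [show Module.lengthAt R (R ⧸ Ideal.span {q}) 𝔮 = 1 from Module.lengthAt_quotient_self 𝔮, one_mul,
        show 𝔮.asIdeal = Ideal.span {q} from rfl, Ideal.map_span, Set.image_singleton]
    rw [hterm]
    exact Finset.single_le_sum (f := fun 𝔭 => Module.lengthAt R (R ⧸ Ideal.span {q}) 𝔭 *
          Module.lengthAt (R ⧸ Ideal.span {s})
            ((R ⧸ Ideal.span {s}) ⧸ 𝔭.asIdeal.map (Ideal.Quotient.mk (Ideal.span {s}))) 𝔔)
      (fun _ _ => zero_le) h𝔮J

end LB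

end LowerBoundFinset

section Door3

variable {p : ℕ} [Fact p.Prime]

/-! ### E11.3 (GP) good points exist — the sketch's §9.3 Prop, VERBATIM (PROVED there: `PB.goodPointExists_holds`,
counting in `Λ₂/𝔓`); a hypothesis of door 3 exactly as `PatchingTarget` is. -/

variable (p) in
/-- **(GP) Good points exist** (sketch §9.3, proved in sketch §9.7): for a non-vertical prime element `π` of
`Λ₂`, `H` prime to `π`, `w ≠ 0` in `Λ₁` and `c ≠ 0` in `Λ₂`, there is a good prime `P ∤ w` with `C P ∤ c` and a
height-one prime `𝔔` of `Λ₂/(C P)` through `π̄` avoiding `H̄`. -/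
def GoodPointExists : Prop :=
  ∀ (π H c : IwasawaAlgebra₂ p) (w : IwasawaAlgebra p), Prime π →
    Ideal.comap (PowerSeries.C (R := IwasawaAlgebra p)) (Ideal.span {π}) = ⊥ →
    ¬ π ∣ H → w ≠ 0 → c ≠ 0 →
    ∃ P : GoodPrime p, ¬ P.P ∣ w ∧ ¬ (PowerSeries.C P.P : IwasawaAlgebra₂ p) ∣ c ∧
      ∃ 𝔔 : PrimeSpectrum (IwasawaAlgebra₂ p ⧸ Ideal.span {(PowerSeries.C P.P : IwasawaAlgebra₂ p)}),
        𝔔.asIdeal.height = 1 ∧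
        Ideal.Quotient.mk (Ideal.span {(PowerSeries.C P.P : IwasawaAlgebra₂ p)}) π ∈ 𝔔.asIdeal ∧
        Ideal.Quotient.mk (Ideal.span {(PowerSeries.C P.P : IwasawaAlgebra₂ p)}) H ∉ 𝔔.asIdeal

attribute [local instance] algS

section BaseChangeS

variable (S : Type) [CommRing S] [IsDomain S] [IsDiscreteValuationRing S]
  [IsAdicComplete (IsLocalRing.maximalIdeal S) S] [CharZero S] [Algebra ℤ_[p] S] [Module.Finite ℤ_[p] S]

/-! ### E11.4 Flat base change at a general height-one prime of `Λ₂` -/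

/-- `ℓ_{𝔓'}(Λ_{2,S}/𝔓Λ_{2,S}) · ℓ_𝔓(N) ≤ ℓ_{𝔓'}(Λ_{2,S} ⊗_{Λ₂} N)` for `𝔓` of height one, `𝔓'` any prime of
`Λ_{2,S}`, `N` finitely generated killed by `c ≠ 0` (the proof of `lengthAt_baseChange_ge`, verbatim). -/
theorem lengthAt_baseChange_ge' (𝔓 : PrimeSpectrum (IwasawaAlgebra₂ p)) (h𝔓 : 𝔓.asIdeal.height = 1)
    (𝔓' : PrimeSpectrum (PowerSeries (PowerSeries S)))
    (N : Type) [AddCommGroup N] [Module (IwasawaAlgebra₂ p) N] [hN : Module.Finite (IwasawaAlgebra₂ p) N]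
    {c : IwasawaAlgebra₂ p} (hc : c ≠ 0) (hcN : ∀ x : N, c • x = 0) :
    Module.lengthAt (PowerSeries (PowerSeries S))
        (PowerSeries (PowerSeries S) ⧸
          𝔓.asIdeal.map (algebraMap (IwasawaAlgebra₂ p) (PowerSeries (PowerSeries S)))) 𝔓' *
      Module.lengthAt (IwasawaAlgebra₂ p) N 𝔓 ≤
    Module.lengthAt (PowerSeries (PowerSeries S)) ((PowerSeries (PowerSeries S)) ⊗[IwasawaAlgebra₂ p] N) 𝔓' := by
  classical
  haveI := flatS (p := p) S
  revert hcN
  induction hN using IsNoetherianRing.induction_on_isQuotientEquivQuotientPrime (IwasawaAlgebra₂ p) with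
  | subsingleton N =>
    intro _
    rw [Module.lengthAt_eq_zero_of_subsingleton (R := IwasawaAlgebra₂ p) (M := N), mul_zero]
    exact bot_le
  | quotient N 𝔮 e =>
    intro hcN
    have hc𝔮 : c ∈ 𝔮.asIdeal := LB.mem_of_equiv_quotient e hcN
    by_cases h𝔮 : 𝔮 = 𝔓
    · subst h𝔮
      rw [Module.lengthAt_eq_of_linearEquiv e, Module.lengthAt_quotient_self, mul_one]
      have e' := (Algebra.TensorProduct.quotIdealMapEquivTensorQuot (PowerSeries (PowerSeries S))
          𝔮.asIdeal).toLinearEquiv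
      exact (Module.lengthAt_eq_of_linearEquiv
        (e'.trans (LinearEquiv.baseChange (IwasawaAlgebra₂ p) (PowerSeries (PowerSeries S)) _ _ e).symm) 𝔓').le
    · have hne : ¬ 𝔮.asIdeal ≤ 𝔓.asIdeal := by
        intro hle
        have h0 : 𝔮.asIdeal ≠ ⊥ := by
          intro h
          rw [h, Ideal.mem_bot] at hc𝔮
          exact hc hc𝔮
        have h1 : 𝔓.asIdeal.height ≤ 𝔮.asIdeal.height := by
          rw [h𝔓, Order.one_le_iff_ne_zero, Ne, Ideal.height_eq_zero_iff_eq_bot]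
          exact h0
        exact h𝔮 (PrimeSpectrum.ext (Ideal.eq_of_le_of_height_le (I := 𝔮.asIdeal) (J := 𝔓.asIdeal) hle h1))
      rw [Module.lengthAt_eq_of_linearEquiv e, Module.lengthAt_quotient_eq_zero_of_not_le hne, mul_zero]
      exact bot_le
  | exact N₁ N₂ N₃ f g hf hg hfg ih₁ ih₃ =>
    intro hcN₂
    have hcN₁ : ∀ x : N₁, c • x = 0 := fun x => hf (by rw [map_smul, hcN₂, map_zero])
    have hcN₃ : ∀ x : N₃, c • x = 0 := fun x => by
      obtain ⟨y, rfl⟩ := hg x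
      rw [← map_smul, hcN₂, map_zero]
    have hf' : Function.Injective (f.baseChange (PowerSeries (PowerSeries S))) := by
      rw [LinearMap.baseChange_eq_ltensor]
      exact Module.Flat.lTensor_preserves_injective_linearMap f hf
    have hg' : Function.Surjective (g.baseChange (PowerSeries (PowerSeries S))) := by
      rw [LinearMap.baseChange_eq_ltensor]
      exact LinearMap.lTensor_surjective _ hg
    have hfg' : Function.Exact (f.baseChange (PowerSeries (PowerSeries S)))
        (g.baseChange (PowerSeries (PowerSeries S))) := by
      rw [LinearMap.baseChange_eq_ltensor, LinearMap.baseChange_eq_ltensor]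
      exact lTensor_exact _ hfg hg
    rw [Module.lengthAt_eq_add_of_exact f g hf hg hfg 𝔓,
      Module.lengthAt_eq_add_of_exact _ _ hf' hg' hfg' 𝔓', mul_add]
    exact add_le_add (ih₁ hcN₁) (ih₃ hcN₃)

/-! ### E11.5 The fibre ring `Λ_{2,S}/(T₂ - u) ≅ S⟦T₁⟧`: dimension `2`; a non-zero prime avoiding `p̄` has height `1` -/

/-- `dim S⟦T⟧ = 2` (tree: `dim 𝒪⟦X₀,…,X_{n-1}⟧ = n + 1`). -/
theorem ringKrullDim_powerSeriesS : ringKrullDim (PowerSeries S) = ((2 : ℕ∞) : WithBot ℕ∞) := by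
  have h := Literature.NumberTheory.GaloisRepresentations.NearlyOrdinaryPresentationCA.ringKrullDim_mvPowerSeries_dvr
    S 1
  rw [ringKrullDim_eq_of_ringEquiv
    (MvPowerSeries.renameEquiv S (Equiv.ofUnique (Fin 1) Unit)).toRingEquiv] at h
  refine h.trans ?_
  norm_cast

/-- A prime `𝔮 ≠ 0` of `Λ_{2,S}/(T₂ - u)` not containing `p̄` has height `1`. -/
theorem height_eq_one_quotS {u : S} (hu : u ∈ IsLocalRing.maximalIdeal S)
    (𝔮 : Ideal (PowerSeries (PowerSeries S) ⧸ Ideal.span {verticalPrimeO S u})) [𝔮.IsPrime]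
    (h0 : 𝔮 ≠ ⊥)
    (hp : Ideal.Quotient.mk (Ideal.span {verticalPrimeO S u}) (p : PowerSeries (PowerSeries S)) ∉ 𝔮) :
    𝔮.height = 1 := by
  set e := eqvS hu with he
  rw [← RingEquiv.height_comap e 𝔮]
  have hne : 𝔮.comap e ≠ ⊥ := by
    intro h
    apply h0
    rw [eq_bot_iff]
    intro x hx
    have hx' : e.symm x ∈ 𝔮.comap e := by
      rw [Ideal.mem_comap]
      show e (e.symm x) ∈ 𝔮
      rwa [RingEquiv.apply_symm_apply]
    rw [h, Ideal.mem_bot, map_eq_zero_iff _ e.symm.injective] at hx'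
    exact (Ideal.mem_bot).mpr hx'
  have h1 : 1 ≤ (𝔮.comap e).height := by
    rw [Order.one_le_iff_ne_zero, Ne, Ideal.height_eq_zero_iff_eq_bot]
    exact hne
  have hpm : (p : PowerSeries S) ∈ IsLocalRing.maximalIdeal (PowerSeries S) := by
    rw [IsLocalRing.mem_maximalIdeal, mem_nonunits_iff, PowerSeries.isUnit_iff_constantCoeff, map_natCast]
    exact (IsLocalRing.mem_maximalIdeal _).mp (natCast_p_mem_maximalIdeal (p := p) S)
  have hlt : 𝔮.comap e < IsLocalRing.maximalIdeal (PowerSeries S) := by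
    refine lt_of_le_of_ne (IsLocalRing.le_maximalIdeal (Ideal.IsPrime.ne_top inferInstance)) fun h => hp ?_
    rw [← h, Ideal.mem_comap, map_natCast] at hpm
    rwa [map_natCast]
  have h2 := Ideal.height_add_one_le_of_lt_of_isPrime hlt
  have hm : (IsLocalRing.maximalIdeal (PowerSeries S)).height = 2 := by
    have h := IsLocalRing.maximalIdeal_height_eq_ringKrullDim (R := PowerSeries S)
    rw [ringKrullDim_powerSeriesS S] at h
    exact WithBot.coe_injective h
  rw [hm, show (2 : ℕ∞) = 1 + 1 from rfl, ENat.add_le_add_iff_right ENat.one_ne_top] at h2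
  exact le_antisymm h2 h1

/-! ### E11.6 The good-point inequality `ℓ_{(F)}(X) ≤ g` over `Λ_{2,S}` -/

/-- **The good-point inequality.** `P` a good prime with a root `u₀ ∈ 𝔪_S`; `X` killed by `c ≠ 0`, `C P ∤ c`;
`F` a prime of `Λ₂` with `C P ∤ F`; `𝔔 ∋ C P, F` a prime of `Λ₂` avoiding `p` and `G₁`; the fibre
bound at `u₀` for `G = F^g G₁` with slack `p^t` ⟹ `ℓ_{(F)}(X) ≤ g`. (Lying over `Λ₂ ⊆ Λ_{2,S}`, §E11.1 for
the height-one primes of `Λ_{2,S}` through `F`, §E11.4, fibre transport, §E11.2.) -/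
theorem lengthAt_le_of_goodPointS (P : GoodPrime p) {u₀ : S} (hu₀ : u₀ ∈ IsLocalRing.maximalIdeal S)
    (hr : evS hu₀ (PowerSeries.map (algebraMap ℤ_[p] S) P.P) = 0)
    (X : Type) [AddCommGroup X] [Module (IwasawaAlgebra₂ p) X] [Module.Finite (IwasawaAlgebra₂ p) X]
    {c : IwasawaAlgebra₂ p} (hc : c ≠ 0) (hcX : ∀ x : X, c • x = 0)
    (hPc : ¬ (PowerSeries.C P.P : IwasawaAlgebra₂ p) ∣ c)
    {F : IwasawaAlgebra₂ p} (hF : Prime F) (hPF : ¬ (PowerSeries.C P.P : IwasawaAlgebra₂ p) ∣ F)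
    {G₁ : IwasawaAlgebra₂ p} (g : ℕ)
    (𝔔 : Ideal (IwasawaAlgebra₂ p)) [𝔔.IsPrime] (hCP𝔔 : (PowerSeries.C P.P : IwasawaAlgebra₂ p) ∈ 𝔔)
    (hF𝔔 : F ∈ 𝔔) (hp𝔔 : (p : IwasawaAlgebra₂ p) ∉ 𝔔) (hG₁𝔔 : G₁ ∉ 𝔔)
    {t : ℕ} (hFB : FibreBoundOver p S X (F ^ g * G₁) u₀ t) :
    Module.lengthAt (IwasawaAlgebra₂ p) X
        ⟨Ideal.span {F}, (Ideal.span_singleton_prime hF.ne_zero).mpr hF⟩ ≤ g := by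
  classical
  -- notation and instances
  set Λ := PowerSeries (PowerSeries S) with hΛ
  set ι := algebraMap (IwasawaAlgebra₂ p) Λ with hι
  set π := verticalPrimeO S u₀ with hπdef
  have hπ : Prime π := prime_verticalPrimeO hu₀
  haveI hπP : (Ideal.span {π}).IsPrime := (Ideal.span_singleton_prime hπ.ne_zero).mpr hπ
  haveI : IsDomain (Λ ⧸ Ideal.span {π}) := Ideal.Quotient.isDomain _
  haveI : UniqueFactorizationMonoid Λ :=
    Literature.NumberTheory.IwasawaTheory.uniqueFactorizationMonoid_powerSeries_powerSeries S
  haveI : Module.Finite (IwasawaAlgebra₂ p) Λ := by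
    obtain ⟨n, ⟨e⟩⟩ := exists_linearEquiv_pi (p := p) S
    exact Module.Finite.equiv e.symm
  set 𝔓F : PrimeSpectrum (IwasawaAlgebra₂ p) :=
    ⟨Ideal.span {F}, (Ideal.span_singleton_prime hF.ne_zero).mpr hF⟩ with h𝔓F
  have hF1 : 𝔓F.asIdeal.height = 1 :=
    Ideal.height_span_singleton_eq_one_of_mem_nonZeroDivisors (mem_nonZeroDivisors_of_ne_zero hF.ne_zero)
      hF.not_unit
  set Y := Λ ⊗[IwasawaAlgebra₂ p] X with hY
  set A := Λ ⧸ Ideal.span {π} with hA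
  set mk := Ideal.Quotient.mk (Ideal.span {π}) with hmk
  -- (D1): `π ∤ ι F`, `π ∤ ι c`
  have hπF : ¬ π ∣ ι F := fun h => hPF (C_dvd_of_verticalPrimeO_dvd P hu₀ hr h)
  have hπc : ¬ π ∣ ι c := fun h => hPc (C_dvd_of_verticalPrimeO_dvd P hu₀ hr h)
  have hFS0 : ι F ≠ 0 := algebraMap_ne_zero₂ S hF.ne_zero
  have hFbar : mk (ι F) ≠ 0 := by
    rw [Ne, hmk, Ideal.Quotient.eq_zero_iff_mem, Ideal.mem_span_singleton]; exact hπF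
  have hcbar : mk (ι c) ≠ 0 := by
    rw [Ne, hmk, Ideal.Quotient.eq_zero_iff_mem, Ideal.mem_span_singleton]; exact hπc
  -- `ι c` kills `Y`
  have hcY : ∀ y : Y, ι c • y = 0 := by
    intro y
    induction y using TensorProduct.induction_on with
    | zero => rw [smul_zero]
    | tmul a x =>
      rw [TensorProduct.smul_tmul', smul_eq_mul, ← Algebra.smul_def, TensorProduct.smul_tmul, hcX,
        TensorProduct.tmul_zero]
    | add y z hy hz => rw [smul_add, hy, hz, add_zero]
  -- Step 1: a prime `Q ⊇ (π)` of `Λ_{2,S}` lying over `𝔔`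
  have hIP : (Ideal.span {π}).comap ι ≤ 𝔔 := by
    intro x hx
    rw [Ideal.mem_comap, Ideal.mem_span_singleton] at hx
    exact (Ideal.span_singleton_le_iff_mem _).mpr hCP𝔔
      (Ideal.mem_span_singleton.mpr (C_dvd_of_verticalPrimeO_dvd P hu₀ hr hx))
  obtain ⟨Q, hQπ, hQp, hQc⟩ := Ideal.exists_ideal_over_prime_of_isIntegral 𝔔 (Ideal.span {π}) hIP
  haveI := hQp
  -- Step 2: `𝔮 = Q/(π)`, a prime of `A`; membership of `Λ₂`-elements
  have hker : RingHom.ker mk ≤ Q := by rw [hmk, Ideal.mk_ker]; exact hQπ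
  haveI h𝔮p : (Q.map mk).IsPrime := Ideal.map_isPrime_of_surjective Ideal.Quotient.mk_surjective hker
  have hcm : (Q.map mk).comap mk = Q := by
    rw [Ideal.comap_map_of_surjective _ Ideal.Quotient.mk_surjective, ← RingHom.ker_eq_comap_bot,
      Ideal.mk_ker]
    exact sup_eq_left.mpr hQπ
  have hmemΛ : ∀ x : Λ, mk x ∈ Q.map mk ↔ x ∈ Q := fun x => by
    rw [← Ideal.mem_comap, hcm]
  have hmem₂ : ∀ x : IwasawaAlgebra₂ p, mk (ι x) ∈ Q.map mk ↔ x ∈ 𝔔 := fun x => by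
    rw [hmemΛ, ← Ideal.mem_comap, hι, hQc]
  set 𝔮 : PrimeSpectrum A := ⟨Q.map mk, h𝔮p⟩ with h𝔮def
  have hF𝔮 : mk (ι F) ∈ 𝔮.asIdeal := (hmem₂ F).mpr hF𝔔
  have hp𝔮 : mk (p : Λ) ∉ 𝔮.asIdeal := fun h => hp𝔔 ((hmem₂ _).mp (by rwa [map_natCast]))
  have hG₁𝔮 : mk (ι G₁) ∉ 𝔮.asIdeal := fun h => hG₁𝔔 ((hmem₂ _).mp h)
  have hpbar : mk (p : Λ) ≠ 0 := fun h => hp𝔮 (h ▸ 𝔮.asIdeal.zero_mem)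
  have hG₁bar : mk (ι G₁) ≠ 0 := fun h => hG₁𝔮 (h ▸ 𝔮.asIdeal.zero_mem)
  -- Step 3: `ht 𝔮 = 1`
  have h𝔮0 : 𝔮.asIdeal ≠ ⊥ := fun h => hFbar (by
    have h' := hF𝔮; rw [h, Ideal.mem_bot] at h'; exact h')
  have h𝔮1 : 𝔮.asIdeal.height = 1 := height_eq_one_quotS (p := p) S hu₀ (Q.map mk) h𝔮0 hp𝔮
  -- Step 4: the height-one primes of `Λ_{2,S}` through `ι F`
  have hfin : {𝔭 : PrimeSpectrum Λ | 𝔭.asIdeal.height = 1 ∧ ι F ∈ 𝔭.asIdeal}.Finite := by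
    have hmin := Ideal.finite_minimalPrimes_of_isNoetherianRing Λ (Ideal.span {ι F})
    have hsub : {𝔭 : PrimeSpectrum Λ | 𝔭.asIdeal.height = 1 ∧ ι F ∈ 𝔭.asIdeal} ⊆
        PrimeSpectrum.asIdeal ⁻¹' (Ideal.span {ι F}).minimalPrimes := by
      rintro 𝔭 ⟨h1, hm⟩
      refine Ideal.mem_minimalPrimes_of_height_eq ((Ideal.span_singleton_le_iff_mem _).mpr hm) ?_
      rw [h1, Order.one_le_iff_ne_zero, Ne, Ideal.height_eq_zero_iff_eq_bot, Ideal.span_singleton_eq_bot]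
      exact hFS0
    exact (hmin.preimage fun _ _ _ _ h => PrimeSpectrum.ext h).subset hsub
  set J := hfin.toFinset with hJ
  have hJmem : ∀ 𝔭 : PrimeSpectrum Λ, 𝔭 ∈ J ↔ 𝔭.asIdeal.height = 1 ∧ ι F ∈ 𝔭.asIdeal := fun 𝔭 => by
    rw [hJ, Set.Finite.mem_toFinset]; rfl
  have hJ1 : ∀ 𝔭 ∈ J, 𝔭.asIdeal.height = 1 := fun 𝔭 h => ((hJmem 𝔭).mp h).1
  have hJs : ∀ 𝔭 ∈ J, π ∉ 𝔭.asIdeal := by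
    intro 𝔭 h𝔭 hπ𝔭
    obtain ⟨h1, hm⟩ := (hJmem 𝔭).mp h𝔭
    have hle : Ideal.span {π} ≤ 𝔭.asIdeal := (Ideal.span_singleton_le_iff_mem _).mpr hπ𝔭
    have hh : 𝔭.asIdeal.height ≤ (Ideal.span {π}).height := by rw [h1, ← ptS_asIdeal hu₀, height_ptS hu₀]
    have heq := Ideal.eq_of_le_of_height_le (I := Ideal.span {π}) (J := 𝔭.asIdeal) hle hh
    rw [← heq, Ideal.mem_span_singleton] at hm
    exact hπF hm
  -- abbreviations for the lengths
  set mbar : PrimeSpectrum Λ → ℕ∞ := fun 𝔭 =>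
    Module.lengthAt A (A ⧸ 𝔭.asIdeal.map mk) 𝔮 with hmbar
  set eF : PrimeSpectrum Λ → ℕ∞ := fun 𝔭 => Module.lengthAt Λ (Λ ⧸ Ideal.span {ι F}) 𝔭 with heF
  set sumE := ∑ 𝔭 ∈ J, eF 𝔭 * mbar 𝔭 with hsumE
  set ℓX := Module.lengthAt (IwasawaAlgebra₂ p) X 𝔓F with hℓX
  haveI := LB.isScalarTower_quotSMulTop π Y
  haveI : Module.Finite A (QuotSMulTop π Y) := Module.Finite.of_restrictScalars_finite Λ _ _
  set ℓq := Module.lengthAt A (QuotSMulTop π Y) 𝔮 with hℓq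
  -- Step 5: (LB) for `J`: `Σ_𝔭 ℓ_𝔭(Y) m̄_𝔭 ≤ ℓ_𝔮(Y/πY)`
  have hLB : ∑ 𝔭 ∈ J, Module.lengthAt Λ Y 𝔭 * mbar 𝔭 ≤ ℓq :=
    le_trans le_self_add (LB.lowerBound_devissage_finset hπ hπc J hJ1 hJs 𝔮 h𝔮1 Y hcY)
  -- Step 6: base change termwise: `ℓX · sumE ≤ Σ_𝔭 ℓ_𝔭(Y) m̄_𝔭`
  have hmapF : 𝔓F.asIdeal.map ι = Ideal.span {ι F} := by
    rw [show 𝔓F.asIdeal = Ideal.span {F} from rfl, Ideal.map_span, Set.image_singleton]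
  have hBC : ∀ 𝔭 : PrimeSpectrum Λ, eF 𝔭 * ℓX ≤ Module.lengthAt Λ Y 𝔭 := by
    intro 𝔭
    have h := lengthAt_baseChange_ge' (p := p) S 𝔓F hF1 𝔭 X hc hcX
    rwa [Module.lengthAt_eq_of_linearEquiv (Ideal.quotientEquivAlgOfEq Λ hmapF).toLinearEquiv] at h
  have h6 : ℓX * sumE ≤ ∑ 𝔭 ∈ J, Module.lengthAt Λ Y 𝔭 * mbar 𝔭 := by
    rw [hsumE, Finset.mul_sum]
    refine Finset.sum_le_sum fun 𝔭 _ => ?_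
    rw [← mul_assoc, mul_comm ℓX]
    exact mul_le_mul' (hBC 𝔭) le_rfl
  -- Step 7: the fibre bound read at `𝔮`: `ℓq ≤ g · ℓ_𝔮(A/(F̄))`
  have hmem := fibre_transportS hu₀ Y (ι (F ^ g * G₁)) t hFB
  have hcM : ∀ x : QuotSMulTop π Y, mk (ι c) • x = 0 := by
    intro x
    obtain ⟨x, rfl⟩ := Submodule.mkQ_surjective _ x
    show ι c • (Submodule.Quotient.mk x : QuotSMulTop π Y) = 0
    rw [← Submodule.Quotient.mk_smul, hcY, Submodule.Quotient.mk_zero]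
  have hTq : Module.IsTorsion A (QuotSMulTop π Y) := fun x =>
    ⟨⟨mk (ι c), mem_nonZeroDivisors_of_ne_zero hcbar⟩, hcM x⟩
  have hℓqtop : ℓq ≠ ⊤ := Module.lengthAt_ne_top_of_isTorsionBy hcbar (fun x => hcM x) 𝔮 h𝔮1.le
  have hxmem : mk ((p : Λ) ^ t * ι (F ^ g * G₁)) ∈ 𝔮.asIdeal ^ ℓq.toNat :=
    Summit.BirchSwinnertonDyer.Rank1Residual.X11b.CongruenceLimit.charIdeal_le_pow_lengthAt
      (M := QuotSMulTop π Y) hTq 𝔮 h𝔮1 hmem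
  have h7a : ℓq ≤ Module.lengthAt A (A ⧸ Ideal.span {mk ((p : Λ) ^ t * ι (F ^ g * G₁))}) 𝔮 := by
    have hle : Ideal.span {mk ((p : Λ) ^ t * ι (F ^ g * G₁))} ≤ 𝔮.asIdeal ^ ℓq.toNat :=
      (Ideal.span_singleton_le_iff_mem _).mpr hxmem
    calc ℓq = (ℓq.toNat : ℕ∞) := (ENat.coe_toNat hℓqtop).symm
      _ ≤ Module.lengthAt A (A ⧸ 𝔮.asIdeal ^ ℓq.toNat) 𝔮 := natCast_le_lengthAt_quotient_pow 𝔮 h𝔮0 _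
      _ ≤ _ := Module.lengthAt_le_of_surjective (Submodule.factor hle) (Submodule.factor_surjective hle) 𝔮
  have hzero_p : Module.lengthAt A (A ⧸ Ideal.span {mk (p : Λ) ^ t}) 𝔮 = 0 := by
    rw [Module.lengthAt_quotient_span_singleton_pow hpbar t 𝔮,
      Module.lengthAt_quotient_eq_zero_of_not_le (I := Ideal.span {mk (p : Λ)})
        (fun h => hp𝔮 ((Ideal.span_singleton_le_iff_mem _).mp h)), smul_zero]
  have hzero_G₁ : Module.lengthAt A (A ⧸ Ideal.span {mk (ι G₁)}) 𝔮 = 0 :=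
    Module.lengthAt_quotient_eq_zero_of_not_le (I := Ideal.span {mk (ι G₁)})
      (fun h => hG₁𝔮 ((Ideal.span_singleton_le_iff_mem _).mp h))
  have h7 : ℓq ≤ g • Module.lengthAt A (A ⧸ Ideal.span {mk (ι F)}) 𝔮 := by
    refine h7a.trans (le_of_eq ?_)
    rw [map_mul, map_mul, map_mul, map_pow, map_pow, map_pow,
      Module.lengthAt_quotient_span_singleton_mul _ (pow_ne_zero t hpbar) 𝔮, hzero_p, zero_add,
      Module.lengthAt_quotient_span_singleton_mul _ (pow_ne_zero g hFbar) 𝔮, hzero_G₁, add_zero,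
      Module.lengthAt_quotient_span_singleton_pow hFbar g 𝔮]
  -- Step 8: the cyclic upper bound `ℓ_𝔮(A/(F̄)) ≤ sumE`
  have h8 : Module.lengthAt A (A ⧸ Ideal.span {mk (ι F)}) 𝔮 ≤ sumE :=
    LB.lengthAt_quot_le_sum hπ 𝔮 J hFS0 hπF fun 𝔭 h1 hm => (hJmem 𝔭).mpr ⟨h1, hm⟩
  -- Step 9: `0 < sumE < ⊤` and the cancellation
  have hsumE1 : 1 ≤ sumE := by
    refine le_trans ?_ h8
    have hle : Ideal.span {mk (ι F)} ≤ 𝔮.asIdeal := (Ideal.span_singleton_le_iff_mem _).mpr hF𝔮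
    calc (1 : ℕ∞) = Module.lengthAt A (A ⧸ 𝔮.asIdeal) 𝔮 := (Module.lengthAt_quotient_self 𝔮).symm
      _ ≤ _ := Module.lengthAt_le_of_surjective (Submodule.factor hle) (Submodule.factor_surjective hle) 𝔮
  have hsumEtop : sumE ≠ ⊤ := by
    rw [hsumE]
    refine ENat.sum_ne_top.mpr fun 𝔭 h𝔭 => ?_
    have h1 := hJ1 𝔭 h𝔭
    have hm : ι F ∈ 𝔭.asIdeal := ((hJmem 𝔭).mp h𝔭).2
    have he : eF 𝔭 ≠ ⊤ := by
      refine Module.lengthAt_ne_top_of_isTorsionBy (M := Λ ⧸ Ideal.span {ι F}) hFS0 (fun x => ?_) 𝔭 h1.le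
      obtain ⟨b, rfl⟩ := Ideal.Quotient.mk_surjective x
      change Ideal.Quotient.mk (Ideal.span {ι F}) (ι F • b) = 0
      rw [Ideal.Quotient.eq_zero_iff_mem, smul_eq_mul]
      exact Ideal.mul_mem_right b _ (Ideal.mem_span_singleton_self _)
    have hmb : mbar 𝔭 ≠ ⊤ := by
      refine Module.lengthAt_ne_top_of_isTorsionBy (M := A ⧸ 𝔭.asIdeal.map mk) hFbar (fun x => ?_) 𝔮
        h𝔮1.le
      obtain ⟨b, rfl⟩ := Ideal.Quotient.mk_surjective x
      change Ideal.Quotient.mk (𝔭.asIdeal.map mk) (mk (ι F) • b) = 0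
      rw [Ideal.Quotient.eq_zero_iff_mem, smul_eq_mul]
      exact Ideal.mul_mem_right b _ (Ideal.mem_map_of_mem _ hm)
    rw [← ENat.coe_toNat he, ← ENat.coe_toNat hmb, ← Nat.cast_mul]
    exact ENat.coe_ne_top _
  have hℓXtop : ℓX ≠ ⊤ := Module.lengthAt_ne_top_of_isTorsionBy hc hcX 𝔓F hF1.le
  -- the chain `ℓX · sumE ≤ g · sumE`
  have hchain : ℓX * sumE ≤ (g : ℕ∞) * sumE := by
    refine h6.trans (hLB.trans (h7.trans ?_))
    rw [nsmul_eq_mul]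
    exact mul_le_mul' le_rfl h8
  obtain ⟨n, hn⟩ : ∃ n : ℕ, sumE = n := ⟨sumE.toNat, (ENat.coe_toNat hsumEtop).symm⟩
  obtain ⟨k, hk⟩ : ∃ k : ℕ, ℓX = k := ⟨ℓX.toNat, (ENat.coe_toNat hℓXtop).symm⟩
  have hn0 : 0 < n := by
    have h := hsumE1; rw [hn] at h; exact_mod_cast h
  rw [hn, hk] at hchain
  rw [hk]
  have hkn : k * n ≤ g * n := by exact_mod_cast hchain
  exact_mod_cast Nat.le_of_mul_le_mul_right hkn hn0

end BaseChangeS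

/-! ### E11.7 The non-vertical primes, and the THIRD DOOR -/

/-- **Non-vertical primes from (GP) + the DVR-class fibre bounds** (replaces `PatchingBeta` + `hnv`): for a
height-one prime `𝔓` of `Λ₂` with `𝔓 ∩ ℤ_p⟦T₂⟧ = 0`, `𝔓^{ℓ_𝔓(X)} ∣ (G)`. -/
theorem nonvertical_dvd (X : Type) [AddCommGroup X] [Module (IwasawaAlgebra₂ p) X]
    [Module.Finite (IwasawaAlgebra₂ p) X] (G : IwasawaAlgebra₂ p) (hGP : GoodPointExists p)
    (hT : Module.IsTorsion (IwasawaAlgebra₂ p) X) (hQ1 : DepthFibreBoundsDVR p X G)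
    (𝔓 : PrimeSpectrum (IwasawaAlgebra₂ p)) (hht : 𝔓.asIdeal.height = 1)
    (hnv : Ideal.comap (PowerSeries.C (R := IwasawaAlgebra p)) 𝔓.asIdeal = ⊥) :
    𝔓.asIdeal ^ (Module.lengthAt (IwasawaAlgebra₂ p) X 𝔓).toNat ∣ Ideal.span {G} := by
  classical
  haveI : UniqueFactorizationMonoid (IwasawaAlgebra₂ p) :=
    Literature.NumberTheory.IwasawaTheory.uniqueFactorizationMonoid_iwasawaAlgebraTwoVar p
  -- `𝔓 = (F)` with `F` prime
  obtain ⟨F, hF𝔓, hF⟩ := Ideal.IsPrime.exists_mem_prime_of_ne_bot 𝔓.isPrime (Ideal.ne_bot_of_height_eq_one hht)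
  have h𝔓F : 𝔓.asIdeal = Ideal.span {F} := Ideal.eq_span_singleton_of_height_eq_one hht hF𝔓 hF
  have hpt : 𝔓 = ⟨Ideal.span {F}, (Ideal.span_singleton_prime hF.ne_zero).mpr hF⟩ := PrimeSpectrum.ext h𝔓F
  -- `G = 0` is trivial
  by_cases hG0 : G = 0
  · rw [hG0, Ideal.span_singleton_eq_bot.mpr rfl, ← Ideal.zero_eq_bot]
    exact dvd_zero _
  -- `G = F^g · G₁`, `F ∤ G₁`
  obtain ⟨g, G₁, hFG₁, hGfac⟩ := WfDvdMonoid.max_power_factor hG0 hF.irreducible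
  -- an annihilator `c ≠ 0` of `X`
  obtain ⟨c, hc, hc0⟩ := Submodule.exists_mem_ne_zero_of_ne_bot (Module.annihilator_ne_bot_of_isTorsion X hT)
  have hcX : ∀ x : X, c • x = 0 := fun x => Module.mem_annihilator.mp hc x
  obtain ⟨Fd, z, hz, hFB⟩ := hQ1
  -- `F ∤ p · G₁` (`F ∣ p` would put `p ∈ 𝔓 ∩ ℤ_p⟦T₂⟧`)
  have hFp : ¬ F ∣ (p : IwasawaAlgebra₂ p) * G₁ := by
    intro h
    rcases hF.dvd_or_dvd h with h1 | h1
    · have hmem : (p : IwasawaAlgebra p) ∈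
          Ideal.comap (PowerSeries.C (R := IwasawaAlgebra p)) 𝔓.asIdeal := by
        rw [Ideal.mem_comap, map_natCast, h𝔓F, Ideal.mem_span_singleton]
        exact h1
      rw [hnv, Ideal.mem_bot] at hmem
      have h2 := congrArg (PowerSeries.constantCoeff (R := ℤ_[p])) hmem
      rw [map_natCast, map_zero] at h2
      exact (Nat.cast_ne_zero.mpr (Fact.out : p.Prime).ne_zero) h2
    · exact hFG₁ h1
  have hw : ((z : PowerSeries ℤ_[p]) : IwasawaAlgebra p) ≠ 0 := by
    rw [Ne, Polynomial.coe_eq_zero_iff]; exact hz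
  have hG₁0 : G₁ ≠ 0 := fun h => hFG₁ (h ▸ dvd_zero F)
  have hc' : c * G₁ ≠ 0 := mul_ne_zero hc0 hG₁0
  obtain ⟨P, hPw, hPc, 𝔔, -, hF𝔔, hH𝔔⟩ :=
    hGP F ((p : IwasawaAlgebra₂ p) * G₁) (c * G₁) (z : PowerSeries ℤ_[p]) hF (h𝔓F ▸ hnv) hFp hw hc'
  -- the root datum of `P` and a point of the DVR class off the zeros of `z`
  obtain ⟨S, _, _, _, _, _, _, _, u₀, hu₀, hr⟩ := rootDatumS P
  have hzu : Polynomial.aeval u₀ z ≠ 0 := by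
    intro h0
    apply hPw
    refine dvd_of_evS_eq_zero P hu₀ hr ?_
    rw [← Polynomial.polynomial_map_coe, evS_coe, Polynomial.eval_map_algebraMap]
    exact h0
  obtain ⟨t, -, hFBt⟩ := hFB S u₀ hu₀ hzu
  rw [hGfac] at hFBt
  -- the prime `𝔔₂ ⊂ Λ₂` over `𝔔`
  set 𝔔₂ : Ideal (IwasawaAlgebra₂ p) :=
    𝔔.asIdeal.comap (Ideal.Quotient.mk (Ideal.span {(PowerSeries.C P.P : IwasawaAlgebra₂ p)})) with h𝔔₂
  have hCP : (PowerSeries.C P.P : IwasawaAlgebra₂ p) ∈ 𝔔₂ := by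
    rw [h𝔔₂, Ideal.mem_comap, Ideal.Quotient.eq_zero_iff_mem.mpr (Ideal.mem_span_singleton_self _)]
    exact zero_mem _
  have hF2 : F ∈ 𝔔₂ := Ideal.mem_comap.mpr hF𝔔
  have hp2 : (p : IwasawaAlgebra₂ p) ∉ 𝔔₂ := fun h =>
    hH𝔔 (by rw [map_mul]; exact Ideal.mul_mem_right _ _ (Ideal.mem_comap.mp h))
  have hG₁2 : G₁ ∉ 𝔔₂ := fun h =>
    hH𝔔 (by rw [map_mul]; exact Ideal.mul_mem_left _ _ (Ideal.mem_comap.mp h))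
  have hPc0 : ¬ (PowerSeries.C P.P : IwasawaAlgebra₂ p) ∣ c := fun h => hPc (h.mul_right _)
  -- `C P ∤ F` (else `F ~ C P` and `P ∈ 𝔓 ∩ ℤ_p⟦T₂⟧`)
  have hPF : ¬ (PowerSeries.C P.P : IwasawaAlgebra₂ p) ∣ F := by
    rintro ⟨x, hx⟩
    have hdvd : F ∣ (PowerSeries.C P.P : IwasawaAlgebra₂ p) * x := ⟨1, by rw [mul_one, hx]⟩
    rcases hF.dvd_or_dvd hdvd with h1 | ⟨y, hy⟩
    · have hmem : P.P ∈ Ideal.comap (PowerSeries.C (R := IwasawaAlgebra p)) 𝔓.asIdeal := by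
        rw [Ideal.mem_comap, h𝔓F, Ideal.mem_span_singleton]
        exact h1
      rw [hnv, Ideal.mem_bot] at hmem
      exact P.prime.ne_zero hmem
    · have h1 : F * 1 = F * ((PowerSeries.C P.P : IwasawaAlgebra₂ p) * y) := by
        rw [mul_one]
        nth_rw 1 [hx]
        rw [hy]
        ring
      exact P.prime_C.not_unit (IsUnit.of_mul_eq_one y (mul_left_cancel₀ hF.ne_zero h1).symm)
  -- the good-point inequality
  have hle := lengthAt_le_of_goodPointS S P hu₀ hr X hc0 hcX hPc0 hF hPF g 𝔔₂ hCP hF2 hp2 hG₁2 hFBt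
  have hfin : Module.lengthAt (IwasawaAlgebra₂ p) X
      ⟨Ideal.span {F}, (Ideal.span_singleton_prime hF.ne_zero).mpr hF⟩ ≠ ⊤ :=
    ne_top_of_le_ne_top (ENat.coe_ne_top g) hle
  rw [hpt]
  have hk : (Module.lengthAt (IwasawaAlgebra₂ p) X
      ⟨Ideal.span {F}, (Ideal.span_singleton_prime hF.ne_zero).mpr hF⟩).toNat ≤ g :=
    ENat.toNat_le_of_le_coe hle
  refine ⟨Ideal.span {F ^ (g - (Module.lengthAt (IwasawaAlgebra₂ p) X
      ⟨Ideal.span {F}, (Ideal.span_singleton_prime hF.ne_zero).mpr hF⟩).toNat) * G₁}, ?_⟩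
  rw [hGfac, Ideal.span_singleton_pow, Ideal.span_singleton_mul_span_singleton, ← mul_assoc, ← pow_add,
    Nat.add_sub_cancel' hk]

/-- `engine_of_dvd` with the non-vertical primes served by `nonvertical_dvd` (no `PatchingBeta`, no `hnv`). -/
theorem engine_of_dvd3 (X : Type) [AddCommGroup X] [Module (IwasawaAlgebra₂ p) X]
    [Module.Finite (IwasawaAlgebra₂ p) X] (G : IwasawaAlgebra₂ p)
    (hPT : PatchingTarget p X G) (hGP : GoodPointExists p)
    (hT : Module.IsTorsion (IwasawaAlgebra₂ p) X) (hQ1 : DepthFibreBoundsDVR p X G)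
    (hv : ∀ P : GoodPrime p, FibreTorsionAt p P X ∨
      (PowerSeries.C P.P : IwasawaAlgebra₂ p) ^ (Module.lengthAt (IwasawaAlgebra₂ p) X P.pt).toNat ∣ G) :
    ∃ a : ℕ, Ideal.span {(p : IwasawaAlgebra₂ p) ^ a * G} ≤
      Literature.NumberTheory.EllipticCurves.Module.charIdeal (IwasawaAlgebra₂ p) X := by
  classical
  refine hPT hT fun 𝔓 hht hp𝔓 => ?_
  by_cases hvert : Ideal.comap (PowerSeries.C (R := IwasawaAlgebra p)) 𝔓.asIdeal = ⊥
  · exact nonvertical_dvd X G hGP hT hQ1 𝔓 hht hvert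
  obtain ⟨P, rfl⟩ := exists_goodPrime_of_comap_ne_bot 𝔓 hht hp𝔓 hvert
  have goal_of : ∀ {k : ℕ} {H : IwasawaAlgebra₂ p}, (PowerSeries.C P.P : IwasawaAlgebra₂ p) ^ k ∣ H →
      P.pt.asIdeal ^ k ∣ Ideal.span {H} := fun {k H} ⟨K, hK⟩ =>
    ⟨Ideal.span {K}, by
      rw [hK, GoodPrime.pt_asIdeal, Ideal.span_singleton_pow, Ideal.span_singleton_mul_span_singleton]⟩
  rcases hv P with ⟨s, hs, hsX⟩ | hdvd
  · have h0 : Module.lengthAt (IwasawaAlgebra₂ p) X P.pt = 0 :=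
      lengthAt_eq_zero_of_fibre_torsion (M := X) P.prime_C hs hsX
    rw [h0]
    simp
  · exact goal_of hdvd

/-- **THE THIRD DOOR (g17″, PROVED algebra).** `PatchingTarget` (PROVED, `patchingTarget_holds`) + **(GP)**
(PROVED in the sketch) + Kato-line torsion + `DepthFibreBoundsDVR` ⟹ `(p^a · G) ⊆ ch_{Λ₂}(X)`.
No `PatchingBeta`, no `hnv`, no root data, no twists / (UNIF) / `VFamily` / (FT) / (LB): the DVR-class fibre
bounds serve BOTH the vertical primes (§E9, via `engine_of_dvd3`'s second disjunct exactly as in `engine_doorS`)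
AND the non-vertical ones (§E11, `nonvertical_dvd`). -/
theorem engine_door3 (X : Type) [AddCommGroup X] [Module (IwasawaAlgebra₂ p) X]
    [Module.Finite (IwasawaAlgebra₂ p) X] (G : IwasawaAlgebra₂ p)
    (hPT : PatchingTarget p X G) (hGP : GoodPointExists p)
    (hKato : Module.IsTorsion
      (IwasawaAlgebra₂ p ⧸ Ideal.span {(PowerSeries.C PowerSeries.X : IwasawaAlgebra₂ p)})
      (QuotSMulTop (PowerSeries.C PowerSeries.X : IwasawaAlgebra₂ p) X))
    (hQ1 : DepthFibreBoundsDVR p X G) :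
    ∃ a : ℕ, Ideal.span {(p : IwasawaAlgebra₂ p) ^ a * G} ≤
      Literature.NumberTheory.EllipticCurves.Module.charIdeal (IwasawaAlgebra₂ p) X := by
  classical
  have hFTk := fibreTorsionAt_of_isTorsion (katoLine p) X hKato
  have hT : Module.IsTorsion (IwasawaAlgebra₂ p) X := isTorsion_of_fibreTorsionAt' (katoLine p) X hFTk
  refine engine_of_dvd3 X G hPT hGP hT hQ1 fun P => ?_
  by_cases hPX : Associated P.P PowerSeries.X
  · exact Or.inl (fibreTorsionAt_of_associated (katoLine p) P hPX.symm X hFTk)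
  right
  obtain ⟨c, hc, hc0⟩ := Submodule.exists_mem_ne_zero_of_ne_bot (Module.annihilator_ne_bot_of_isTorsion X hT)
  have hcX : ∀ x : X, c • x = 0 := fun x => Module.mem_annihilator.mp hc x
  obtain ⟨S, _, _, _, _, _, _, _, u₀, hu₀, hr⟩ := rootDatumS P
  obtain ⟨F, z, hz, hF⟩ := hQ1
  -- `u₀ ≠ 0` (else `T₂ ∣ P`, i.e. `P ~ T₂`)
  have hu0 : u₀ ≠ 0 := by
    intro h0
    apply hPX
    have h1 := (evS_eq_zero_iff hu₀ _).mp hr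
    rw [h0, map_zero, sub_zero, PowerSeries.X_dvd_iff, ← PowerSeries.coeff_zero_eq_constantCoeff_apply,
      PowerSeries.coeff_map] at h1
    have h2 : PowerSeries.constantCoeff P.P = 0 := by
      rw [← PowerSeries.coeff_zero_eq_constantCoeff_apply]
      exact algebraMap_injectiveS S (by rw [h1, map_zero])
    exact (PowerSeries.X_prime.associated_of_dvd P.prime (PowerSeries.X_dvd_iff.mpr h2)).symm
  -- depth constancy along `u₀ + p^{N+1}` and the isolated zeros of `z`
  obtain ⟨d, hd⟩ := exists_pow_p_mem_spanS (p := p) S hu0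
  have hzS : ((z.map (algebraMap ℤ_[p] S) : Polynomial S) : PowerSeries S) ≠ 0 := by
    rw [Ne, Polynomial.coe_eq_zero_iff, Polynomial.map_eq_zero_iff (algebraMap_injectiveS S)]
    exact hz
  obtain ⟨N₁, hN₁⟩ := eventually_evS_ne_zero (p := p) hu₀ hzS
  refine GoodPrime.C_pow_dvd_of_root P X G hc0 hcX hu₀ hr (max d N₁)
    (F (Nat.card (S ⧸ Ideal.span {u₀})) (Module.finrank ℤ_[p] S)) fun N hN => ?_
  have hspan : Ideal.span {u₀ + (p : S) ^ (N + 1)} = Ideal.span {u₀} := by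
    have h := span_add_eqS S hd (Nat.succ_le_succ ((le_max_left _ _).trans hN)) (1 : S)
    rwa [mul_one] at h
  have hz' : Polynomial.aeval (u₀ + (p : S) ^ (N + 1)) z ≠ 0 := by
    rw [← Polynomial.eval_map_algebraMap, ← evS_coe (approx_mem (p := p) S hu₀ N)]
    exact hN₁ N ((le_max_right _ _).trans hN)
  obtain ⟨t, ht, hFB⟩ := hF S (u₀ + (p : S) ^ (N + 1)) (approx_mem (p := p) S hu₀ N) hz'
  rw [hspan] at ht
  exact ⟨t, ht, hFB⟩

end Door3

/-! ## E12. (F-h) THE ERL CONSTANT: door 3 for a supplier that carries `h` (critic V#23n (b)/(c))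

A supplier assembled from a two-variable explicit reciprocity law with constant `h ∈ Λ₂` (sketch §(h)
`TwoVariableReciprocity.h`, where only `h ≠ 0` is typed) and a fibrewise Kolyvagin-system bound proves the binder
for `h * G`, not for `G`. Door 3 then gives `(p^a · h · G) ⊆ ch(X)`; this decides the crux shape EXACTLY when `h` is
a power of `p` up to a unit (the f-dominant, `I_𝐠`-free normalisation), and in general yields divisibility away from
the divisor `W` of `h` (`h ~ p^m · W`; for the g-dominant normalisation `W = C V`, `V ∈ Λ₁` the congruence power
series — VERTICAL, so at every interior zero of `V` the slack `p^t` of `DepthFibreBoundsDVR p X G` itself would have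
to absorb `v_S(V(u))`, which is unbounded at frozen depth: V#23n (b)). The typed field a (KS-Ind-S) supplier must
decide is therefore `hh : ∃ m, Associated h (p^m * W)` — with `W = 1` the target. -/

section DoorH

variable {p : ℕ} [Fact p.Prime]

/-- **Door 3 with an ERL constant.** If the binder is supplied for `h * G` and `h ~ p^m · W`, then
`∃ a, (p^a · W · G) ⊆ ch_{Λ₂}(X)`. -/
theorem engine_door3_of_associated (X : Type) [AddCommGroup X] [Module (IwasawaAlgebra₂ p) X]
    [Module.Finite (IwasawaAlgebra₂ p) X] (G h W : IwasawaAlgebra₂ p)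
    (hh : ∃ m : ℕ, Associated h ((p : IwasawaAlgebra₂ p) ^ m * W))
    (hPT : PatchingTarget p X (h * G)) (hGP : GoodPointExists p)
    (hKato : Module.IsTorsion
      (IwasawaAlgebra₂ p ⧸ Ideal.span {(PowerSeries.C PowerSeries.X : IwasawaAlgebra₂ p)})
      (QuotSMulTop (PowerSeries.C PowerSeries.X : IwasawaAlgebra₂ p) X))
    (hQ1 : DepthFibreBoundsDVR p X (h * G)) :
    ∃ a : ℕ, Ideal.span {(p : IwasawaAlgebra₂ p) ^ a * (W * G)} ≤
      Literature.NumberTheory.EllipticCurves.Module.charIdeal (IwasawaAlgebra₂ p) X := by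
  obtain ⟨a, ha⟩ := engine_door3 X (h * G) hPT hGP hKato hQ1
  obtain ⟨m, u, hu⟩ := hh
  refine ⟨a + m, ?_⟩
  have hAss : Associated ((p : IwasawaAlgebra₂ p) ^ a * (h * G))
      ((p : IwasawaAlgebra₂ p) ^ (a + m) * (W * G)) := by
    refine ⟨u, ?_⟩
    have h1 : (p : IwasawaAlgebra₂ p) ^ (a + m) * (W * G) = (p : IwasawaAlgebra₂ p) ^ a * (h * ↑u) * G := by
      rw [hu]; ring
    rw [h1]; ring
  rwa [Ideal.span_singleton_eq_span_singleton.mpr hAss] at ha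

/-- **(F-h), f-dominant case**: `h ~ p^m` (no vertical factor) — the binder for `h * G` decides the crux
shape for `G` itself. -/
theorem engine_door3_of_associated_pow (X : Type) [AddCommGroup X] [Module (IwasawaAlgebra₂ p) X]
    [Module.Finite (IwasawaAlgebra₂ p) X] (G h : IwasawaAlgebra₂ p)
    (hh : ∃ m : ℕ, Associated h ((p : IwasawaAlgebra₂ p) ^ m))
    (hPT : PatchingTarget p X (h * G)) (hGP : GoodPointExists p)
    (hKato : Module.IsTorsion
      (IwasawaAlgebra₂ p ⧸ Ideal.span {(PowerSeries.C PowerSeries.X : IwasawaAlgebra₂ p)})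
      (QuotSMulTop (PowerSeries.C PowerSeries.X : IwasawaAlgebra₂ p) X))
    (hQ1 : DepthFibreBoundsDVR p X (h * G)) :
    ∃ a : ℕ, Ideal.span {(p : IwasawaAlgebra₂ p) ^ a * G} ≤
      Literature.NumberTheory.EllipticCurves.Module.charIdeal (IwasawaAlgebra₂ p) X := by
  have hh' : ∃ m : ℕ, Associated h ((p : IwasawaAlgebra₂ p) ^ m * 1) := by simpa using hh
  simpa using engine_door3_of_associated X G h 1 hh' hPT hGP hKato hQ1

end DoorH

/-! ## E13 (v1.2, g18). DOOR 4 — THE KATO LINE FROM THE BOTTOM LAYER (PROVED algebra)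

(7) Kato-line torsion («`X/(T₂)X` is `Λ₂/(T₂) = ℤ_p⟦T₁⟧`-torsion», the input door 3 cannot reach from the
neighbouring fibres, §E8) follows from the BOTTOM LAYER ALONE: if `p^k · X ⊆ (T₁,T₂) · X` (**(BOT)**
`BottomPTorsion`; for f.g. `X` iff `X/(T₁,T₂)X` is finite, cf. `bottomPTorsion_of_finite`), then `X/(T₂)X` is
torsion over the domain `Λ₂/(T₂)`: Cayley–Hamilton for `p^k•` on `X/(T₂)X` (range inside `T̄₁·(X/(T₂)X)`) gives a
monic `d = p^{kn} + (T̄₁-multiples)` killing it, and `d ≠ 0` since `ev_{(0,0)} = constantCoeff ∘ constantCoeff`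
kills `(T₁,T₂)` but no power of `p` (`isTorsion_of_forall_smul_mem`, generic in the ideal `I` and the element `s`
with `s^n ∉ I`). `engine_door4` = `engine_door3` with `hKato` replaced by (BOT); `engine_door4_of_associated[_pow]`
= the (F-h) forms of §E12; §E13b translates (BOT) for `X_Gr₂` into «`p^k` kills `Sel_{∅,0}(K̃_∞,E[p^∞])^{Γ_K}`»
(Pontryagin, PROVED) — the statement the dossier `KatoLine.md` door (7-bot) supplies from bottom-layer control +
FINITENESS of `Sel_{𝔭-rel,𝔭̄-str}(E/K)[p^∞]` (a theorem in analytic rank one over `K`: Gross–Zagier–Kolyvagin +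
Poitou–Tate; no `p`-adic `L`-function / Coleman map / reciprocity law / main conjecture). In analytic rank `≥ 3`
over `K` (BOT) fails while (7) is still expected: door 4 is silent there, as are doors (7-cyc)/(7-ac). -/

section KatoBottom

variable {p : ℕ} [Fact p.Prime]

/-- **Cayley–Hamilton torsion test (generic).** Over a domain `R`, a f.g. module `M` with `s • M ⊆ I • M`
for an `s` NO POWER of which lies in the ideal `I` is torsion: the characteristic polynomial of `s•` gives
`d = s^n + (I-multiples)` with `d • M = 0`, `d ≠ 0` (cf. §E8 `isTorsion_of_fibreTorsionAt'`: `I` prime). -/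
theorem isTorsion_of_forall_smul_mem {R : Type*} [CommRing R] [IsDomain R] {M : Type*} [AddCommGroup M]
    [Module R M] [Module.Finite R M] (I : Ideal R) (s : R) (hs : ∀ n : ℕ, s ^ n ∉ I)
    (h : ∀ x : M, s • x ∈ I • (⊤ : Submodule R M)) : Module.IsTorsion R M := by
  classical
  let f : Module.End R M := algebraMap R (Module.End R M) s
  have hf : LinearMap.range f ≤ I • ⊤ := by
    rintro _ ⟨x, rfl⟩
    rw [Module.algebraMap_end_apply]
    exact h x
  obtain ⟨q, hmonic, -, hcoeff, hq⟩ :=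
    LinearMap.exists_monic_and_natDegree_eq_and_coeff_mem_pow_and_aeval_eq_zero R f I hf
  set d : R := q.eval s with hd
  have hdX : ∀ x : M, d • x = 0 := by
    intro x
    have h1 : Polynomial.aeval f q = algebraMap R (Module.End R M) d :=
      Polynomial.aeval_algebraMap_apply_eq_algebraMap_eval s q
    have h2 := congrArg (fun g : Module.End R M => g x) hq
    simpa only [h1, Module.algebraMap_end_apply, LinearMap.zero_apply] using h2
  -- `d - s^n ∈ I`
  have hdiff : d - s ^ q.natDegree ∈ I := by
    rw [hd, Polynomial.eval_eq_sum_range, Finset.sum_range_succ, hmonic.coeff_natDegree, one_mul,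
      add_sub_cancel_right]
    refine I.sum_mem fun k hk => ?_
    have hk' : k < q.natDegree := Finset.mem_range.mp hk
    exact I.mul_mem_right _ (Ideal.pow_le_self (by omega) (hcoeff k))
  have hdne : d ≠ 0 := by
    intro h0
    have h2 := I.neg_mem hdiff
    rw [h0, zero_sub, neg_neg] at h2
    exact hs _ h2
  intro x
  exact ⟨⟨d, mem_nonZeroDivisors_of_ne_zero hdne⟩, hdX x⟩

variable (p) in
/-- **(BOT) bottom-layer `p`-torsion**: `p^k · X ⊆ (T₂, T₁) · X` for some `k` — `X/(T₁,T₂)X` is killed by a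
power of `p` (for f.g. `X`: iff finite, `bottomPTorsion_of_finite`; for `X_Gr₂`: §E13b, dossier `KatoLine.md`). -/
def BottomPTorsion (X : Type) [AddCommGroup X] [Module (IwasawaAlgebra₂ p) X] : Prop :=
  ∃ k : ℕ, ∀ x : X, ((p : IwasawaAlgebra₂ p) ^ k) • x ∈
    (Ideal.span {(PowerSeries.C PowerSeries.X : IwasawaAlgebra₂ p), (PowerSeries.X : IwasawaAlgebra₂ p)}) •
      (⊤ : Submodule (IwasawaAlgebra₂ p) X)

/-- (BOT) from the elementary form `p^k · x = T₂ · y + T₁ · z`. -/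
theorem bottomPTorsion_of_exists (X : Type) [AddCommGroup X] [Module (IwasawaAlgebra₂ p) X]
    (h : ∃ k : ℕ, ∀ x : X, ∃ y z : X, ((p : IwasawaAlgebra₂ p) ^ k) • x =
      (PowerSeries.C PowerSeries.X : IwasawaAlgebra₂ p) • y + (PowerSeries.X : IwasawaAlgebra₂ p) • z) :
    BottomPTorsion p X := by
  obtain ⟨k, hk⟩ := h
  refine ⟨k, fun x => ?_⟩
  obtain ⟨y, z, hxyz⟩ := hk x
  rw [hxyz]
  exact Submodule.add_mem _
    (Submodule.smul_mem_smul (Ideal.subset_span (Set.mem_insert _ _)) Submodule.mem_top)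
    (Submodule.smul_mem_smul (Ideal.subset_span (Set.mem_insert_of_mem _ rfl)) Submodule.mem_top)

/-- (BOT) from FINITENESS of the bottom quotient `X/(T₁,T₂)X`: its cardinality `p^v · m` (`p ∤ m`) kills it,
and `m` is a unit of `ℤ_p ⊆ Λ₂`. (No finite generation needed.) -/
theorem bottomPTorsion_of_finite (X : Type) [AddCommGroup X] [Module (IwasawaAlgebra₂ p) X]
    (hfin : Finite (X ⧸ ((Ideal.span {(PowerSeries.C PowerSeries.X : IwasawaAlgebra₂ p),
      (PowerSeries.X : IwasawaAlgebra₂ p)}) • (⊤ : Submodule (IwasawaAlgebra₂ p) X)))) :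
    BottomPTorsion p X := by
  classical
  set J : Ideal (IwasawaAlgebra₂ p) :=
    Ideal.span {(PowerSeries.C PowerSeries.X : IwasawaAlgebra₂ p), (PowerSeries.X : IwasawaAlgebra₂ p)} with hJ
  have hp : p.Prime := Fact.out
  have hN0 : Nat.card (X ⧸ (J • (⊤ : Submodule (IwasawaAlgebra₂ p) X))) ≠ 0 := Nat.card_pos.ne'
  obtain ⟨v, m, hm, hN⟩ := Nat.exists_eq_pow_mul_and_not_dvd hN0 p hp.ne_one
  -- `m` is a unit of `ℤ_p`, hence of `Λ₂`
  have hmu : IsUnit (m : IwasawaAlgebra₂ p) := by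
    have h1 : IsUnit (m : ℤ_[p]) :=
      PadicInt.isUnit_iff.mpr (PadicInt.norm_natCast_eq_one_iff.mpr ((Nat.Prime.coprime_iff_not_dvd hp).mpr hm))
    have h2 := h1.map ((PowerSeries.C (R := IwasawaAlgebra p)).comp (PowerSeries.C (R := ℤ_[p])))
    rwa [map_natCast] at h2
  refine ⟨v, fun x => ?_⟩
  rw [← Submodule.Quotient.mk_eq_zero, Submodule.Quotient.mk_smul]
  have hq : (Nat.card (X ⧸ (J • (⊤ : Submodule (IwasawaAlgebra₂ p) X)))) •
      (Submodule.Quotient.mk x : X ⧸ (J • (⊤ : Submodule (IwasawaAlgebra₂ p) X))) = 0 :=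
    card_nsmul_eq_zero'
  rw [hN, ← Nat.cast_smul_eq_nsmul (IwasawaAlgebra₂ p), Nat.cast_mul, Nat.cast_pow, mul_comm, mul_smul,
    hmu.smul_eq_zero] at hq
  exact hq

/-- **DOOR 4, core: (BOT) ⟹ (7) Kato-line torsion.** If `p^k · X ⊆ (T₁,T₂) · X`, the Kato fibre `X/(T₂)X` is
`Λ₂/(T₂)`-torsion (Cayley–Hamilton for `p^k•`, range in `T̄₁ · X/(T₂)X`; `p^{kn} ∉ (T₁,T₂)` by `ev_{(0,0)}`). -/
theorem isTorsion_katoFibre_of_bottomPTorsion (X : Type) [AddCommGroup X] [Module (IwasawaAlgebra₂ p) X]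
    [Module.Finite (IwasawaAlgebra₂ p) X] (hbot : BottomPTorsion p X) :
    Module.IsTorsion
      (IwasawaAlgebra₂ p ⧸ Ideal.span {(PowerSeries.C PowerSeries.X : IwasawaAlgebra₂ p)})
      (QuotSMulTop (PowerSeries.C PowerSeries.X : IwasawaAlgebra₂ p) X) := by
  classical
  have hπ : Prime (PowerSeries.C PowerSeries.X : IwasawaAlgebra₂ p) := (katoLine p).prime_C
  obtain ⟨k, hk⟩ := hbot
  set π : IwasawaAlgebra₂ p := PowerSeries.C PowerSeries.X with hπdef
  haveI hIp : (Ideal.span {π}).IsPrime := (Ideal.span_singleton_prime hπ.ne_zero).mpr hπ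
  haveI : IsScalarTower (IwasawaAlgebra₂ p) (IwasawaAlgebra₂ p ⧸ Ideal.span {π}) (QuotSMulTop π X) :=
    ⟨fun r' a x => by
      obtain ⟨a, rfl⟩ := Ideal.Quotient.mk_surjective a
      obtain ⟨x, rfl⟩ := Submodule.mkQ_surjective _ x
      show (r' * a) • (Submodule.Quotient.mk x : QuotSMulTop π X) =
        r' • a • (Submodule.Quotient.mk x : QuotSMulTop π X)
      rw [mul_smul]⟩
  haveI : Module.Finite (IwasawaAlgebra₂ p ⧸ Ideal.span {π}) (QuotSMulTop π X) :=
    Module.Finite.of_restrictScalars_finite (IwasawaAlgebra₂ p) _ _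
  -- the augmentation ideal `J = (T₂, T₁)` and its image `I = (T̄₁)` in `Λ₂/(T₂)`
  set J : Ideal (IwasawaAlgebra₂ p) := Ideal.span {π, (PowerSeries.X : IwasawaAlgebra₂ p)} with hJ
  have hle : Ideal.span {π} ≤ J := Ideal.span_mono (Set.singleton_subset_iff.mpr (Set.mem_insert _ _))
  set I : Ideal (IwasawaAlgebra₂ p ⧸ Ideal.span {π}) := J.map (Ideal.Quotient.mk (Ideal.span {π})) with hI
  -- `ev_{(0,0)} = constantCoeff ∘ constantCoeff` kills `J` but no power of `p`
  let ev₀₀ : IwasawaAlgebra₂ p →+* ℤ_[p] :=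
    (PowerSeries.constantCoeff (R := ℤ_[p])).comp (PowerSeries.constantCoeff (R := IwasawaAlgebra p))
  have hJker : J ≤ RingHom.ker ev₀₀ := by
    rw [hJ, Ideal.span_le]
    rintro a ha
    rcases ha with rfl | ha
    · simp [ev₀₀, hπdef]
    · rw [Set.mem_singleton_iff] at ha
      subst ha
      simp [ev₀₀]
  have hs : ∀ n : ℕ, (Ideal.Quotient.mk (Ideal.span {π}) ((p : IwasawaAlgebra₂ p) ^ k)) ^ n ∉ I := by
    intro n hn
    rw [← map_pow, hI, Ideal.mem_quotient_iff_mem hle] at hn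
    have h0 : ev₀₀ (((p : IwasawaAlgebra₂ p) ^ k) ^ n) = 0 := hJker hn
    rw [map_pow, map_pow, map_natCast] at h0
    exact pow_ne_zero n (pow_ne_zero k (Nat.cast_ne_zero.mpr (Fact.out : p.Prime).ne_zero)) h0
  refine isTorsion_of_forall_smul_mem I (Ideal.Quotient.mk (Ideal.span {π}) ((p : IwasawaAlgebra₂ p) ^ k))
    hs fun xb => ?_
  obtain ⟨x, rfl⟩ := Submodule.mkQ_surjective _ xb
  have e1 : (Ideal.Quotient.mk (Ideal.span {π}) ((p : IwasawaAlgebra₂ p) ^ k)) •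
      (Submodule.mkQ (π • (⊤ : Submodule (IwasawaAlgebra₂ p) X)) x : QuotSMulTop π X) =
      Submodule.mkQ (π • (⊤ : Submodule (IwasawaAlgebra₂ p) X)) ((((p : IwasawaAlgebra₂ p) ^ k)) • x) := rfl
  rw [e1]
  refine Submodule.smul_induction_on (p := fun w : X =>
      (Submodule.mkQ (π • (⊤ : Submodule (IwasawaAlgebra₂ p) X)) w : QuotSMulTop π X) ∈
        I • (⊤ : Submodule (IwasawaAlgebra₂ p ⧸ Ideal.span {π}) (QuotSMulTop π X))) (hk x) ?_ ?_
  · intro r hr n _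
    rw [Submodule.mkQ_apply, Submodule.Quotient.mk_smul]
    change (Ideal.Quotient.mk (Ideal.span {π}) r) • (Submodule.Quotient.mk n : QuotSMulTop π X) ∈ _
    exact Submodule.smul_mem_smul (Ideal.mem_map_of_mem _ hr) Submodule.mem_top
  · intro a b ha hb
    rw [map_add]
    exact Submodule.add_mem _ ha hb

/-- **THE FOURTH DOOR (g18, PROVED algebra).** `PatchingTarget` + **(GP)** (both PROVED in the sketch) + **(BOT)**
+ `DepthFibreBoundsDVR` ⟹ `(p^a · G) ⊆ ch_{Λ₂}(X)`: door 3 with `hKato` discharged from the bottom layer. -/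
theorem engine_door4 (X : Type) [AddCommGroup X] [Module (IwasawaAlgebra₂ p) X]
    [Module.Finite (IwasawaAlgebra₂ p) X] (G : IwasawaAlgebra₂ p)
    (hPT : PatchingTarget p X G) (hGP : GoodPointExists p) (hbot : BottomPTorsion p X)
    (hQ1 : DepthFibreBoundsDVR p X G) :
    ∃ a : ℕ, Ideal.span {(p : IwasawaAlgebra₂ p) ^ a * G} ≤
      Literature.NumberTheory.EllipticCurves.Module.charIdeal (IwasawaAlgebra₂ p) X :=
  engine_door3 X G hPT hGP (isTorsion_katoFibre_of_bottomPTorsion X hbot) hQ1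

/-- Door 4 with an ERL constant `h ~ p^m · W` (§E12 shape): `∃ a, (p^a · W · G) ⊆ ch_{Λ₂}(X)`. -/
theorem engine_door4_of_associated (X : Type) [AddCommGroup X] [Module (IwasawaAlgebra₂ p) X]
    [Module.Finite (IwasawaAlgebra₂ p) X] (G h W : IwasawaAlgebra₂ p)
    (hh : ∃ m : ℕ, Associated h ((p : IwasawaAlgebra₂ p) ^ m * W))
    (hPT : PatchingTarget p X (h * G)) (hGP : GoodPointExists p) (hbot : BottomPTorsion p X)
    (hQ1 : DepthFibreBoundsDVR p X (h * G)) :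
    ∃ a : ℕ, Ideal.span {(p : IwasawaAlgebra₂ p) ^ a * (W * G)} ≤
      Literature.NumberTheory.EllipticCurves.Module.charIdeal (IwasawaAlgebra₂ p) X :=
  engine_door3_of_associated X G h W hh hPT hGP (isTorsion_katoFibre_of_bottomPTorsion X hbot) hQ1

/-- Door 4, f-dominant (F-h) `h ~ p^m`: the binder for `h * G` and (BOT) give the crux shape for `G`. -/
theorem engine_door4_of_associated_pow (X : Type) [AddCommGroup X] [Module (IwasawaAlgebra₂ p) X]
    [Module.Finite (IwasawaAlgebra₂ p) X] (G h : IwasawaAlgebra₂ p)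
    (hh : ∃ m : ℕ, Associated h ((p : IwasawaAlgebra₂ p) ^ m))
    (hPT : PatchingTarget p X (h * G)) (hGP : GoodPointExists p) (hbot : BottomPTorsion p X)
    (hQ1 : DepthFibreBoundsDVR p X (h * G)) :
    ∃ a : ℕ, Ideal.span {(p : IwasawaAlgebra₂ p) ^ a * G} ≤
      Literature.NumberTheory.EllipticCurves.Module.charIdeal (IwasawaAlgebra₂ p) X :=
  engine_door3_of_associated_pow X G h hh hPT hGP (isTorsion_katoFibre_of_bottomPTorsion X hbot) hQ1

end KatoBottom

section KatoBottomSelmer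

/-! ### E13b. (BOT) for `X_Gr₂` in Selmer terms (Pontryagin step, PROVED) and door 4 for `X_Gr₂`

`X_Gr₂ = Hom(Sel, ℚ/ℤ)`, `Sel = Sel_{∅,0}(K̃_∞, E[p^∞]) = unrSelmer₂`, `T₁ = γ₁ - 1`, `T₂ = γ₂ - 1`
(`WeierstrassCurve.XGr₂`, `X_smul_apply`, `CX_smul_apply`). If `p^k · Sel^{γ₁,γ₂} = 0` then (BOT) holds for
`X_Gr₂`: `p^k·x` vanishes on `ker δ = Sel^{γ₁,γ₂}` (`δ = (γ₁-1, γ₂-1) : Sel → Sel × Sel`), so it factors through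
`δ(Sel) ⊆ Sel × Sel` and extends to `ỹ = (z, y) ∈ Hom(Sel × Sel, ℚ/ℤ)` (`ℚ/ℤ` injective,
`CharacterModule.dual_surjective_of_injective`), i.e. `p^k·x = T₂·y + T₁·z`. -/

open NumberField IsDedekindDomain Field
open Literature.NumberTheory.GaloisRepresentations Literature.NumberTheory.EllipticCurves.TwoVariableSelmer

variable {p : ℕ} [Fact p.Prime]

/-- **(BOT) for `X_Gr₂` from the invariants**: if `p^k · Sel_{∅,0}(K̃_∞, E[p^∞])^{⟨γ₁,γ₂⟩} = 0` then
`p^k · X_Gr₂ ⊆ (T₁, T₂) · X_Gr₂` (Pontryagin duality; `ℚ/ℤ` divisible). -/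
theorem XGr₂_bottomPTorsion_of_invariants {K : Type} [Field K] [NumberField K] (W : WeierstrassCurve K)
    (κ₁ κ₂ : ZpExtension K p) (vbar : HeightOneSpectrum (𝓞 K)) (γ₁ γ₂ : Field.absoluteGaloisGroup K)
    [Fact (ZpExtension.IsTopGeneratorPair κ₁ κ₂ γ₁ γ₂)] (k : ℕ)
    (hfix : ∀ s : unrSelmer₂ κ₁ κ₂ (W.geomPrimaryTorsion p) vbar,
      conjSel₂ κ₁ κ₂ (W.geomPrimaryTorsion p) vbar γ₁ s = s →
      conjSel₂ κ₁ κ₂ (W.geomPrimaryTorsion p) vbar γ₂ s = s → p ^ k • s = 0) :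
    BottomPTorsion p (W.XGr₂ p κ₁ κ₂ vbar γ₁ γ₂) := by
  classical
  refine bottomPTorsion_of_exists _ ⟨k, fun x => ?_⟩
  -- `δ = (γ₁ - 1, γ₂ - 1) : Sel → Sel × Sel` (kernel = invariants); `x' = p^k·x` dies on `ker δ`; extend to `Sel × Sel`
  let x₀ : unrSelmer₂ κ₁ κ₂ (W.geomPrimaryTorsion p) vbar →+ AddCircle (1 : ℚ) := x
  let δ : unrSelmer₂ κ₁ κ₂ (W.geomPrimaryTorsion p) vbar →+
      unrSelmer₂ κ₁ κ₂ (W.geomPrimaryTorsion p) vbar × unrSelmer₂ κ₁ κ₂ (W.geomPrimaryTorsion p) vbar :=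
    AddMonoidHom.prod
      (show unrSelmer₂ κ₁ κ₂ (W.geomPrimaryTorsion p) vbar →+ unrSelmer₂ κ₁ κ₂ (W.geomPrimaryTorsion p) vbar from
        (conjSel₂ κ₁ κ₂ (W.geomPrimaryTorsion p) vbar γ₁ - 1 :
          AddMonoid.End (unrSelmer₂ κ₁ κ₂ (W.geomPrimaryTorsion p) vbar)))
      (show unrSelmer₂ κ₁ κ₂ (W.geomPrimaryTorsion p) vbar →+ unrSelmer₂ κ₁ κ₂ (W.geomPrimaryTorsion p) vbar from
        (conjSel₂ κ₁ κ₂ (W.geomPrimaryTorsion p) vbar γ₂ - 1 :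
          AddMonoid.End (unrSelmer₂ κ₁ κ₂ (W.geomPrimaryTorsion p) vbar)))
  let x' : unrSelmer₂ κ₁ κ₂ (W.geomPrimaryTorsion p) vbar →+ AddCircle (1 : ℚ) := p ^ k • x₀
  have hδ : ∀ s, δ s = (conjSel₂ κ₁ κ₂ (W.geomPrimaryTorsion p) vbar γ₁ s - s,
      conjSel₂ κ₁ κ₂ (W.geomPrimaryTorsion p) vbar γ₂ s - s) := fun s => rfl
  have hx' : ∀ s, x' s = p ^ k • x₀ s := fun s => rfl
  have hker : δ.ker ≤ x'.ker := by
    intro s hs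
    rw [AddMonoidHom.mem_ker, hδ, Prod.mk_eq_zero, sub_eq_zero, sub_eq_zero] at hs
    rw [AddMonoidHom.mem_ker, hx', ← map_nsmul, hfix s hs.1 hs.2, map_zero]
  obtain ⟨ytilde, hy⟩ := CharacterModule.dual_surjective_of_injective
    (QuotientAddGroup.kerLift δ).toIntLinearMap (QuotientAddGroup.kerLift_injective δ)
    (QuotientAddGroup.lift δ.ker x' hker :
      CharacterModule (unrSelmer₂ κ₁ κ₂ (W.geomPrimaryTorsion p) vbar ⧸ δ.ker))
  let yt : unrSelmer₂ κ₁ κ₂ (W.geomPrimaryTorsion p) vbar × unrSelmer₂ κ₁ κ₂ (W.geomPrimaryTorsion p) vbar →+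
      AddCircle (1 : ℚ) := ytilde
  have hys : ∀ s, yt (δ s) = p ^ k • x₀ s := by
    intro s
    have h1 : (CharacterModule.dual (QuotientAddGroup.kerLift δ).toIntLinearMap ytilde)
        (s : unrSelmer₂ κ₁ κ₂ (W.geomPrimaryTorsion p) vbar ⧸ δ.ker) =
        QuotientAddGroup.lift δ.ker x' hker (s : unrSelmer₂ κ₁ κ₂ (W.geomPrimaryTorsion p) vbar ⧸ δ.ker) :=
      DFunLike.congr_fun hy _
    have h2 : (CharacterModule.dual (QuotientAddGroup.kerLift δ).toIntLinearMap ytilde)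
        (s : unrSelmer₂ κ₁ κ₂ (W.geomPrimaryTorsion p) vbar ⧸ δ.ker) = yt (δ s) := rfl
    have h3 : QuotientAddGroup.lift δ.ker x' hker (s : unrSelmer₂ κ₁ κ₂ (W.geomPrimaryTorsion p) vbar ⧸ δ.ker) =
        x' s := rfl
    rw [← h2, h1, h3, hx']
  have hsplit : ∀ u v : unrSelmer₂ κ₁ κ₂ (W.geomPrimaryTorsion p) vbar,
      yt (u, v) = yt (u, 0) + yt (0, v) := fun u v => by
    rw [← map_add, Prod.mk_add_mk, add_zero, zero_add]
  have hsub₁ : ∀ a b : unrSelmer₂ κ₁ κ₂ (W.geomPrimaryTorsion p) vbar,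
      yt (a - b, 0) = yt (a, 0) - yt (b, 0) := fun a b => by
    rw [← map_sub, Prod.mk_sub_mk, sub_zero]
  have hsub₂ : ∀ a b : unrSelmer₂ κ₁ κ₂ (W.geomPrimaryTorsion p) vbar,
      yt (0, a - b) = yt (0, a) - yt (0, b) := fun a b => by
    rw [← map_sub, Prod.mk_sub_mk, sub_zero]
  -- `y = ỹ ∘ inr` pairs with `T₂ = C X` (`γ₂ - 1`), `z = ỹ ∘ inl` with `T₁ = X` (`γ₁ - 1`)
  let y : W.XGr₂ p κ₁ κ₂ vbar γ₁ γ₂ := yt.comp (AddMonoidHom.inr _ _)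
  let z : W.XGr₂ p κ₁ κ₂ vbar γ₁ γ₂ := yt.comp (AddMonoidHom.inl _ _)
  refine ⟨y, z, DFunLike.ext _ _ fun s => ?_⟩
  rw [← Nat.cast_pow, Nat.cast_smul_eq_nsmul]
  show p ^ k • x₀ s = ((PowerSeries.C PowerSeries.X : IwasawaAlgebra₂ p) • y) s +
    ((PowerSeries.X : IwasawaAlgebra₂ p) • z) s
  rw [WeierstrassCurve.XGr₂.CX_smul_apply, WeierstrassCurve.XGr₂.X_smul_apply]
  show p ^ k • x₀ s =
    (yt (0, conjSel₂ κ₁ κ₂ (W.geomPrimaryTorsion p) vbar γ₂ s) - yt (0, s)) +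
      (yt (conjSel₂ κ₁ κ₂ (W.geomPrimaryTorsion p) vbar γ₁ s, 0) - yt (s, 0))
  rw [← hys, hδ, hsplit, hsub₁, hsub₂, add_comm]

/-- **DOOR 4 for `X_Gr₂ = Sel_{∅,0}(K̃_∞, E[p^∞])^∨`**: `PatchingTarget` + (GP) + «`p^k` kills
`Sel_{∅,0}(K̃_∞, E[p^∞])^{Γ_K}`» + `DepthFibreBoundsDVR` ⟹ `(p^a · G) ⊆ ch_{Λ₂}(X_Gr₂)` (= `XGr₂.charIdeal`).
No `p`-adic `L`-function / Coleman map / reciprocity law among the hypotheses; BSD is not proved here. -/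
theorem engine_door4_XGr₂ {K : Type} [Field K] [NumberField K] (W : WeierstrassCurve K)
    (κ₁ κ₂ : ZpExtension K p) (vbar : HeightOneSpectrum (𝓞 K)) (γ₁ γ₂ : Field.absoluteGaloisGroup K)
    [Fact (ZpExtension.IsTopGeneratorPair κ₁ κ₂ γ₁ γ₂)]
    [Module.Finite (IwasawaAlgebra₂ p) (W.XGr₂ p κ₁ κ₂ vbar γ₁ γ₂)] (G : IwasawaAlgebra₂ p)
    (hPT : PatchingTarget p (W.XGr₂ p κ₁ κ₂ vbar γ₁ γ₂) G) (hGP : GoodPointExists p) (k : ℕ)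
    (hfix : ∀ s : unrSelmer₂ κ₁ κ₂ (W.geomPrimaryTorsion p) vbar,
      conjSel₂ κ₁ κ₂ (W.geomPrimaryTorsion p) vbar γ₁ s = s →
      conjSel₂ κ₁ κ₂ (W.geomPrimaryTorsion p) vbar γ₂ s = s → p ^ k • s = 0)
    (hQ1 : DepthFibreBoundsDVR p (W.XGr₂ p κ₁ κ₂ vbar γ₁ γ₂) G) :
    ∃ a : ℕ, Ideal.span {(p : IwasawaAlgebra₂ p) ^ a * G} ≤
      WeierstrassCurve.XGr₂.charIdeal W p κ₁ κ₂ vbar γ₁ γ₂ :=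
  engine_door4 (W.XGr₂ p κ₁ κ₂ vbar γ₁ γ₂) G hPT hGP
    (XGr₂_bottomPTorsion_of_invariants W κ₁ κ₂ vbar γ₁ γ₂ k hfix) hQ1

end KatoBottomSelmer

end Summit.BirchSwinnertonDyer.BirchSwinnertonDyer.Cruxes.TwoVariableEulerSystemDivisibility.QtameDoor3
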